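import Mathlib
import Literature.NumberTheory.Sieve.TwoResidueSelbergSumExplicit
import Literature.NumberTheory.Sieve.RomanoffExplicitAllN
import Literature.NumberTheory.Sieve.ShnirelmanGoldbachTheorem
import Literature.Combinatorics.Additive.SchnirelmannBasisTheorem
import Literature.Combinatorics.Additive.MannTheorem
import Literature.NumberTheory.LFunctions.ChebyshevPsiExplicit
import HarnessLib

/-!
# An explicit Shnirel'man–Goldbach theorem: every integer `> 1` is a sum of at most `501` primes (`4329` → `1581` → `791` → `501`)

Topic `Literature/NumberTheory/Sieve`; namespace `Literature.NumberTheory.Sieve.ShnirelmanGoldbachExplicit`.  Cell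
`parity-ideate` seat p5, ROUND-23 «SCHNIRELMANN-ALLN» (`round23/SchnirelmannExplicit.lean` 8dfe305ac65bf6f9), landed with
statements and proofs verbatim (helpers `private`; §9's prime-counting input is the tree's
`RomanoffExplicit.primeCountingLowerMul_09212`); §10–§11 appended from ROUND-25 «ONE-THIRD» / ROUND-26 «HALVING»
(`round23/SchnirelmannExplicit.lean` 5e775b04e579685e, l.1356–2550, verbatim, helpers `private`); §12 appended from
ROUND-27 «THRESHOLD» (`round23/SchnirelmannExplicit.lean` 77cf9f0090e58100, l.2558–3173, verbatim, helpers `private`).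

## References
* [Nathanson1996] M. B. Nathanson, *Additive Number Theory: The Classical Bases*, GTM 164 (1996), §6.2 Theorem 6.3
  (Chebyshev), §7.3 Lemma 7.6, Lemma 7.7, Theorem 7.8, Theorem 7.9 (Goldbach–Shnirel'man).
* [Khinchin1952] A. Ya. Khinchin, *Three Pearls of Number Theory* (1952), Ch. II §4 (Mann's theorem).
* [RosserSchoenfeld1962] J. B. Rosser, L. Schoenfeld, Illinois J. Math. 6 (1962), Theorem 2, eq. (3.3).
* [Chebyshev1852] P. L. Chebyshev, *Mémoire sur les nombres premiers*, J. Math. Pures Appl. 17 (1852), §5.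
* [BatemanDiamond2004] P. T. Bateman, H. G. Diamond, *Analytic Number Theory: An Introductory Course* (2004), §13.4
  (13.13)–(13.14), Theorem 13.8 (pp. 325–328): the explicit large-sieve/Selberg step behind `explicit_of_largeSieve_kappa`.

The tree's `Literature.NumberTheory.Sieve.ShnirelmanGoldbachTheorem.shnirelman_goldbach` (Nathanson, *Additive Number
Theory: The Classical Bases*, GTM 164, Thm 7.9) is QUALITATIVE (`∃ h`) because ONE of its inputs is: Selberg's upper
bound `r(N) ≪ (N/log²N) Σ_{d∣N} 1/d` (Thm 7.2, `GoldbachSelbergUpperBound.goldbachCount_le_sum_divisors : ∃ C₁, …`).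
Here that input is replaced by the EXPLICIT two-residue Selberg bound of ROUND-22
(`TwoResidueSelbergExplicit.goldbachCount_le_kappa`: `r(N) ≤ 17.1·f(N)·N/log²N` for even `N ≥ e^47`,
`f(N) = ∏_{p∣N, p>2} (p−1)/(p−2)`), and Lemma 7.6 is re-derived from Mathlib's Chebyshev bound with the constant
`c₀ = 0.693` (instead of `1/256`). No named facts, fully proved; the only definition is the auxiliary local
factor `gFactor p = ((p−1)/(p−2))² − 1` of §3 (no instances, no notation).

* §1 `primeCountingLowerMul_0693 : 0.693·n/log n ≤ π(n)` (`n ≥ 2^30`), from Mathlib `Chebyshev.pi_ge`.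
* §2 first moment: `Σ_{N≤x} r(N) ≥ c₀²((x−x₁)²−x₁²)/(2 log²x)` from any `c₀ n/log n ≤ π(n)` (`n ≥ x₁`)
  (`sum_goldbachCount_ge_of_lower`; double counting `p + q ≤ x`).
* §3 mean square of the singular factor: `Σ_{even N ≤ x} f(N)² ≤ 1.329·x` (`sum_even_oddSingularFactor_sq_le`;
  `f² = Σ_{T ⊆ {p∣N, p>2}} ∏_{p∈T} g(p)`, `g(p) = ((p−1)/(p−2))² − 1`, and
  `∏_{p>2}(1 + g(p)/p) ≤ 2.658`).
* §4 second moment: `Σ_{N≤x} r(N)² ≤ 389·x³/log⁴x` for `x ≥ e^100` (`sum_goldbachCount_sq_le_explicit`).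
* §5 Cauchy–Schwarz: `#{N ≤ x : N = p + q} ≥ (c₁²/389)·x` for `x ≥ e^100` (`goldbach_count_ge_of_first_moment`);
  unconditionally `≥ x/6760`.
* §6 all `N ≥ 1`: `A(N) ≥ N/6760` for `A = {0,1} ∪ {p+q}` and `σ(A) ≥ 1/6760` (`schnirelmannDensity_goldbach_ge`).
* §7 `(1 − 1/6760)^4686 ≤ 1/2`, hence `(2·4686)A = ℕ` and every `N ≥ 2` is a sum of at most `4·4686 + 1 = 18745`
  primes (`schnirelmann_goldbach_explicit`).  Conditional column: `schnirelmann_goldbach_of_RS` (`≤ 4329`).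
* §8 with the tree's Mann theorem (`MannTheorem.min_one_add_le_schnirelmannDensity_add`): `min(1, hσ(A)) ≤ σ(hA)`,
  so `6760·A = ℕ` and every `N ≥ 2` is a sum of at most `2·6760 + 1 = 13521` primes
  (`schnirelmann_goldbach_explicit_mann`); conditional column `schnirelmann_goldbach_of_RS_mann` (`≤ 3121`).
* §9 with the tree's Chebyshev constant (`LFunctions.ChebyshevPsiExplicit`: `ψ(n) ≥ 0.921292·n − 5 log n`, `n ≥ 30`,
  the `1, 2, 3, 5, 30` argument): `c₀ = 0.9212` from `10^6`, `S₁ ≥ 0.424·x²/log²x`, `σ ≥ 1/2164`, and the file's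
  constant **`schnirelmann_goldbach_le_4329`**: every `N ≥ 2` is a sum of at most `4329` primes.
* §10 the factor `1/3`: the divisor-sum expansion of §3 run with the weight `N²` gives the weighted mean square
  `Σ_{even N ≤ x} N²·f(N)² ≤ 0.4431·x³` (`sum_even_sq_mul_oddSingularFactor_sq_le`; boundary terms by
  `1_{2d ≤ x} ≤ √x/10^{#{p∣d : p>100}}` and `harmonic_le_one_add_log`), hence `S₂ ≤ 142·x³/log⁴x`
  (`sum_goldbachCount_sq_le_142`, split at `x/e²`), `σ ≥ 1/790` and
  `schnirelmann_goldbach_le_1581`: every `N ≥ 2` is a sum of at most `1581` primes (conditional column `1141`).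
* §11 halving: every Goldbach number `≥ 4` is even, so Cauchy–Schwarz over even `N` (`Σ_{odd N≤x} r(N) ≤ 2(x+1)`)
  gives `x/790` EVEN Goldbach numbers in `(0, x]` (`goldbach_even_count_ge_790`), i.e. the halved set
  `B = {0,1} ∪ {m : 2m = p+q}` has `B(y) ≥ y/395` for all `y ≥ 1` (`half_count_ge_allN`: primes `p ∈ B` via
  `2p = p + p` below `e^100/2`) and `σ(B) ≥ 1/395` (`schnirelmannDensity_half_ge_395`); Mann: `395 • B = ℕ`;
  doubling `2n = Σ 2bᵢ` (`2·1 = 2` prime, `2m = p + q`; odd `N = 2(n−1) + 3`) gives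
  `schnirelmann_goldbach_le_791`: every `N ≥ 2` is a sum of at most `791` primes (conditional `571`).
* §12 the threshold: the tree's `explicit_of_largeSieve_kappa` is generic in `(Λ, A)` with `A(Λ) ↘ 13.2`; packaged as
  `goldbachCount_le_of_numeric`, instantiated at `Λ = 226` (`goldbachCount_le_1388`: `r(N) ≤ 13.88·f(N)·N/log²N`);
  the second moment made generic in the threshold (`sum_goldbachCount_sq_le_gen`) gives `S₂ ≤ 89.9·x³/log⁴x` for
  `x ≥ e^228` (`sum_goldbachCount_sq_le_899`), `x/500` even Goldbach numbers (`goldbach_even_count_ge_500`), the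
  all-`y` glue tolerating thresholds `Λ₀ ≤ 0.9212·h` (`half_count_ge_allN_gen`), `σ(B) ≥ 1/250` and the file's best
  unconditional constant **`schnirelmann_goldbach_le_501`**: every `N ≥ 2` is a sum of at most `501` primes
  (conditional column `379`, threshold `e^170`, `A = 14.13`).

Print calibration (NOT formalised, not used; Rassias, *Goldbach's Problem* (2017) p. 4, Ribenboim, *The Little Book
of Bigger Primes* (2004) p. 162): Shnirel'man 1930/1933 (`∃ K`), Klimov 1969 (`K ≤ 6·10⁹`, the first explicit value),
Klimov–Pil'tjaĭ–Šeptickaja 1972 (`115`), Klimov 1975 (`55`), Vaughan 1977 (`27`), Deshouillers 1977 (`26`),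
Riesel–Vaughan 1983 (`19`), Ramaré 1995 (every even `n` a sum of `≤ 6` primes), Helfgott 2013 (ternary Goldbach ⇒
`K ≤ 4`).  The constants here are those of the ELEMENTARY method with kernel-checked inputs, not a record in print.
-/

namespace Literature.NumberTheory.Sieve.ShnirelmanGoldbachExplicit

open Finset Real
open scoped Classical Pointwise
open Literature.NumberTheory.Sieve Literature.Combinatorics.Additive
open Literature.NumberTheory.Sieve.GoldbachLinnik (oddSingularFactor oddSingularFactor_nonneg)
open Literature.NumberTheory.Sieve.RomanoffExplicit (PrimeCountingLowerMul primeCountingLowerMul_09212)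

/-! ## §1 The prime-counting input from Mathlib: `c₀ = 0.693` from `2^30` -/

/-- `0.693·n/log n ≤ π(n)` for every `n ≥ 2^30`, from Mathlib's `Chebyshev.pi_ge : (n log 2 − log(n+1))/log n ≤ π(n)`
(`log(n+1) ≤ 2√(n+1) ≤ 0.00014 n`). [cite: Nathanson1996, Theorem 6.3 (Chebyshev; explicit form c₀ = 0.693 for n ≥ 2^30, proved from Mathlib `Chebyshev.pi_ge`)] -/
theorem primeCountingLowerMul_0693 : PrimeCountingLowerMul 0.693 (2 ^ 30) := by
  intro n hn
  have hn0 : (2 : ℝ) ^ 30 ≤ n := by exact_mod_cast hn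
  have hnn : (0 : ℝ) ≤ n := by positivity
  have hlogn : 0 < Real.log n := Real.log_pos (by linarith)
  have hcheb := Chebyshev.pi_ge n
  set s := Real.sqrt ((n : ℝ) + 1) with hs
  have hs0 : 0 < s := Real.sqrt_pos.mpr (by linarith)
  have hs2 : s ^ 2 = (n : ℝ) + 1 := Real.sq_sqrt (by linarith)
  have hlog1 : Real.log ((n : ℝ) + 1) ≤ 2 * s := by
    have h1 : Real.log ((n : ℝ) + 1) = 2 * Real.log s := by
      rw [← hs2, Real.log_pow]; norm_num
    have h2 : Real.log s ≤ s - 1 := Real.log_le_sub_one_of_pos hs0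
    linarith
  have hsn : s ≤ 0.00007 * n := by
    have hnn2 : (2 : ℝ) ^ 30 * n ≤ n * n := mul_le_mul_of_nonneg_right hn0 hnn
    have h1 : (n : ℝ) + 1 ≤ (0.00007 * n) ^ 2 := by nlinarith
    calc s = Real.sqrt ((n : ℝ) + 1) := hs
      _ ≤ Real.sqrt ((0.00007 * n) ^ 2) := Real.sqrt_le_sqrt h1
      _ = 0.00007 * n := Real.sqrt_sq (by positivity)
  have hlog2 := Real.log_two_gt_d9
  have h2 : 0.6931471803 * (n : ℝ) ≤ n * Real.log 2 := by nlinarith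
  have hnum : 0.693 * (n : ℝ) ≤ n * Real.log 2 - Real.log (n + 1) := by linarith
  calc 0.693 * (n : ℝ) / Real.log n ≤ (n * Real.log 2 - Real.log (n + 1)) / Real.log n :=
        div_le_div_of_nonneg_right hnum hlogn.le
    _ ≤ _ := hcheb

/-- Rosser–Schoenfeld (3.3) (`n/(log n − ½) ≤ π(n)`, `n ≥ 67`, a registered fact) implies `n/log n ≤ π(n)` for
`n ≥ 67`, i.e. `PrimeCountingLowerMul 1 67`. [cite: RosserSchoenfeld1962, Theorem 2, eq. (3.3)] -/
theorem primeCountingLowerMul_one_of_RS (h : Literature.NumberTheory.LFunctions.RosserSchoenfeld1962_theorem2) :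
    PrimeCountingLowerMul 1 67 := by
  intro n hn
  have hRS := RomanoffExplicit.primeCountingLowerWith_of_RS h n hn
  have hn0 : (67 : ℝ) ≤ n := by exact_mod_cast hn
  have hlog : 2 < Real.log (n : ℝ) := by
    have h1 : Real.exp 2 < 67 := by
      have he := Real.exp_one_lt_d9
      have h : Real.exp 2 = Real.exp 1 * Real.exp 1 := by rw [← Real.exp_add]; norm_num
      rw [h]; nlinarith [Real.exp_pos 1]
    have h2 := Real.log_lt_log (Real.exp_pos 2) (lt_of_lt_of_le h1 hn0)
    rwa [Real.log_exp] at h2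
  calc (1 : ℝ) * n / Real.log n = n / Real.log n := by rw [one_mul]
    _ ≤ n / (Real.log n - 1 / 2) :=
        div_le_div_of_nonneg_left (by positivity) (by linarith) (by linarith)
    _ ≤ _ := hRS

/-! ## §2 The first moment `S₁(x) = Σ_{N ≤ x} r(N)` (Lemma 7.6 with a Chebyshev constant) -/

/-- `#{p ≤ y : p prime} = π(y)`. [folklore] -/
private theorem card_filter_prime_range (y : ℕ) : #{p ∈ range (y + 1) | p.Prime} = Nat.primeCounting y := by
  rw [Nat.primeCounting, ← Nat.primesBelow_card_eq_primeCounting']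
  rfl

/-- Double counting: `Σ_{N ≤ x} r(N) ≥ Σ_{q ≤ y, q prime} π(x − q)` for `y ≤ x` (the prime pairs `(p, q)` with
`q ≤ y`, `p ≤ x − q` have `p + q ≤ x`). [cite: Nathanson1996, Lemma 7.6 (proof, sharpened: all `q ≤ y` instead of
`p, q ≤ x/2`)] -/
theorem sum_primeCounting_le_sum_goldbachCount {x y : ℕ} (hyx : y ≤ x) :
    ∑ q ∈ (range (y + 1)).filter Nat.Prime, (Nat.primeCounting (x - q) : ℝ)
      ≤ ∑ N ∈ range (x + 1), (SingularSeries.goldbachCount N : ℝ) := by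
  set s : Finset (ℕ × ℕ) := ((range (x + 1)) ×ˢ (range (x + 1))).filter
    (fun pq => pq.1.Prime ∧ pq.2.Prime ∧ pq.1 + pq.2 ≤ x) with hs
  -- (i) `#s ≤ Σ_N r(N)` along the fibres of `(p, q) ↦ p + q`
  have h1 : #s ≤ ∑ N ∈ range (x + 1), SingularSeries.goldbachCount N := by
    have hmaps : ∀ pq ∈ s, pq.1 + pq.2 ∈ range (x + 1) := by
      intro pq hpq
      rw [hs, mem_filter] at hpq
      rw [mem_range]; omega
    rw [card_eq_sum_card_fiberwise hmaps]
    refine sum_le_sum fun N _ => ?_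
    unfold SingularSeries.goldbachCount
    refine card_le_card fun pq hpq => ?_
    rw [mem_filter, hs, mem_filter] at hpq
    rw [mem_filter, Finset.HasAntidiagonal.mem_antidiagonal]
    exact ⟨hpq.2, hpq.1.2.1, hpq.1.2.2.1⟩
  -- (ii) `Σ_{q ≤ y prime} π(x − q) ≤ #s` along the fibres of `(p, q) ↦ q`
  have h2 : ∑ q ∈ (range (y + 1)).filter Nat.Prime, Nat.primeCounting (x - q) ≤ #s := by
    have hmaps : ∀ pq ∈ s, pq.2 ∈ range (x + 1) := by
      intro pq hpq
      rw [hs, mem_filter, mem_product] at hpq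
      exact hpq.1.2
    rw [card_eq_sum_card_fiberwise hmaps]
    calc ∑ q ∈ (range (y + 1)).filter Nat.Prime, Nat.primeCounting (x - q)
        ≤ ∑ q ∈ (range (y + 1)).filter Nat.Prime, #{pq ∈ s | pq.2 = q} := by
          refine sum_le_sum fun q hq => ?_
          rw [mem_filter, mem_range] at hq
          rw [← card_filter_prime_range (x - q)]
          have hsub : ((range (x - q + 1)).filter Nat.Prime).image (fun p => (p, q))
              ⊆ {pq ∈ s | pq.2 = q} := by
            intro pq hpq
            rw [mem_image] at hpq
            obtain ⟨p, hp, rfl⟩ := hpq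
            rw [mem_filter, mem_range] at hp
            rw [mem_filter, hs, mem_filter, mem_product, mem_range, mem_range]
            exact ⟨⟨⟨by omega, by omega⟩, hp.2, hq.2, by omega⟩, rfl⟩
          calc #((range (x - q + 1)).filter Nat.Prime)
              = #(((range (x - q + 1)).filter Nat.Prime).image (fun p => (p, q))) :=
                (card_image_of_injective _ (fun a b h => by simpa using h)).symm
            _ ≤ _ := card_le_card hsub
      _ ≤ ∑ q ∈ range (x + 1), #{pq ∈ s | pq.2 = q} :=
          sum_le_sum_of_subset_of_nonneg (fun q hq => by
            rw [mem_filter, mem_range] at hq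
            rw [mem_range]; omega) (fun _ _ _ => Nat.zero_le _)
  have h12 := h2.trans h1
  exact_mod_cast h12

/-- Swapping the order of summation: `Σ_{q ≤ y prime} (x − q) = Σ_{m < x} #{q ≤ min(m, y) prime} ≥ Σ_{m = x₁}^{y} π(m)`
(`y < x`). [folklore] -/
private theorem sum_primeCounting_Icc_le {x y x₁ : ℕ} (hyx : y < x) :
    ∑ m ∈ Icc x₁ y, (Nat.primeCounting m : ℝ)
      ≤ ∑ q ∈ (range (y + 1)).filter Nat.Prime, ((x : ℝ) - q) := by
  set P := (range (y + 1)).filter Nat.Prime with hP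
  have key : ∀ q ∈ P, ((x : ℝ) - q) = ∑ m ∈ range x, if q ≤ m then (1 : ℝ) else 0 := by
    intro q hq
    rw [hP, mem_filter, mem_range] at hq
    rw [sum_boole]
    have hset : (range x).filter (fun m => q ≤ m) = Ico q x := by
      ext m
      rw [mem_filter, mem_range, mem_Ico]
      omega
    rw [hset, Nat.card_Ico, Nat.cast_sub (by omega : q ≤ x)]
  rw [sum_congr rfl key, sum_comm]
  have hinner : ∀ m ∈ range x,
      (∑ q ∈ P, if q ≤ m then (1 : ℝ) else 0) = #{q ∈ P | q ≤ m} := fun m _ => sum_boole _ _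
  rw [sum_congr rfl hinner]
  have hIcc : ∀ m ∈ Icc x₁ y, (Nat.primeCounting m : ℝ) = #{q ∈ P | q ≤ m} := by
    intro m hm
    rw [mem_Icc] at hm
    rw [← card_filter_prime_range m]
    congr 2
    ext q
    simp only [hP, mem_filter, mem_range]
    constructor
    · rintro ⟨hqm, hq⟩; exact ⟨⟨by omega, hq⟩, by omega⟩
    · rintro ⟨⟨hqy, hq⟩, hqm⟩; exact ⟨by omega, hq⟩
  rw [sum_congr rfl hIcc]
  exact sum_le_sum_of_subset_of_nonneg (fun m hm => by
    rw [mem_Icc] at hm; rw [mem_range]; omega) (fun _ _ _ => by positivity)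

/-- Gauss: `Σ_{m = a}^{b} m ≥ (b² − a²)/2`. [folklore] -/
private theorem sum_Icc_id_ge (a b : ℕ) : (((b : ℝ)) ^ 2 - (a : ℝ) ^ 2) / 2 ≤ ∑ m ∈ Icc a b, (m : ℝ) := by
  induction b with
  | zero =>
      have h0 : (0 : ℝ) ≤ ∑ m ∈ Icc a 0, (m : ℝ) := sum_nonneg fun m _ => Nat.cast_nonneg m
      push_cast
      nlinarith [sq_nonneg (a : ℝ)]
  | succ b ih =>
      by_cases hab : a ≤ b + 1
      · rw [sum_Icc_succ_top hab]
        push_cast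
        nlinarith [ih]
      · have hem : Icc a (b + 1) = ∅ := Finset.Icc_eq_empty (by omega)
        rw [hem, sum_empty]
        have hlt : (b : ℝ) + 1 < a := by exact_mod_cast (by omega : b + 1 < a)
        have hb : (0 : ℝ) ≤ b := Nat.cast_nonneg b
        push_cast
        nlinarith

/-- **First moment, explicit** (Lemma 7.6 with constants): if `c₀ n/log n ≤ π(n)` for `n ≥ x₁` (`x₁ ≥ 2`, `c₀ ≥ 0`),
then for `x ≥ 2x₁`, `Σ_{N ≤ x} r(N) ≥ c₀²·((x − x₁)² − x₁²)/(2 log²x)`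
(`Σ_{N≤x} r(N) ≥ Σ_{q ≤ x−x₁} π(x−q) ≥ (c₀/log x) Σ_{q ≤ x−x₁}(x−q) ≥ (c₀/log x) Σ_{m=x₁}^{x−x₁} π(m) ≥ (c₀/log x)² Σ m`).
[cite: Nathanson1996, Lemma 7.6 (explicit form proved here)] -/
theorem sum_goldbachCount_ge_of_lower {c₀ : ℝ} {x₁ : ℕ} (hc : 0 ≤ c₀) (hx₁ : 2 ≤ x₁)
    (hπ : PrimeCountingLowerMul c₀ x₁) {x : ℕ} (hx : 2 * x₁ ≤ x) :
    c₀ ^ 2 * ((((x : ℝ) - x₁) ^ 2 - (x₁ : ℝ) ^ 2) / (2 * Real.log x ^ 2))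
      ≤ ∑ N ∈ range (x + 1), (SingularSeries.goldbachCount N : ℝ) := by
  set y := x - x₁ with hy
  have hyx : y < x := by omega
  have hx1 : (1 : ℝ) < x := by exact_mod_cast (by omega : 1 < x)
  have hL : 0 < Real.log x := Real.log_pos hx1
  have hx₁r : (2 : ℝ) ≤ x₁ := by exact_mod_cast hx₁
  set P := (range (y + 1)).filter Nat.Prime with hP
  have h1 := sum_primeCounting_le_sum_goldbachCount (x := x) (y := y) hyx.le
  have h2 : ∑ q ∈ P, c₀ * ((x : ℝ) - q) / Real.log x ≤ ∑ q ∈ P, (Nat.primeCounting (x - q) : ℝ) := by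
    refine sum_le_sum fun q hq => ?_
    rw [hP, mem_filter, mem_range] at hq
    have hxq : x₁ ≤ x - q := by omega
    have hq' := hπ (x - q) hxq
    rw [Nat.cast_sub (by omega : q ≤ x)] at hq'
    have hxq' : (x₁ : ℝ) ≤ (x : ℝ) - q := by
      have := (Nat.cast_le (α := ℝ)).mpr hxq
      rw [Nat.cast_sub (by omega : q ≤ x)] at this
      exact this
    have hpos : (0 : ℝ) < (x : ℝ) - q := by linarith
    have hq0 : (0 : ℝ) ≤ q := Nat.cast_nonneg q
    have hlogle : Real.log ((x : ℝ) - q) ≤ Real.log x := Real.log_le_log hpos (by linarith)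
    have hlogpos : 0 < Real.log ((x : ℝ) - q) := Real.log_pos (by linarith)
    calc c₀ * ((x : ℝ) - q) / Real.log x ≤ c₀ * ((x : ℝ) - q) / Real.log ((x : ℝ) - q) :=
          div_le_div_of_nonneg_left (mul_nonneg hc hpos.le) hlogpos hlogle
      _ ≤ _ := hq'
  have h3 := sum_primeCounting_Icc_le (x := x) (y := y) (x₁ := x₁) hyx
  have h4 : ∑ m ∈ Icc x₁ y, c₀ * (m : ℝ) / Real.log x ≤ ∑ m ∈ Icc x₁ y, (Nat.primeCounting m : ℝ) := by
    refine sum_le_sum fun m hm => ?_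
    rw [mem_Icc] at hm
    have hm' := hπ m hm.1
    have hm0 : (2 : ℝ) ≤ m := by exact_mod_cast (le_trans hx₁ hm.1)
    have hlogle : Real.log m ≤ Real.log x :=
      Real.log_le_log (by linarith) (by exact_mod_cast (by omega : m ≤ x))
    have hlogpos : 0 < Real.log m := Real.log_pos (by linarith)
    calc c₀ * (m : ℝ) / Real.log x ≤ c₀ * m / Real.log m :=
          div_le_div_of_nonneg_left (mul_nonneg hc (by linarith)) hlogpos hlogle
      _ ≤ _ := hm'
  have h5 := sum_Icc_id_ge x₁ y
  have hycast : (y : ℝ) = (x : ℝ) - x₁ := by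
    rw [hy, Nat.cast_sub (by omega : x₁ ≤ x)]
  have hcL : 0 ≤ c₀ / Real.log x := div_nonneg hc hL.le
  calc c₀ ^ 2 * ((((x : ℝ) - x₁) ^ 2 - (x₁ : ℝ) ^ 2) / (2 * Real.log x ^ 2))
      = (c₀ / Real.log x) * ((c₀ / Real.log x) * ((((y : ℝ)) ^ 2 - (x₁ : ℝ) ^ 2) / 2)) := by
        rw [hycast]; field_simp
    _ ≤ (c₀ / Real.log x) * ((c₀ / Real.log x) * ∑ m ∈ Icc x₁ y, (m : ℝ)) :=
        mul_le_mul_of_nonneg_left (mul_le_mul_of_nonneg_left h5 hcL) hcL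
    _ = (c₀ / Real.log x) * ∑ m ∈ Icc x₁ y, c₀ * (m : ℝ) / Real.log x := by
        rw [mul_sum]
        congr 1
        exact sum_congr rfl fun m _ => by ring
    _ ≤ (c₀ / Real.log x) * ∑ m ∈ Icc x₁ y, (Nat.primeCounting m : ℝ) :=
        mul_le_mul_of_nonneg_left h4 hcL
    _ ≤ (c₀ / Real.log x) * ∑ q ∈ P, ((x : ℝ) - q) := mul_le_mul_of_nonneg_left h3 hcL
    _ = ∑ q ∈ P, c₀ * ((x : ℝ) - q) / Real.log x := by
        rw [mul_sum]
        exact sum_congr rfl fun q _ => by ring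
    _ ≤ ∑ q ∈ P, (Nat.primeCounting (x - q) : ℝ) := h2
    _ ≤ _ := h1

/-! ## §3 The mean square of the singular factor: `Σ_{even N ≤ x} f(N)² ≤ 1.329·x` -/

/-- The local factor `g(p) = ((p−1)/(p−2))² − 1` (`= (2p−3)/(p−2)²` for `p > 2`), so that
`f(N)² = ∏_{p∣N, p>2}(1 + g(p))`. [folklore] -/
noncomputable def gFactor (p : ℕ) : ℝ := (((p : ℝ) - 1) / ((p : ℝ) - 2)) ^ 2 - 1

/-- `f(N)² = Σ_{T ⊆ {p ∣ N : p > 2}} ∏_{p ∈ T} g(p)` (expand `∏ (1 + g)`). [folklore] -/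
private theorem oddSingularFactor_sq_eq (N : ℕ) :
    oddSingularFactor N ^ 2 = ∑ T ∈ (N.primeFactors.filter (2 < ·)).powerset, ∏ p ∈ T, gFactor p := by
  unfold oddSingularFactor
  rw [← prod_pow, ← prod_one_add]
  exact prod_congr rfl fun p _ => by unfold gFactor; ring

/-- `g(p) ≥ 0` for `p ≥ 3`. [folklore] -/
private theorem gFactor_nonneg {p : ℕ} (hp : 2 < p) : 0 ≤ gFactor p := by
  unfold gFactor
  have hp3 : (3 : ℝ) ≤ p := by exact_mod_cast hp
  have h1 : 1 ≤ ((p : ℝ) - 1) / ((p : ℝ) - 2) := by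
    rw [le_div_iff₀ (by linarith)]; linarith
  nlinarith

/-- For `p ≥ 101`: `g(p)/p ≤ 2.06/p²`. [folklore] -/
private theorem gFactor_div_le {p : ℕ} (hp : 101 ≤ p) : gFactor p / p ≤ 2.06 / (p : ℝ) ^ 2 := by
  unfold gFactor
  have hp' : (101 : ℝ) ≤ p := by exact_mod_cast hp
  have hp2 : (0 : ℝ) < (p : ℝ) - 2 := by linarith
  have hp2' : (p : ℝ) - 2 ≠ 0 := ne_of_gt hp2
  have hg : (((p : ℝ) - 1) / ((p : ℝ) - 2)) ^ 2 - 1 = (2 * p - 3) / ((p : ℝ) - 2) ^ 2 := by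
    field_simp; ring
  rw [hg, div_div, div_le_div_iff₀ (by positivity) (by positivity)]
  have h : (2 * (p : ℝ) - 3) * p ≤ 2.06 * ((p : ℝ) - 2) ^ 2 := by
    nlinarith [mul_nonneg (by linarith : (0 : ℝ) ≤ p - 101) (by linarith : (0 : ℝ) ≤ p)]
  nlinarith [mul_le_mul_of_nonneg_right h (by linarith : (0 : ℝ) ≤ p)]

/-- `Σ_{p ∈ T} 1/p² ≤ 1/198` for any finite set `T` of odd integers `≥ 101`
(`1/p² ≤ ½(1/(p−2) − 1/p)`, telescoping over the odd numbers). [folklore] -/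
private theorem sum_inv_sq_le_of_odd (T : Finset ℕ) (hT : ∀ p ∈ T, Odd p ∧ 101 ≤ p) :
    ∑ p ∈ T, 1 / (p : ℝ) ^ 2 ≤ 1 / 198 := by
  have htel : ∀ M : ℕ, 49 ≤ M →
      ∑ m ∈ Icc 50 M, (1 / (2 * (m : ℝ) - 1) - 1 / (2 * (m : ℝ) + 1)) = 1 / 99 - 1 / (2 * (M : ℝ) + 1) := by
    intro M hM
    induction M with
    | zero => omega
    | succ M ih =>
        rcases Nat.lt_or_ge M 49 with h | h
        · have hM' : M = 48 := by omega
          subst hM'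
          rw [Finset.Icc_eq_empty (by norm_num), sum_empty]
          norm_num
        · rw [sum_Icc_succ_top (by omega), ih h]
          push_cast
          ring
  by_cases hTe : T = ∅
  · rw [hTe, sum_empty]; norm_num
  obtain ⟨p₀, hp₀⟩ := Finset.nonempty_iff_ne_empty.mpr hTe
  obtain ⟨M, hM⟩ : ∃ M : ℕ, T.sup (fun p => (p - 1) / 2) = M := ⟨_, rfl⟩
  have hM49 : 49 ≤ M := by
    have h1 := Finset.le_sup (f := fun p => (p - 1) / 2) hp₀
    simp only [hM] at h1
    have h2 := (hT p₀ hp₀).2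
    omega
  have hsub : T ⊆ (Icc 50 M).image (fun m => 2 * m + 1) := by
    intro p hp
    obtain ⟨⟨k, hk⟩, hp101⟩ := hT p hp
    rw [mem_image]
    refine ⟨k, ?_, hk.symm⟩
    rw [mem_Icc]
    have h1 := Finset.le_sup (f := fun p => (p - 1) / 2) hp
    simp only [hM] at h1
    constructor <;> omega
  have hterm : ∀ p ∈ T, 1 / (p : ℝ) ^ 2 ≤ (1 / 2 : ℝ) * (1 / ((p : ℝ) - 2) - 1 / p) := by
    intro p hp
    have hp101 : (101 : ℝ) ≤ p := by exact_mod_cast (hT p hp).2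
    have hp2 : (p : ℝ) - 2 ≠ 0 := by
      have : (0 : ℝ) < (p : ℝ) - 2 := by linarith
      exact ne_of_gt this
    have hp0 : (p : ℝ) ≠ 0 := by
      have : (0 : ℝ) < (p : ℝ) := by linarith
      exact ne_of_gt this
    have heq : (1 / 2 : ℝ) * (1 / ((p : ℝ) - 2) - 1 / p) = 1 / (((p : ℝ) - 2) * p) := by
      field_simp; ring
    rw [heq]
    exact one_div_le_one_div_of_le (by nlinarith) (by nlinarith)
  have hnonneg : ∀ q : ℕ, q ∈ (Icc 50 M).image (fun m => 2 * m + 1) →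
      0 ≤ (1 / 2 : ℝ) * (1 / ((q : ℝ) - 2) - 1 / q) := by
    intro q hq
    rw [mem_image] at hq
    obtain ⟨m, hm, rfl⟩ := hq
    rw [mem_Icc] at hm
    have hm50 : (50 : ℝ) ≤ m := by exact_mod_cast hm.1
    push_cast
    have h1 : 1 / (2 * (m : ℝ) + 1) ≤ 1 / (2 * (m : ℝ) + 1 - 2) :=
      one_div_le_one_div_of_le (by linarith) (by linarith)
    linarith
  calc ∑ p ∈ T, 1 / (p : ℝ) ^ 2 ≤ ∑ p ∈ T, (1 / 2 : ℝ) * (1 / ((p : ℝ) - 2) - 1 / p) := sum_le_sum hterm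
    _ ≤ ∑ q ∈ (Icc 50 M).image (fun m => (2 * m + 1 : ℕ)), (1 / 2 : ℝ) * (1 / ((q : ℝ) - 2) - 1 / q) :=
        sum_le_sum_of_subset_of_nonneg hsub fun q hq _ => hnonneg q hq
    _ = ∑ m ∈ Icc 50 M, (1 / 2 : ℝ) * (1 / (2 * (m : ℝ) - 1) - 1 / (2 * (m : ℝ) + 1)) := by
        rw [sum_image (fun a _ b _ h => by omega)]
        refine sum_congr rfl fun m _ => ?_
        push_cast
        ring
    _ = (1 / 2 : ℝ) * (1 / 99 - 1 / (2 * (M : ℝ) + 1)) := by rw [← mul_sum, htel M hM49]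
    _ ≤ 1 / 198 := by
        have : (0 : ℝ) ≤ 1 / (2 * (M : ℝ) + 1) := by positivity
        linarith

set_option maxHeartbeats 1600000 in
/-- The Euler product bound `∏_{p ∈ O}(1 + g(p)/p) ≤ 2.658` for any finite set `O` of odd primes: the primes `≤ 97`
exactly (`∏_{2<p≤97} = 2.630126…`), the rest by `1 + t ≤ e^t`, `g(p)/p ≤ 2.06/p²` and `Σ_{odd p ≥ 101} 1/p² ≤ 1/198`
(true value of the full product `2.63985…`). [folklore] -/
private theorem prod_gFactor_le (O : Finset ℕ) (hO : ∀ p ∈ O, p.Prime ∧ 2 < p) :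
    ∏ p ∈ O, (1 + gFactor p / p) ≤ 2.658 := by
  have hF1 : ∀ p : ℕ, 2 < p → 1 ≤ 1 + gFactor p / p := fun p hp => by
    have h1 := gFactor_nonneg hp
    have h2 : (0 : ℝ) ≤ gFactor p / p := by positivity
    linarith
  have hF0 : ∀ p ∈ O, 0 ≤ 1 + gFactor p / p := fun p hp => le_trans zero_le_one (hF1 p (hO p hp).2)
  rw [← prod_filter_mul_prod_filter_not O (fun p => p ≤ 100)]
  -- the head: odd primes `≤ 100`
  have hsub : O.filter (fun p => p ≤ 100) ⊆ (range 101).filter (fun p => p.Prime ∧ 2 < p) := by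
    intro p hp
    rw [mem_filter] at hp ⊢
    obtain ⟨hpO, hp100⟩ := hp
    exact ⟨mem_range.mpr (by omega), hO p hpO⟩
  have hhead : ∏ p ∈ O.filter (fun p => p ≤ 100), (1 + gFactor p / p) ≤ 2.630127 := by
    have hUval : ∏ p ∈ (range 101).filter (fun p => p.Prime ∧ 2 < p), (1 + gFactor p / p) ≤ 2.630127 := by
      rw [prod_filter]
      simp only [prod_range_succ, prod_range_zero, gFactor]
      norm_num
    refine le_trans ?_ hUval
    rw [← prod_sdiff hsub]
    have h1 : 1 ≤ ∏ p ∈ (range 101).filter (fun p => p.Prime ∧ 2 < p) \ O.filter (fun p => p ≤ 100),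
        (1 + gFactor p / p) := by
      calc (1 : ℝ) = ∏ p ∈ (range 101).filter (fun p => p.Prime ∧ 2 < p) \ O.filter (fun p => p ≤ 100),
          (1 : ℝ) := prod_const_one.symm
        _ ≤ _ := prod_le_prod (fun _ _ => zero_le_one) fun p hp =>
          hF1 p (mem_filter.mp (sdiff_subset hp)).2.2
    have h0 : 0 ≤ ∏ p ∈ O.filter (fun p => p ≤ 100), (1 + gFactor p / p) :=
      prod_nonneg fun p hp => hF0 p (mem_filter.mp hp).1
    exact le_mul_of_one_le_left h0 h1
  -- the tail: odd primes `≥ 101`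
  have htail : ∏ p ∈ O.filter (fun p => ¬p ≤ 100), (1 + gFactor p / p) ≤ 1.010514 := by
    set T' := O.filter (fun p => ¬p ≤ 100) with hT'
    have hT'mem : ∀ p ∈ T', p.Prime ∧ 2 < p ∧ 101 ≤ p := fun p hp => by
      rw [hT', mem_filter] at hp
      exact ⟨(hO p hp.1).1, (hO p hp.1).2, by omega⟩
    have h1 : ∏ p ∈ T', (1 + gFactor p / p) ≤ Real.exp (∑ p ∈ T', gFactor p / p) := by
      rw [Real.exp_sum]
      exact prod_le_prod (fun p hp => hF0 p (mem_filter.mp hp).1) fun p _ => by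
        have := Real.add_one_le_exp (gFactor p / p); linarith
    have h2 : ∑ p ∈ T', gFactor p / p ≤ 2.06 * ∑ p ∈ T', 1 / (p : ℝ) ^ 2 := by
      rw [mul_sum]
      exact sum_le_sum fun p hp => by
        calc gFactor p / p ≤ 2.06 / (p : ℝ) ^ 2 := gFactor_div_le (hT'mem p hp).2.2
          _ = 2.06 * (1 / (p : ℝ) ^ 2) := by ring
    have h3 : ∑ p ∈ T', 1 / (p : ℝ) ^ 2 ≤ 1 / 198 :=
      sum_inv_sq_le_of_odd T' fun p hp =>
        ⟨(hT'mem p hp).1.odd_of_ne_two (by have := (hT'mem p hp).2.1; omega), (hT'mem p hp).2.2⟩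
    have h4 : ∑ p ∈ T', gFactor p / p ≤ 0.010405 := by linarith
    have h5 : Real.exp (∑ p ∈ T', gFactor p / p) ≤ Real.exp 0.010405 := Real.exp_le_exp.mpr h4
    have h6 : Real.exp (0.010405 : ℝ) ≤ 1.010514 := by
      have := Real.abs_exp_sub_one_sub_id_le (x := (0.010405 : ℝ)) (by rw [abs_le]; constructor <;> norm_num)
      rw [abs_le] at this
      nlinarith [this.2]
    linarith
  have htail0 : 0 ≤ ∏ p ∈ O.filter (fun p => ¬p ≤ 100), (1 + gFactor p / p) :=
    prod_nonneg fun p hp => hF0 p (mem_filter.mp hp).1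
  calc (∏ p ∈ O.filter (fun p => p ≤ 100), (1 + gFactor p / p)) *
        ∏ p ∈ O.filter (fun p => ¬p ≤ 100), (1 + gFactor p / p) ≤ 2.630127 * 1.010514 :=
        mul_le_mul hhead htail htail0 (by norm_num)
    _ ≤ 2.658 := by norm_num

/-- `Σ_{even N ∈ (0, x]} f(N)² ≤ (x/2)·∏_{2<p≤x}(1 + g(p)/p)`: expand `f²`, swap the sums and count the even
multiples of `∏_{p∈T} p`: `#{N ≤ x even : T ⊆ primeFactors N} ≤ x/(2∏_{p∈T} p)`. [folklore] -/
private theorem sum_even_oddSingularFactor_sq_le_prod (x : ℕ) :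
    ∑ N ∈ (Ioc 0 x).filter Even, oddSingularFactor N ^ 2
      ≤ (x : ℝ) / 2 * ∏ p ∈ (range (x + 1)).filter (fun p => p.Prime ∧ 2 < p), (1 + gFactor p / p) := by
  set E := (Ioc 0 x).filter Even with hE
  set O := (range (x + 1)).filter (fun p => p.Prime ∧ 2 < p) with hO
  have hSO : ∀ N ∈ E, N.primeFactors.filter (2 < ·) ⊆ O := by
    intro N hN p hp
    rw [hE, mem_filter, mem_Ioc] at hN
    rw [mem_filter, Nat.mem_primeFactors] at hp
    obtain ⟨⟨hpr, hpd, hN0⟩, hp2⟩ := hp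
    rw [hO, mem_filter, mem_range]
    have := Nat.le_of_dvd (by omega) hpd
    exact ⟨by omega, hpr, hp2⟩
  have hg0 : ∀ p ∈ O, 0 ≤ gFactor p := fun p hp => by
    rw [hO, mem_filter] at hp
    exact gFactor_nonneg hp.2.2
  have hw0 : ∀ T ∈ O.powerset, 0 ≤ ∏ p ∈ T, gFactor p := fun T hT =>
    prod_nonneg fun p hp => hg0 p (mem_powerset.mp hT hp)
  -- Step 1: expand `f(N)²` over subsets of `O`
  have hexp : ∀ N ∈ E, oddSingularFactor N ^ 2
      = ∑ T ∈ O.powerset, if T ⊆ N.primeFactors.filter (2 < ·) then ∏ p ∈ T, gFactor p else 0 := by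
    intro N hN
    rw [oddSingularFactor_sq_eq, ← sum_filter]
    apply sum_congr _ (fun _ _ => rfl)
    ext T
    simp only [mem_powerset, mem_filter]
    exact ⟨fun h => ⟨h.trans (hSO N hN), h⟩, fun h => h.2⟩
  -- Step 2: swap the sums
  have hswap : ∑ N ∈ E, oddSingularFactor N ^ 2
      = ∑ T ∈ O.powerset, (∏ p ∈ T, gFactor p) * #{N ∈ E | T ⊆ N.primeFactors.filter (2 < ·)} := by
    rw [sum_congr rfl hexp, sum_comm]
    refine sum_congr rfl fun T _ => ?_
    rw [← sum_filter, sum_const, nsmul_eq_mul, mul_comm]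
  -- Step 3: count the even multiples of `∏ T`
  have hcount : ∀ T ∈ O.powerset,
      (#{N ∈ E | T ⊆ N.primeFactors.filter (2 < ·)} : ℝ) ≤ (x : ℝ) / (2 * ∏ p ∈ T, (p : ℝ)) := by
    intro T hT
    rw [mem_powerset] at hT
    have hTprime : ∀ p ∈ T, p.Prime ∧ 2 < p := fun p hp => by
      have := hT hp
      rw [hO, mem_filter] at this
      exact this.2
    set d := ∏ p ∈ T, p with hd
    have h2d : Nat.Coprime 2 d := Nat.Coprime.prod_right fun p hp =>
      (Nat.coprime_primes Nat.prime_two (hTprime p hp).1).mpr (by have := (hTprime p hp).2; omega)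
    have hsub : {N ∈ E | T ⊆ N.primeFactors.filter (2 < ·)} ⊆ {N ∈ Ioc 0 x | 2 * d ∣ N} := by
      intro N hN
      rw [mem_filter, hE, mem_filter] at hN
      obtain ⟨⟨hNx, hNeven⟩, hTS⟩ := hN
      rw [mem_filter]
      refine ⟨hNx, Nat.Coprime.mul_dvd_of_dvd_of_dvd h2d (even_iff_two_dvd.mp hNeven) ?_⟩
      rw [hd]
      exact Finset.prod_primes_dvd N (fun p hp => (hTprime p hp).1.prime) fun p hp => by
        have := hTS hp
        rw [mem_filter, Nat.mem_primeFactors] at this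
        exact this.1.2.1
    have hcard := card_le_card hsub
    rw [Nat.Ioc_filter_dvd_card_eq_div] at hcard
    have hdiv : ((x / (2 * d) : ℕ) : ℝ) ≤ (x : ℝ) / ((2 * d : ℕ) : ℝ) := Nat.cast_div_le
    calc (#{N ∈ E | T ⊆ N.primeFactors.filter (2 < ·)} : ℝ) ≤ ((x / (2 * d) : ℕ) : ℝ) := by
          exact_mod_cast hcard
      _ ≤ (x : ℝ) / ((2 * d : ℕ) : ℝ) := hdiv
      _ = (x : ℝ) / (2 * ∏ p ∈ T, (p : ℝ)) := by rw [hd]; push_cast; rfl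
  -- Step 4: resum the Euler product
  calc ∑ N ∈ E, oddSingularFactor N ^ 2
      = ∑ T ∈ O.powerset, (∏ p ∈ T, gFactor p) * #{N ∈ E | T ⊆ N.primeFactors.filter (2 < ·)} := hswap
    _ ≤ ∑ T ∈ O.powerset, (∏ p ∈ T, gFactor p) * ((x : ℝ) / (2 * ∏ p ∈ T, (p : ℝ))) :=
        sum_le_sum fun T hT => mul_le_mul_of_nonneg_left (hcount T hT) (hw0 T hT)
    _ = (x : ℝ) / 2 * ∑ T ∈ O.powerset, ∏ p ∈ T, (gFactor p / p) := by
        rw [mul_sum]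
        refine sum_congr rfl fun T hT => ?_
        rw [prod_div_distrib]
        have hTpos : (0 : ℝ) < ∏ p ∈ T, (p : ℝ) := prod_pos fun p hp => by
          have := (mem_powerset.mp hT) hp
          rw [hO, mem_filter] at this
          exact_mod_cast this.2.1.pos
        field_simp
    _ = (x : ℝ) / 2 * ∏ p ∈ O, (1 + gFactor p / p) := by rw [prod_one_add]

/-- **Mean square of the singular factor**: `Σ_{even N ∈ (0, x]} f(N)² ≤ 1.329·x`. [cite: Nathanson1996, Lemma 7.7 (proof: mean square of the singular factor; explicit form proved here)] -/
theorem sum_even_oddSingularFactor_sq_le (x : ℕ) :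
    ∑ N ∈ (Ioc 0 x).filter Even, oddSingularFactor N ^ 2 ≤ 1.329 * (x : ℝ) := by
  have h1 := sum_even_oddSingularFactor_sq_le_prod x
  have h2 := prod_gFactor_le ((range (x + 1)).filter (fun p => p.Prime ∧ 2 < p))
    (fun p hp => (mem_filter.mp hp).2)
  have hx : (0 : ℝ) ≤ (x : ℝ) / 2 := by positivity
  calc _ ≤ _ := h1
    _ ≤ (x : ℝ) / 2 * 2.658 := mul_le_mul_of_nonneg_left h2 hx
    _ = 1.329 * (x : ℝ) := by ring

/-! ## §4 The second moment `S₂(x) = Σ_{N ≤ x} r(N)²` (Lemma 7.7 with the explicit Selberg bound) -/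

/-- `r(N) ≤ N + 1`. [folklore] -/
private theorem goldbachCount_le_succ (N : ℕ) : SingularSeries.goldbachCount N ≤ N + 1 := by
  unfold SingularSeries.goldbachCount
  exact (card_filter_le _ _).trans (by rw [Finset.Nat.card_antidiagonal])

/-- For odd `N`, `r(N) ≤ 2` (one of `p, q` is even, hence `= 2`). [folklore] -/
private theorem goldbachCount_le_two_of_odd {N : ℕ} (hN : Odd N) : SingularSeries.goldbachCount N ≤ 2 := by
  unfold SingularSeries.goldbachCount
  calc #{pq ∈ antidiagonal N | pq.1.Prime ∧ pq.2.Prime}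
      ≤ #({(2, N - 2), (N - 2, 2)} : Finset (ℕ × ℕ)) := by
        refine card_le_card fun pq hpq => ?_
        rw [mem_filter, Finset.HasAntidiagonal.mem_antidiagonal] at hpq
        obtain ⟨hsum, hp, hq⟩ := hpq
        rw [mem_insert, mem_singleton]
        rcases Nat.even_or_odd pq.1 with h1 | h1
        · have h2 : pq.1 = 2 := (Nat.Prime.even_iff hp).mp h1
          left
          exact Prod.ext h2 (by simp only; omega)
        · have h2 : Even pq.2 := by
            rw [← hsum] at hN
            exact (Nat.odd_add.mp hN).mp h1
          have h3 : pq.2 = 2 := (Nat.Prime.even_iff hq).mp h2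
          right
          exact Prod.ext (by simp only; omega) h3
    _ ≤ 2 := card_le_two

/-- `t/log²t` is increasing on `[e², ∞)`. [folklore] -/
private theorem div_log_sq_mono {a b : ℝ} (ha : Real.exp 2 ≤ a) (hab : a ≤ b) :
    a / Real.log a ^ 2 ≤ b / Real.log b ^ 2 := by
  have ha0 : 0 < a := lt_of_lt_of_le (Real.exp_pos 2) ha
  have hb0 : 0 < b := lt_of_lt_of_le ha0 hab
  have hu2 : 2 ≤ Real.log a := by
    have := Real.log_le_log (Real.exp_pos 2) ha
    rwa [Real.log_exp] at this
  have huv : Real.log a ≤ Real.log b := Real.log_le_log ha0 hab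
  have hexp : b = a * Real.exp (Real.log b - Real.log a) := by
    rw [Real.exp_sub, Real.exp_log hb0, Real.exp_log ha0]
    field_simp
  set u := Real.log a with hu_def
  set v := Real.log b with hv_def
  set d := v - u with hd
  have hd0 : 0 ≤ d := by rw [hd]; linarith
  have hq := Real.quadratic_le_exp_of_nonneg hd0
  have hu0 : (0 : ℝ) < u := by linarith
  have hv0 : (0 : ℝ) < v := by linarith
  rw [div_le_div_iff₀ (pow_pos hu0 2) (pow_pos hv0 2)]
  have hv : v = u + d := by rw [hd]; ring
  rw [hv, hexp]
  have hin : (u + d) ^ 2 ≤ (1 + d + d ^ 2 / 2) * u ^ 2 := by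
    nlinarith [mul_nonneg hd0 (by nlinarith : (0 : ℝ) ≤ u ^ 2 - 2 * u),
      mul_nonneg (sq_nonneg d) (by nlinarith : (0 : ℝ) ≤ u ^ 2 / 2 - 1)]
  calc a * (u + d) ^ 2 ≤ a * ((1 + d + d ^ 2 / 2) * u ^ 2) := mul_le_mul_of_nonneg_left hin ha0.le
    _ ≤ a * (Real.exp d * u ^ 2) :=
        mul_le_mul_of_nonneg_left (mul_le_mul_of_nonneg_right hq (sq_nonneg u)) ha0.le
    _ = a * Real.exp d * u ^ 2 := by ring

/-- For even `N` with `e^47 ≤ N ≤ x`: `r(N)² ≤ 17.1²·f(N)²·x²/log⁴x` (the explicit Selberg bound of ROUND-22 and the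
monotonicity of `t/log²t`). [cite: Nathanson1996, Thm 7.2 (explicit constant `17.1` for `N ≥ e^47`, proved in
`TwoResidueSelbergExplicit.goldbachCount_le_kappa`)] -/
theorem goldbachCount_sq_le {N x : ℕ} (hN : Real.exp 47 ≤ (N : ℝ)) (hNx : N ≤ x) (heven : Even N) :
    (SingularSeries.goldbachCount N : ℝ) ^ 2
      ≤ 17.1 ^ 2 * oddSingularFactor N ^ 2 * ((x : ℝ) ^ 2 / Real.log x ^ 4) := by
  have hk := TwoResidueSelbergExplicit.goldbachCount_le_kappa hN heven
  have he2 : Real.exp 2 ≤ (N : ℝ) := le_trans (Real.exp_le_exp.mpr (by norm_num)) hN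
  have hNx' : (N : ℝ) ≤ x := by exact_mod_cast hNx
  have hmono := div_log_sq_mono he2 hNx'
  have hf := oddSingularFactor_nonneg N
  have h1 : (SingularSeries.goldbachCount N : ℝ) ≤ 17.1 * oddSingularFactor N * ((x : ℝ) / Real.log x ^ 2) := by
    calc (SingularSeries.goldbachCount N : ℝ)
        ≤ 17.1 * oddSingularFactor N * (N : ℝ) / Real.log (N : ℝ) ^ 2 := hk
      _ = 17.1 * oddSingularFactor N * ((N : ℝ) / Real.log (N : ℝ) ^ 2) := by ring
      _ ≤ _ := mul_le_mul_of_nonneg_left hmono (by positivity)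
  have h0 : (0 : ℝ) ≤ SingularSeries.goldbachCount N := Nat.cast_nonneg _
  calc (SingularSeries.goldbachCount N : ℝ) ^ 2
      ≤ (17.1 * oddSingularFactor N * ((x : ℝ) / Real.log x ^ 2)) ^ 2 := pow_le_pow_left₀ h0 h1 2
    _ = _ := by ring

/-- `log⁴x ≤ 4096·√x` for `x ≥ 1` (`log x = 8 log x^{1/8} ≤ 8 x^{1/8}`). [folklore] -/
private theorem log_pow_four_le_sqrt {x : ℝ} (hx : 1 ≤ x) : Real.log x ^ 4 ≤ 4096 * Real.sqrt x := by
  set t := Real.sqrt (Real.sqrt (Real.sqrt x)) with ht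
  have hx0 : 0 ≤ x := by linarith
  have ht1 : 1 ≤ t := Real.one_le_sqrt.mpr (Real.one_le_sqrt.mpr (Real.one_le_sqrt.mpr hx))
  have ht0 : 0 < t := by linarith
  have ht2 : t ^ 2 = Real.sqrt (Real.sqrt x) := by rw [ht, Real.sq_sqrt (Real.sqrt_nonneg _)]
  have ht4 : t ^ 4 = Real.sqrt x := by
    rw [show t ^ 4 = (t ^ 2) ^ 2 by ring, ht2, Real.sq_sqrt (Real.sqrt_nonneg _)]
  have ht8 : t ^ 8 = x := by
    rw [show t ^ 8 = (t ^ 4) ^ 2 by ring, ht4, Real.sq_sqrt hx0]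
  have hlog : Real.log x = 8 * Real.log t := by
    rw [← ht8, Real.log_pow]; norm_num
  have hlt : Real.log t ≤ t := by linarith [Real.log_le_sub_one_of_pos ht0]
  have hl0 : 0 ≤ Real.log t := Real.log_nonneg ht1
  rw [hlog, ← ht4, show (8 * Real.log t) ^ 4 = 4096 * Real.log t ^ 4 by ring]
  exact mul_le_mul_of_nonneg_left (pow_le_pow_left₀ hl0 hlt 4) (by norm_num)

/-- `2^100 ≤ e^100`. [folklore] -/
private theorem two_pow_100_le_exp_100 : (2 : ℝ) ^ 100 ≤ Real.exp 100 := by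
  have he : (2 : ℝ) ≤ Real.exp 1 := by have := Real.exp_one_gt_d9; linarith
  have h := pow_le_pow_left₀ (by norm_num) he 100
  rwa [← Real.exp_nat_mul, show ((100 : ℕ) : ℝ) * 1 = 100 by norm_num] at h

/-- **Second moment, explicit** (Lemma 7.7 with constants): `Σ_{N ≤ x} r(N)² ≤ 389·x³/log⁴x` for `x ≥ e^100`
(even `N ≥ e^47`: `r(N)² ≤ 17.1² f(N)² x²/log⁴x` and `Σ f² ≤ 1.329x`, `17.1²·1.329 = 388.61…`; odd `N`: `r ≤ 2`;
`N < e^47`: `r ≤ N + 1`). [cite: Nathanson1996, Lemma 7.7 (explicit form proved here)] -/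
theorem sum_goldbachCount_sq_le_explicit {x : ℕ} (hx : Real.exp 100 ≤ (x : ℝ)) :
    ∑ N ∈ range (x + 1), (SingularSeries.goldbachCount N : ℝ) ^ 2 ≤ 389 * (x : ℝ) ^ 3 / Real.log x ^ 4 := by
  have hx1 : (1 : ℝ) < x := lt_of_lt_of_le (by have := Real.add_one_le_exp (100 : ℝ); linarith) hx
  have hx0 : (0 : ℝ) < x := by linarith
  have hL : 0 < Real.log x := Real.log_pos hx1
  set Lq := Real.log x ^ 4 with hLq_def
  have hLq0 : 0 < Lq := by positivity
  rw [← sum_filter_add_sum_filter_not (range (x + 1)) (fun N : ℕ => Even N ∧ Real.exp 47 ≤ (N : ℝ))]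
  -- the main part
  have hmain : ∑ N ∈ (range (x + 1)).filter (fun N : ℕ => Even N ∧ Real.exp 47 ≤ (N : ℝ)),
      (SingularSeries.goldbachCount N : ℝ) ^ 2 ≤ 17.1 ^ 2 * ((x : ℝ) ^ 2 / Lq) * (1.329 * x) := by
    calc ∑ N ∈ (range (x + 1)).filter (fun N : ℕ => Even N ∧ Real.exp 47 ≤ (N : ℝ)),
          (SingularSeries.goldbachCount N : ℝ) ^ 2
        ≤ ∑ N ∈ (range (x + 1)).filter (fun N : ℕ => Even N ∧ Real.exp 47 ≤ (N : ℝ)),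
          17.1 ^ 2 * oddSingularFactor N ^ 2 * ((x : ℝ) ^ 2 / Lq) := by
          refine sum_le_sum fun N hN => ?_
          rw [mem_filter, mem_range] at hN
          exact goldbachCount_sq_le hN.2.2 (by omega) hN.2.1
      _ = 17.1 ^ 2 * ((x : ℝ) ^ 2 / Lq) * ∑ N ∈ (range (x + 1)).filter
          (fun N : ℕ => Even N ∧ Real.exp 47 ≤ (N : ℝ)), oddSingularFactor N ^ 2 := by
          rw [mul_sum]
          exact sum_congr rfl fun N _ => by ring
      _ ≤ 17.1 ^ 2 * ((x : ℝ) ^ 2 / Lq) * ∑ N ∈ (Ioc 0 x).filter Even, oddSingularFactor N ^ 2 := by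
          apply mul_le_mul_of_nonneg_left _ (by positivity)
          apply sum_le_sum_of_subset_of_nonneg
          · intro N hN
            rw [mem_filter, mem_range] at hN
            rw [mem_filter, mem_Ioc]
            have hN0 : (0 : ℝ) < N := lt_of_lt_of_le (Real.exp_pos 47) hN.2.2
            have hN0' : 0 < N := by exact_mod_cast hN0
            exact ⟨⟨hN0', by omega⟩, hN.2.1⟩
          · intro N _ _
            positivity
      _ ≤ 17.1 ^ 2 * ((x : ℝ) ^ 2 / Lq) * (1.329 * x) :=
          mul_le_mul_of_nonneg_left (sum_even_oddSingularFactor_sq_le x) (by positivity)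
  -- the rest: each term `≤ (2e^47)²`, at most `x + 1` terms
  have hrest : ∑ N ∈ (range (x + 1)).filter (fun N : ℕ => ¬(Even N ∧ Real.exp 47 ≤ (N : ℝ))),
      (SingularSeries.goldbachCount N : ℝ) ^ 2 ≤ ((x : ℝ) + 1) * (2 * Real.exp 47) ^ 2 := by
    have h47 : (1 : ℝ) ≤ Real.exp 47 := by have := Real.add_one_le_exp (47 : ℝ); linarith
    have hterm : ∀ N ∈ (range (x + 1)).filter (fun N : ℕ => ¬(Even N ∧ Real.exp 47 ≤ (N : ℝ))),
        (SingularSeries.goldbachCount N : ℝ) ^ 2 ≤ (2 * Real.exp 47) ^ 2 := by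
      intro N hN
      rw [mem_filter] at hN
      have hr0 : (0 : ℝ) ≤ SingularSeries.goldbachCount N := Nat.cast_nonneg _
      apply pow_le_pow_left₀ hr0
      rcases Nat.even_or_odd N with hev | hodd
      · have hlt : (N : ℝ) < Real.exp 47 := by
          by_contra h
          exact hN.2 ⟨hev, not_lt.mp h⟩
        have h1 : (SingularSeries.goldbachCount N : ℝ) ≤ N + 1 := by
          exact_mod_cast goldbachCount_le_succ N
        linarith
      · have h1 : (SingularSeries.goldbachCount N : ℝ) ≤ 2 := by
          exact_mod_cast goldbachCount_le_two_of_odd hodd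
        linarith
    calc _ ≤ ∑ N ∈ (range (x + 1)).filter (fun N : ℕ => ¬(Even N ∧ Real.exp 47 ≤ (N : ℝ))),
          (2 * Real.exp 47) ^ 2 := sum_le_sum hterm
      _ = #((range (x + 1)).filter (fun N : ℕ => ¬(Even N ∧ Real.exp 47 ≤ (N : ℝ)))) * (2 * Real.exp 47) ^ 2 := by
          rw [sum_const, nsmul_eq_mul]
      _ ≤ ((x : ℝ) + 1) * (2 * Real.exp 47) ^ 2 := by
          apply mul_le_mul_of_nonneg_right _ (by positivity)
          have : #((range (x + 1)).filter (fun N : ℕ => ¬(Even N ∧ Real.exp 47 ≤ (N : ℝ)))) ≤ x + 1 :=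
            (card_filter_le _ _).trans (by rw [card_range])
          exact_mod_cast this
  -- numerics: `(x + 1)·(2e^47)²·log⁴x ≤ 0.387·x³` for `x ≥ e^100`
  have hsqrt : Real.exp 50 ≤ Real.sqrt x := by
    apply Real.le_sqrt_of_sq_le
    rw [← Real.exp_nat_mul]
    norm_num
    exact hx
  have hLq : Lq ≤ 4096 * Real.sqrt x := log_pow_four_le_sqrt hx1.le
  have hxx : Real.sqrt x * Real.sqrt x = x := Real.mul_self_sqrt hx0.le
  have he : (2.7 : ℝ) ≤ Real.exp 1 := by have := Real.exp_one_gt_d9; linarith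
  have he56 : (100000 : ℝ) ≤ Real.exp 56 := by
    have h1 := pow_le_pow_left₀ (by norm_num) he 56
    rw [← Real.exp_nat_mul] at h1
    norm_num at h1
    have h2 : (100000 : ℝ) ≤ (2.7 : ℝ) ^ 56 := by norm_num
    linarith
  have h94 : (2 * Real.exp 47) ^ 2 = 4 * Real.exp 94 := by
    rw [mul_pow, ← Real.exp_nat_mul]; norm_num
  have h100 : Real.exp 100 = Real.exp 44 * Real.exp 56 := by rw [← Real.exp_add]; norm_num
  have h94' : Real.exp 94 = Real.exp 44 * Real.exp 50 := by rw [← Real.exp_add]; norm_num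
  have e44 : 0 < Real.exp 44 := Real.exp_pos 44
  have hkey : ((x : ℝ) + 1) * (2 * Real.exp 47) ^ 2 * Lq ≤ 0.387 * (x : ℝ) ^ 3 := by
    rw [h94]
    have h1 : Real.exp 50 * Real.sqrt x ≤ x := by
      calc Real.exp 50 * Real.sqrt x ≤ Real.sqrt x * Real.sqrt x :=
            mul_le_mul_of_nonneg_right hsqrt (Real.sqrt_nonneg x)
        _ = x := hxx
    calc ((x : ℝ) + 1) * (4 * Real.exp 94) * Lq ≤ (2 * x) * (4 * Real.exp 94) * (4096 * Real.sqrt x) :=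
          mul_le_mul (mul_le_mul_of_nonneg_right (by linarith) (by positivity)) hLq hLq0.le (by positivity)
      _ = 32768 * Real.exp 44 * x * (Real.exp 50 * Real.sqrt x) := by rw [h94']; ring
      _ ≤ 32768 * Real.exp 44 * x * x := mul_le_mul_of_nonneg_left h1 (by positivity)
      _ ≤ 0.387 * (Real.exp 44 * Real.exp 56) * x * x := by
          have h2 : 32768 * Real.exp 44 ≤ 0.387 * (Real.exp 44 * Real.exp 56) := by nlinarith
          have hxx0 : (0 : ℝ) ≤ x * x := by positivity
          nlinarith
      _ = 0.387 * Real.exp 100 * ((x : ℝ) * x) := by rw [h100]; ring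
      _ ≤ 0.387 * x * ((x : ℝ) * x) := by
          apply mul_le_mul_of_nonneg_right _ (by positivity)
          exact mul_le_mul_of_nonneg_left hx (by norm_num)
      _ = 0.387 * (x : ℝ) ^ 3 := by ring
  have hmain' : 17.1 ^ 2 * ((x : ℝ) ^ 2 / Lq) * (1.329 * x) = 388.61289 * (x : ℝ) ^ 3 / Lq := by
    field_simp
    ring
  have hrest' : ((x : ℝ) + 1) * (2 * Real.exp 47) ^ 2 ≤ 0.387 * (x : ℝ) ^ 3 / Lq := by
    rw [le_div_iff₀ hLq0]; exact hkey
  calc _ ≤ 17.1 ^ 2 * ((x : ℝ) ^ 2 / Lq) * (1.329 * x) + ((x : ℝ) + 1) * (2 * Real.exp 47) ^ 2 :=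
        add_le_add hmain hrest
    _ ≤ 388.61289 * (x : ℝ) ^ 3 / Lq + 0.387 * (x : ℝ) ^ 3 / Lq := by rw [hmain']; linarith
    _ ≤ 389 * (x : ℝ) ^ 3 / Lq := by
        rw [← add_div]
        apply div_le_div_of_nonneg_right _ hLq0.le
        have : (0 : ℝ) ≤ (x : ℝ) ^ 3 := by positivity
        nlinarith

/-! ## §5 Cauchy–Schwarz: a positive proportion of Goldbach numbers (Theorem 7.8, explicit) -/

/-- **Theorem 7.8, explicit**: if `Σ_{N≤x} r(N) ≥ c₁ x²/log²x` for `x ≥ e^100` (`c₁ ≥ 0`), then for `x ≥ e^100`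
`#{N ∈ (0, x] : N = p + q} ≥ (c₁²/389)·x` (`(Σ r)² ≤ #{r > 0}·Σ r²`).
[cite: Nathanson1996, Thm 7.8 (proof, explicit form proved here)] -/
theorem goldbach_count_ge_of_first_moment {c₁ : ℝ} (hc₁ : 0 ≤ c₁)
    (hS₁ : ∀ x : ℕ, Real.exp 100 ≤ (x : ℝ) →
      c₁ * ((x : ℝ) ^ 2 / Real.log x ^ 2) ≤ ∑ N ∈ range (x + 1), (SingularSeries.goldbachCount N : ℝ))
    {x : ℕ} (hx : Real.exp 100 ≤ (x : ℝ)) :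
    c₁ ^ 2 / 389 * (x : ℝ) ≤ #{N ∈ Ioc 0 x | ∃ p q : ℕ, p.Prime ∧ q.Prime ∧ p + q = N} := by
  have hx1 : (1 : ℝ) < x := lt_of_lt_of_le (by have := Real.add_one_le_exp (100 : ℝ); linarith) hx
  have hx0 : (0 : ℝ) < x := by linarith
  have hlogx : 0 < Real.log x := Real.log_pos hx1
  set r : ℕ → ℝ := fun N => (SingularSeries.goldbachCount N : ℝ) with hr
  set T : Finset ℕ := (range (x + 1)).filter fun N => 0 < SingularSeries.goldbachCount N with hT
  have hsumT : ∑ N ∈ range (x + 1), r N = ∑ N ∈ T, r N * 1 := by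
    rw [hT, sum_filter]
    refine sum_congr rfl fun N _ => ?_
    by_cases h : 0 < SingularSeries.goldbachCount N
    · rw [if_pos h, mul_one]
    · rw [if_neg h, hr]
      simp only [not_lt, Nat.le_zero] at h
      simp [h]
  have hCS : (∑ N ∈ T, r N * 1) ^ 2 ≤ (∑ N ∈ T, r N ^ 2) * ∑ N ∈ T, (1 : ℝ) ^ 2 :=
    sum_mul_sq_le_sq_mul_sq T r fun _ => 1
  have hT1 : ∑ N ∈ T, (1 : ℝ) ^ 2 = #T := by simp
  have hTsq : ∑ N ∈ T, r N ^ 2 ≤ ∑ N ∈ range (x + 1), r N ^ 2 :=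
    sum_le_sum_of_subset_of_nonneg (filter_subset _ _) fun N _ _ => by positivity
  have hTA : T ⊆ {N ∈ Ioc 0 x | ∃ p q : ℕ, p.Prime ∧ q.Prime ∧ p + q = N} := by
    intro N hN
    rw [hT, mem_filter, mem_range] at hN
    obtain ⟨hNx, hpos⟩ := hN
    unfold SingularSeries.goldbachCount at hpos
    obtain ⟨pq, hpq⟩ := card_pos.mp hpos
    rw [mem_filter, Finset.HasAntidiagonal.mem_antidiagonal] at hpq
    have hN2 : 2 ≤ N := by
      have := hpq.2.1.two_le
      omega
    rw [mem_filter, mem_Ioc]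
    exact ⟨⟨by omega, by omega⟩, pq.1, pq.2, hpq.2.1, hpq.2.2, hpq.1⟩
  have hTcard : (#T : ℝ) ≤ #{N ∈ Ioc 0 x | ∃ p q : ℕ, p.Prime ∧ q.Prime ∧ p + q = N} := by
    exact_mod_cast card_le_card hTA
  have h76 := hS₁ x hx
  have h77 := sum_goldbachCount_sq_le_explicit hx
  set S₁ := ∑ N ∈ range (x + 1), r N with hS₁_def
  set S₂ := ∑ N ∈ range (x + 1), r N ^ 2 with hS₂_def
  set Ax : ℝ := ((#{N ∈ Ioc 0 x | ∃ p q : ℕ, p.Prime ∧ q.Prime ∧ p + q = N} : ℕ) : ℝ) with hAx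
  have hmain : S₁ ^ 2 ≤ S₂ * Ax := by
    rw [hsumT]
    calc (∑ N ∈ T, r N * 1) ^ 2 ≤ (∑ N ∈ T, r N ^ 2) * #T := by rw [← hT1]; exact hCS
      _ ≤ S₂ * Ax := mul_le_mul hTsq hTcard (by positivity) (sum_nonneg fun N _ => by positivity)
  have hAx0 : 0 ≤ Ax := by positivity
  have h1 : (c₁ * ((x : ℝ) ^ 2 / Real.log x ^ 2)) ^ 2 ≤ S₁ ^ 2 := pow_le_pow_left₀ (by positivity) h76 2
  have h2 : S₂ * Ax ≤ 389 * (x : ℝ) ^ 3 / Real.log x ^ 4 * Ax := mul_le_mul_of_nonneg_right h77 hAx0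
  have hL4 : (0 : ℝ) < Real.log x ^ 4 := by positivity
  have h3 : c₁ ^ 2 * (x : ℝ) ^ 4 / Real.log x ^ 4 ≤ 389 * (x : ℝ) ^ 3 / Real.log x ^ 4 * Ax := by
    have e : (c₁ * ((x : ℝ) ^ 2 / Real.log x ^ 2)) ^ 2 = c₁ ^ 2 * (x : ℝ) ^ 4 / Real.log x ^ 4 := by
      rw [mul_pow, div_pow]; ring
    rw [← e]
    exact h1.trans (hmain.trans h2)
  have h4 : c₁ ^ 2 * (x : ℝ) ^ 4 ≤ 389 * (x : ℝ) ^ 3 * Ax := by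
    have h := (div_le_iff₀ hL4).mp h3
    have e2 : 389 * (x : ℝ) ^ 3 / Real.log x ^ 4 * Ax * Real.log x ^ 4 = 389 * (x : ℝ) ^ 3 * Ax := by
      field_simp
    linarith [h, e2]
  have h5 : c₁ ^ 2 * (x : ℝ) ≤ 389 * Ax := by
    have hx3 : (0 : ℝ) < (x : ℝ) ^ 3 := by positivity
    have h : (x : ℝ) ^ 3 * (c₁ ^ 2 * x) ≤ (x : ℝ) ^ 3 * (389 * Ax) := by
      calc (x : ℝ) ^ 3 * (c₁ ^ 2 * x) = c₁ ^ 2 * (x : ℝ) ^ 4 := by ring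
        _ ≤ 389 * (x : ℝ) ^ 3 * Ax := h4
        _ = (x : ℝ) ^ 3 * (389 * Ax) := by ring
    exact le_of_mul_le_mul_left h hx3
  calc c₁ ^ 2 / 389 * (x : ℝ) = c₁ ^ 2 * x / 389 := by ring
    _ ≤ Ax := by rw [div_le_iff₀ (by norm_num)]; linarith

/-- **First moment, unconditional instance**: `Σ_{N ≤ x} r(N) ≥ 0.24·x²/log²x` for `x ≥ e^100`
(`c₀ = 0.693`, `x₁ = 2^30`: `c₀²/2 = 0.2401…`). [cite: Nathanson1996, Lemma 7.6 (explicit form proved here)] -/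
theorem sum_goldbachCount_ge_024 {x : ℕ} (hx : Real.exp 100 ≤ (x : ℝ)) :
    0.24 * ((x : ℝ) ^ 2 / Real.log x ^ 2) ≤ ∑ N ∈ range (x + 1), (SingularSeries.goldbachCount N : ℝ) := by
  have hbig : (2 : ℝ) ^ 60 ≤ x := le_trans (le_trans (by norm_num) two_pow_100_le_exp_100) hx
  have hx2 : 2 * 2 ^ 30 ≤ x := by
    have : ((2 * 2 ^ 30 : ℕ) : ℝ) ≤ x := by push_cast; linarith
    exact_mod_cast this
  have h := sum_goldbachCount_ge_of_lower (by norm_num) (by norm_num) primeCountingLowerMul_0693 hx2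
  have e : ((2 ^ 30 : ℕ) : ℝ) = (2 : ℝ) ^ 30 := by norm_num
  rw [e] at h
  refine le_trans ?_ h
  have hx1 : (1 : ℝ) < x := by linarith
  have hL : 0 < Real.log x := Real.log_pos hx1
  have hL2 : 0 < 2 * Real.log x ^ 2 := by positivity
  have hxn : (0 : ℝ) ≤ x := by linarith
  have key : 0.24 * (x : ℝ) ^ 2 * 2 ≤ 0.693 ^ 2 * (((x : ℝ) - (2 : ℝ) ^ 30) ^ 2 - ((2 : ℝ) ^ 30) ^ 2) := by
    nlinarith [mul_le_mul_of_nonneg_right hbig hxn]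
  calc 0.24 * ((x : ℝ) ^ 2 / Real.log x ^ 2) = (0.24 * (x : ℝ) ^ 2 * 2) / (2 * Real.log x ^ 2) := by
        field_simp
    _ ≤ 0.693 ^ 2 * (((x : ℝ) - (2 : ℝ) ^ 30) ^ 2 - ((2 : ℝ) ^ 30) ^ 2) / (2 * Real.log x ^ 2) :=
        div_le_div_of_nonneg_right key hL2.le
    _ = 0.693 ^ 2 * ((((x : ℝ) - (2 : ℝ) ^ 30) ^ 2 - ((2 : ℝ) ^ 30) ^ 2) / (2 * Real.log x ^ 2)) := by ring

/-- **First moment under Rosser–Schoenfeld (3.3)**: `Σ_{N ≤ x} r(N) ≥ 0.4995·x²/log²x` for `x ≥ e^100`.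
[cite: RosserSchoenfeld1962, Theorem 2, eq. (3.3) (as input)] -/
theorem sum_goldbachCount_ge_of_RS (hRS : Literature.NumberTheory.LFunctions.RosserSchoenfeld1962_theorem2)
    {x : ℕ} (hx : Real.exp 100 ≤ (x : ℝ)) :
    0.4995 * ((x : ℝ) ^ 2 / Real.log x ^ 2) ≤ ∑ N ∈ range (x + 1), (SingularSeries.goldbachCount N : ℝ) := by
  have hbig : (2 : ℝ) ^ 60 ≤ x := le_trans (le_trans (by norm_num) two_pow_100_le_exp_100) hx
  have hx2 : 2 * 67 ≤ x := by
    have : ((2 * 67 : ℕ) : ℝ) ≤ x := by push_cast; linarith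
    exact_mod_cast this
  have h := sum_goldbachCount_ge_of_lower (by norm_num) (by norm_num) (primeCountingLowerMul_one_of_RS hRS) hx2
  have e : ((67 : ℕ) : ℝ) = (67 : ℝ) := by norm_num
  rw [e] at h
  refine le_trans ?_ h
  have hx1 : (1 : ℝ) < x := by linarith
  have hL : 0 < Real.log x := Real.log_pos hx1
  have hL2 : 0 < 2 * Real.log x ^ 2 := by positivity
  have hxn : (0 : ℝ) ≤ x := by linarith
  have key : 0.4995 * (x : ℝ) ^ 2 * 2 ≤ 1 ^ 2 * (((x : ℝ) - 67) ^ 2 - (67 : ℝ) ^ 2) := by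
    nlinarith [mul_le_mul_of_nonneg_right hbig hxn]
  calc 0.4995 * ((x : ℝ) ^ 2 / Real.log x ^ 2) = (0.4995 * (x : ℝ) ^ 2 * 2) / (2 * Real.log x ^ 2) := by
        field_simp
    _ ≤ 1 ^ 2 * (((x : ℝ) - 67) ^ 2 - (67 : ℝ) ^ 2) / (2 * Real.log x ^ 2) :=
        div_le_div_of_nonneg_right key hL2.le
    _ = 1 ^ 2 * ((((x : ℝ) - 67) ^ 2 - (67 : ℝ) ^ 2) / (2 * Real.log x ^ 2)) := by ring

/-- **Unconditional**: for `x ≥ e^100`, at least `x/6760` of the integers in `(0, x]` are sums of two primes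
(`0.24²/389 = 1/6753.4…`). [cite: Nathanson1996, Theorem 7.8 (proof; explicit form proved here)] -/
theorem goldbach_count_ge {x : ℕ} (hx : Real.exp 100 ≤ (x : ℝ)) :
    (x : ℝ) / 6760 ≤ #{N ∈ Ioc 0 x | ∃ p q : ℕ, p.Prime ∧ q.Prime ∧ p + q = N} := by
  have h := goldbach_count_ge_of_first_moment (c₁ := 0.24) (by norm_num)
    (fun y hy => sum_goldbachCount_ge_024 hy) hx
  have hx0 : (0 : ℝ) ≤ x := Nat.cast_nonneg x
  have hc : (1 : ℝ) / 6760 ≤ 0.24 ^ 2 / 389 := by norm_num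
  calc (x : ℝ) / 6760 = 1 / 6760 * x := by ring
    _ ≤ 0.24 ^ 2 / 389 * x := mul_le_mul_of_nonneg_right hc hx0
    _ ≤ _ := h

/-- **Under Rosser–Schoenfeld (3.3)**: for `x ≥ e^100`, at least `x/1560` Goldbach numbers in `(0, x]`
(`0.4995²/389 = 1/1559.1…`). [cite: RosserSchoenfeld1962, Theorem 2, eq. (3.3) (as input)] -/
theorem goldbach_count_ge_of_RS (hRS : Literature.NumberTheory.LFunctions.RosserSchoenfeld1962_theorem2)
    {x : ℕ} (hx : Real.exp 100 ≤ (x : ℝ)) :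
    (x : ℝ) / 1560 ≤ #{N ∈ Ioc 0 x | ∃ p q : ℕ, p.Prime ∧ q.Prime ∧ p + q = N} := by
  have h := goldbach_count_ge_of_first_moment (c₁ := 0.4995) (by norm_num)
    (fun y hy => sum_goldbachCount_ge_of_RS hRS hy) hx
  have hx0 : (0 : ℝ) ≤ x := Nat.cast_nonneg x
  have hc : (1 : ℝ) / 1560 ≤ 0.4995 ^ 2 / 389 := by norm_num
  calc (x : ℝ) / 1560 = 1 / 1560 * x := by ring
    _ ≤ 0.4995 ^ 2 / 389 * x := mul_le_mul_of_nonneg_right hc hx0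
    _ ≤ _ := h

/-! ## §6 All `N ≥ 1`: the Shnirel'man density of `A = {0, 1} ∪ {p + q}` -/

/-- The prime shift: `π(N − 2) ≤ #{a ∈ (0, N] : a = p + q}` (`a = p + 2`). [folklore] -/
private theorem primeCounting_sub_two_le_count (N : ℕ) :
    Nat.primeCounting (N - 2) ≤ #{a ∈ Ioc 0 N | ∃ p q : ℕ, p.Prime ∧ q.Prime ∧ p + q = a} := by
  rw [← card_filter_prime_range (N - 2)]
  calc #((range (N - 2 + 1)).filter Nat.Prime)
      = #(((range (N - 2 + 1)).filter Nat.Prime).image (· + 2)) :=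
        (card_image_of_injective _ (add_left_injective 2)).symm
    _ ≤ _ := card_le_card fun a ha => by
        rw [mem_image] at ha
        obtain ⟨p, hp, rfl⟩ := ha
        rw [mem_filter, mem_range] at hp
        have h2 := hp.2.two_le
        rw [mem_filter, mem_Ioc]
        exact ⟨⟨by omega, by omega⟩, p, 2, hp.2, Nat.prime_two, rfl⟩

/-- **All `N ≥ 1`** («Since 1 belongs to the set A», explicit): if `x/K₀ ≤ #{Goldbach numbers in (0, x]}` for
`x ≥ e^100` and `K₀ ≥ 402`, then `N/K₀ ≤ A(N)` for every `N ≥ 1`, `A = {0, 1} ∪ {p + q}` (for `N ≤ K₀` use `1 ∈ A`;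
for `K₀ < N < e^100` the shifted primes `p + 2` and `π(m) ≥ m/(4 log m)`, `log m < 100`).
[cite: Nathanson1996, Thm 7.8 (proof, explicit)] -/
theorem count_ge_allN {K₀ : ℕ} (hK₀ : 402 ≤ K₀)
    (hlarge : ∀ x : ℕ, Real.exp 100 ≤ (x : ℝ) →
      (x : ℝ) / K₀ ≤ #{N ∈ Ioc 0 x | ∃ p q : ℕ, p.Prime ∧ q.Prime ∧ p + q = N})
    {N : ℕ} (hN : 1 ≤ N) :
    (N : ℝ) / K₀ ≤ #{a ∈ Ioc 0 N | a ∈ (({0, 1} : Set ℕ) ∪ {n | ∃ p q : ℕ, p.Prime ∧ q.Prime ∧ p + q = n})} := by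
  set A : Set ℕ := ({0, 1} : Set ℕ) ∪ {n | ∃ p q : ℕ, p.Prime ∧ q.Prime ∧ p + q = n} with hA
  have hK₀r : (402 : ℝ) ≤ K₀ := by exact_mod_cast hK₀
  have hGA : #{a ∈ Ioc 0 N | ∃ p q : ℕ, p.Prime ∧ q.Prime ∧ p + q = a} ≤ #{a ∈ Ioc 0 N | a ∈ A} :=
    card_le_card fun a ha => by
      rw [mem_filter] at ha ⊢
      exact ⟨ha.1, Or.inr ha.2⟩
  by_cases hbig : Real.exp 100 ≤ (N : ℝ)
  · exact (hlarge N hbig).trans (by exact_mod_cast hGA)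
  rw [not_le] at hbig
  by_cases hsmall : N ≤ K₀
  · have h1 : 1 ≤ #{a ∈ Ioc 0 N | a ∈ A} :=
      card_pos.mpr ⟨1, by
        rw [mem_filter, mem_Ioc]
        exact ⟨⟨by omega, hN⟩, Or.inl (by simp)⟩⟩
    have h1' : (1 : ℝ) ≤ #{a ∈ Ioc 0 N | a ∈ A} := by exact_mod_cast h1
    have h2 : (N : ℝ) / K₀ ≤ 1 := by
      rw [div_le_one (by linarith)]
      exact_mod_cast hsmall
    linarith
  · rw [not_le] at hsmall
    have hN2 : 32 ≤ N - 2 := by omega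
    have hπ := ShnirelmanGoldbachTheorem.primeCounting_ge hN2
    have hcount : (Nat.primeCounting (N - 2) : ℝ) ≤ #{a ∈ Ioc 0 N | a ∈ A} := by
      exact_mod_cast (primeCounting_sub_two_le_count N).trans hGA
    have hNr : ((N - 2 : ℕ) : ℝ) = (N : ℝ) - 2 := by
      rw [Nat.cast_sub (by omega : 2 ≤ N)]; norm_num
    have hN36 : (403 : ℝ) ≤ N := by exact_mod_cast (by omega : 403 ≤ N)
    have hlog : Real.log ((N : ℝ) - 2) < 100 := by
      have h1 : Real.log ((N : ℝ) - 2) ≤ Real.log N := Real.log_le_log (by linarith) (by linarith)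
      have h2 : Real.log (N : ℝ) < 100 := by
        have := Real.log_lt_log (by linarith) hbig
        rwa [Real.log_exp] at this
      linarith
    have hlogpos : 0 < Real.log ((N : ℝ) - 2) := Real.log_pos (by linarith)
    rw [hNr] at hπ
    have hNK : (K₀ : ℝ) + 1 ≤ N := by exact_mod_cast (show K₀ + 1 ≤ N by omega)
    calc (N : ℝ) / K₀ ≤ ((N : ℝ) - 2) / 400 := by
          rw [div_le_div_iff₀ (by linarith) (by norm_num)]
          nlinarith [mul_le_mul_of_nonneg_right hNK (by linarith : (0 : ℝ) ≤ K₀ - 400),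
            mul_le_mul hK₀r (by linarith : (1 : ℝ) ≤ K₀ - 401) (by norm_num) (by linarith)]
      _ ≤ ((N : ℝ) - 2) / (4 * Real.log ((N : ℝ) - 2)) :=
          div_le_div_of_nonneg_left (by linarith) (by positivity) (by linarith)
      _ ≤ (Nat.primeCounting (N - 2) : ℝ) := hπ
      _ ≤ _ := hcount

/-- `σ(A) ≥ 1/K₀` from `A(N) ≥ N/K₀` (`N ≥ 1`). [cite: Nathanson1996, Theorem 7.8 (proof: from a counting bound to positive Shnirel'man density)] -/
theorem schnirelmannDensity_ge_of_count {K₀ : ℕ}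
    (h : ∀ N : ℕ, 1 ≤ N → (N : ℝ) / K₀ ≤
      #{a ∈ Ioc 0 N | a ∈ (({0, 1} : Set ℕ) ∪ {n | ∃ p q : ℕ, p.Prime ∧ q.Prime ∧ p + q = n})}) :
    (1 : ℝ) / K₀ ≤ schnirelmannDensity (({0, 1} : Set ℕ) ∪ {n | ∃ p q : ℕ, p.Prime ∧ q.Prime ∧ p + q = n}) := by
  rw [le_schnirelmannDensity_iff]
  intro n hn
  have hn' : (0 : ℝ) < n := by exact_mod_cast hn
  rw [le_div_iff₀ hn']
  have := h n hn
  calc (1 : ℝ) / K₀ * n = (n : ℝ) / K₀ := by ring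
    _ ≤ _ := by convert this using 2

/-- **Unconditional count for all `N ≥ 1`**: `A(N) ≥ N/6760` for `A = {0, 1} ∪ {p + q}`. [cite: Nathanson1996, Theorem 7.8 (explicit constant proved here)] -/
theorem goldbach_A_count_ge_allN {N : ℕ} (hN : 1 ≤ N) :
    (N : ℝ) / 6760 ≤ #{a ∈ Ioc 0 N | a ∈ (({0, 1} : Set ℕ) ∪ {n | ∃ p q : ℕ, p.Prime ∧ q.Prime ∧ p + q = n})} := by
  have h := count_ge_allN (K₀ := 6760) (by norm_num)
    (fun x hx => by have := goldbach_count_ge hx; exact_mod_cast this) hN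
  exact_mod_cast h

/-- **Theorem 7.8, explicit**: the Shnirel'man density of `A = {0, 1} ∪ {p + q : p, q prime}` is at least `1/6760`.
[cite: Nathanson1996, Thm 7.8 (explicit constant proved here)] -/
theorem schnirelmannDensity_goldbach_ge :
    (1 : ℝ) / 6760 ≤ schnirelmannDensity (({0, 1} : Set ℕ) ∪ {n | ∃ p q : ℕ, p.Prime ∧ q.Prime ∧ p + q = n}) := by
  have h := schnirelmannDensity_ge_of_count (K₀ := 6760)
    (fun N hN => by have := goldbach_A_count_ge_allN hN; exact_mod_cast this)
  exact_mod_cast h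

/-- **Under Rosser–Schoenfeld (3.3)**: `σ(A) ≥ 1/1560`. [cite: RosserSchoenfeld1962, Theorem 2, eq. (3.3) (as input)] -/
theorem schnirelmannDensity_goldbach_ge_of_RS
    (hRS : Literature.NumberTheory.LFunctions.RosserSchoenfeld1962_theorem2) :
    (1 : ℝ) / 1560 ≤ schnirelmannDensity (({0, 1} : Set ℕ) ∪ {n | ∃ p q : ℕ, p.Prime ∧ q.Prime ∧ p + q = n}) := by
  have h := schnirelmannDensity_ge_of_count (K₀ := 1560)
    (fun N hN => by
      have := count_ge_allN (K₀ := 1560) (by norm_num)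
        (fun x hx => by have := goldbach_count_ge_of_RS hRS hx; exact_mod_cast this) hN
      exact_mod_cast this)
  exact_mod_cast h

/-! ## §7 The Shnirel'man–Goldbach theorem with an explicit number of summands -/

/-- `(1 − 1/K)^ℓ ≤ 1/2` as soon as `ℓ ≥ K log 2` (`1 − t ≤ e^{−t}`). [folklore] -/
private theorem one_sub_inv_pow_le_half {K ℓ : ℕ} (hK : 0 < K) (hℓ : Real.log 2 * K ≤ ℓ) :
    (1 - 1 / (K : ℝ)) ^ ℓ ≤ 1 / 2 := by
  have hK' : (0 : ℝ) < K := by exact_mod_cast hK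
  have hK1 : (1 : ℝ) ≤ K := by exact_mod_cast hK
  have h1 : (0 : ℝ) ≤ 1 - 1 / K := by
    rw [sub_nonneg, div_le_one hK']
    exact hK1
  have h2 : 1 - 1 / (K : ℝ) ≤ Real.exp (-(1 / K)) := by
    have := Real.add_one_le_exp (-(1 / (K : ℝ)))
    linarith
  calc (1 - 1 / (K : ℝ)) ^ ℓ ≤ Real.exp (-(1 / K)) ^ ℓ := pow_le_pow_left₀ h1 h2 ℓ
    _ = Real.exp (ℓ * (-(1 / K))) := (Real.exp_nat_mul _ ℓ).symm
    _ ≤ Real.exp (-Real.log 2) := by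
        rw [Real.exp_le_exp]
        have h3 : Real.log 2 ≤ (ℓ : ℝ) / K := by rw [le_div_iff₀ hK']; exact hℓ
        have e : (ℓ : ℝ) * (-(1 / K)) = -((ℓ : ℝ) / K) := by ring
        rw [e]
        linarith
    _ = 1 / 2 := by rw [Real.exp_neg, Real.exp_log (by norm_num)]; norm_num

/-- Joint bookkeeping for a finite sum of elements of `A = {0, 1} ∪ {p + q}`: it is `k + Σ M` with `k` ones and a
multiset `M` of primes with `2k + |M| ≤ 2·(number of summands)` (sharper than the tree's separate bounds, which give
`3h + 1`). [cite: Nathanson1996, Thm 7.9 (proof)] -/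
theorem exists_repr_joint (s : Finset ℕ) (g : ℕ → ℕ)
    (hg : ∀ i ∈ s, g i ∈ (({0, 1} : Set ℕ) ∪ {n | ∃ p q : ℕ, p.Prime ∧ q.Prime ∧ p + q = n})) :
    ∃ (k : ℕ) (M : Multiset ℕ), (∀ p ∈ M, p.Prime) ∧ 2 * k + Multiset.card M ≤ 2 * #s ∧
      k + M.sum = ∑ i ∈ s, g i := by
  induction s using Finset.induction_on with
  | empty => exact ⟨0, 0, by simp, by simp, by simp⟩
  | insert i s hi ih =>
      obtain ⟨k, M, hM, hcard, hsum⟩ := ih fun j hj => hg j (mem_insert_of_mem hj)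
      have hgi := hg i (mem_insert_self i s)
      rw [sum_insert hi, card_insert_of_notMem hi]
      rcases hgi with h01 | ⟨p, q, hp, hq, hpq⟩
      · have h01' : g i = 0 ∨ g i = 1 := by simpa using h01
        rcases h01' with h0 | h1
        · exact ⟨k, M, hM, by omega, by rw [h0]; omega⟩
        · exact ⟨k + 1, M, hM, by omega, by rw [h1]; omega⟩
      · refine ⟨k, p ::ₘ q ::ₘ M, fun r hr => ?_, ?_, ?_⟩
        · rw [Multiset.mem_cons, Multiset.mem_cons] at hr
          rcases hr with rfl | rfl | hr
          · exact hp
          · exact hq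
          · exact hM r hr
        · rw [Multiset.card_cons, Multiset.card_cons]; omega
        · rw [Multiset.sum_cons, Multiset.sum_cons, ← hpq]; omega

/-- **From density to an explicit basis**: if `σ(A) ≥ 1/K₀` and `ℓ ≥ K₀ log 2` then every `N ≥ 2` is a sum of at most
`4ℓ + 1` primes (`(1 − σ)^ℓ ≤ ½` ⇒ `(2ℓ)A = ℕ` by the tree's Theorem 7.7; `N − 2 = k·1 + Σ_{pairs}` with
`2k + #primes ≤ 4ℓ`; `k + 2` is a sum of `⌊k/2⌋ + 1` primes). [cite: Nathanson1996, Thm 7.9 (proof; explicit)] -/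
theorem sum_of_primes_of_density {K₀ ℓ : ℕ} (hK₀ : 0 < K₀)
    (hσ : (1 : ℝ) / K₀ ≤ schnirelmannDensity (({0, 1} : Set ℕ) ∪ {n | ∃ p q : ℕ, p.Prime ∧ q.Prime ∧ p + q = n}))
    (hℓ : Real.log 2 * K₀ ≤ ℓ) (N : ℕ) (hN : 2 ≤ N) :
    ∃ M : Multiset ℕ, (∀ p ∈ M, p.Prime) ∧ Multiset.card M ≤ 4 * ℓ + 1 ∧ M.sum = N := by
  set A : Set ℕ := ({0, 1} : Set ℕ) ∪ {n | ∃ p q : ℕ, p.Prime ∧ q.Prime ∧ p + q = n} with hA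
  have h0A : (0 : ℕ) ∈ A := Or.inl (by simp)
  have hpow : (1 - schnirelmannDensity A) ^ ℓ ≤ 1 / 2 := by
    have h1 := one_sub_inv_pow_le_half hK₀ hℓ
    have h2 : (1 - schnirelmannDensity A) ^ ℓ ≤ (1 - 1 / (K₀ : ℝ)) ^ ℓ :=
      pow_le_pow_left₀ (by linarith [schnirelmannDensity_le_one (A := A)]) (by linarith) ℓ
    exact h2.trans h1
  have hbasis : (2 * ℓ) • A = Set.univ :=
    SchnirelmannBasisTheorem.nsmul_eq_univ_of_pow_le_half h0A (ℓ := ℓ) (by convert hpow)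
  have hmem : N - 2 ∈ ∑ _i ∈ range (2 * ℓ), A := by
    rw [sum_const, card_range, hbasis]
    exact Set.mem_univ _
  rw [Set.mem_finsetSum] at hmem
  obtain ⟨g, hg, hgsum⟩ := hmem
  obtain ⟨k, M, hM, hcard, hsum⟩ := exists_repr_joint (range (2 * ℓ)) g fun i hi => hg hi
  rw [card_range] at hcard
  rw [hgsum] at hsum
  obtain ⟨M', hM', hcard', hsum'⟩ := ShnirelmanGoldbachTheorem.exists_multiset_primes_sum_eq_add_two k
  refine ⟨M' + M, fun p hp => ?_, ?_, ?_⟩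
  · rw [Multiset.mem_add] at hp
    exact hp.elim (hM' p) (hM p)
  · rw [Multiset.card_add]
    omega
  · rw [Multiset.sum_add, hsum']
    omega

/-- **The Shnirel'man–Goldbach theorem, explicit and unconditional: every integer `N ≥ 2` is a sum of at most
`18745` primes** (`σ ≥ 1/6760`, `ℓ = 4686 ≥ 6760 log 2 = 4685.67…`, `4ℓ + 1 = 18745`).
[cite: Nathanson1996, Thm 7.9 (explicit constant proved here)] -/
theorem schnirelmann_goldbach_explicit (N : ℕ) (hN : 2 ≤ N) :
    ∃ M : Multiset ℕ, (∀ p ∈ M, p.Prime) ∧ Multiset.card M ≤ 18745 ∧ M.sum = N := by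
  have hℓ : Real.log 2 * ((6760 : ℕ) : ℝ) ≤ ((4686 : ℕ) : ℝ) := by
    have := Real.log_two_lt_d9
    push_cast
    nlinarith
  have hσ : (1 : ℝ) / ((6760 : ℕ) : ℝ)
      ≤ schnirelmannDensity (({0, 1} : Set ℕ) ∪ {n | ∃ p q : ℕ, p.Prime ∧ q.Prime ∧ p + q = n}) := by
    have := schnirelmannDensity_goldbach_ge
    exact_mod_cast this
  exact sum_of_primes_of_density (K₀ := 6760) (ℓ := 4686) (by norm_num) hσ hℓ N hN

/-- **Conditional column**: under Rosser–Schoenfeld (3.3) (`π(x) > x/(log x − ½)`, `x ≥ 67`, one registered fact)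
every integer `N ≥ 2` is a sum of at most `4329` primes (`σ ≥ 1/1560`, `ℓ = 1082`).
[cite: RosserSchoenfeld1962, Theorem 2, eq. (3.3) (as input)] -/
theorem schnirelmann_goldbach_of_RS (hRS : Literature.NumberTheory.LFunctions.RosserSchoenfeld1962_theorem2)
    (N : ℕ) (hN : 2 ≤ N) :
    ∃ M : Multiset ℕ, (∀ p ∈ M, p.Prime) ∧ Multiset.card M ≤ 4329 ∧ M.sum = N := by
  have hℓ : Real.log 2 * ((1560 : ℕ) : ℝ) ≤ ((1082 : ℕ) : ℝ) := by
    have := Real.log_two_lt_d9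
    push_cast
    nlinarith
  have hσ : (1 : ℝ) / ((1560 : ℕ) : ℝ)
      ≤ schnirelmannDensity (({0, 1} : Set ℕ) ∪ {n | ∃ p q : ℕ, p.Prime ∧ q.Prime ∧ p + q = n}) := by
    have := schnirelmannDensity_goldbach_ge_of_RS hRS
    exact_mod_cast this
  exact sum_of_primes_of_density (K₀ := 1560) (ℓ := 1082) (by norm_num) hσ hℓ N hN

/-! ## §8 With Mann's theorem (tree `MannTheorem.min_one_add_le_schnirelmannDensity_add`): `K₀ • A = ℕ`,
hence `2K₀ + 1` primes — `13521` unconditionally, `3121` under Rosser–Schoenfeld (3.3) -/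

/-- `0 ∈ h • A` when `0 ∈ A`. [folklore] -/
private theorem zero_mem_nsmul' {A : Set ℕ} (hA : (0 : ℕ) ∈ A) : ∀ h : ℕ, (0 : ℕ) ∈ h • A
  | 0 => by rw [zero_nsmul]; exact Set.zero_mem_zero
  | h + 1 => by
      rw [succ_nsmul]
      simpa using Set.add_mem_add (zero_mem_nsmul' hA h) hA

/-- **Mann's theorem iterated**: `min(1, h·σ(A)) ≤ σ(h • A)` for `0 ∈ A`.
[cite: Khinchin1952, Ch. II §4 (6) (Mann's theorem, iterated)] -/
theorem min_one_mul_le_schnirelmannDensity_nsmul {A : Set ℕ} (hA : (0 : ℕ) ∈ A) :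
    ∀ h : ℕ, min 1 ((h : ℝ) * schnirelmannDensity A) ≤ schnirelmannDensity (h • A)
  | 0 => by simp [schnirelmannDensity_nonneg]
  | h + 1 => by
      have ih := min_one_mul_le_schnirelmannDensity_nsmul hA h
      have hm := MannTheorem.min_one_add_le_schnirelmannDensity_add (zero_mem_nsmul' hA h) hA
      rw [succ_nsmul]
      refine le_trans ?_ hm
      push_cast
      rcases le_or_gt 1 ((h : ℝ) * schnirelmannDensity A) with h1 | h1
      · rw [min_eq_left h1] at ih
        have h2 : (1 : ℝ) ≤ schnirelmannDensity (h • A) + schnirelmannDensity A := by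
          linarith [schnirelmannDensity_nonneg (A := A)]
        rw [min_eq_left h2]
        exact min_le_left _ _
      · rw [min_eq_right h1.le] at ih
        exact min_le_min le_rfl (by linarith)

/-- **Basis of exact order `K₀` from density `1/K₀`** (Mann): `0 ∈ A`, `σ(A) ≥ 1/K₀ > 0` ⇒ `K₀ • A = ℕ`.
[cite: Khinchin1952, Ch. II §4 (consequence of Mann's theorem)] -/
theorem nsmul_eq_univ_of_density {A : Set ℕ} (hA : (0 : ℕ) ∈ A) {K₀ : ℕ} (hK₀ : 0 < K₀)
    (hσ : (1 : ℝ) / K₀ ≤ schnirelmannDensity A) : K₀ • A = Set.univ := by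
  have hK' : (0 : ℝ) < K₀ := by exact_mod_cast hK₀
  have hK : (1 : ℝ) ≤ (K₀ : ℝ) * schnirelmannDensity A := by
    rw [div_le_iff₀' hK'] at hσ
    exact hσ
  have h1 : (1 : ℝ) ≤ schnirelmannDensity (K₀ • A) := by
    have := min_one_mul_le_schnirelmannDensity_nsmul hA K₀
    rwa [min_eq_left hK] at this
  have hσ1 : schnirelmannDensity (K₀ • A) = 1 := le_antisymm schnirelmannDensity_le_one h1
  exact (schnirelmannDensity_eq_one_iff_of_zero_mem (zero_mem_nsmul' hA K₀)).mp hσ1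

/-- **From density to an explicit basis, via Mann**: `σ(A) ≥ 1/K₀` ⇒ every `N ≥ 2` is a sum of at most `2K₀ + 1`
primes (`K₀ • A = ℕ`; `N − 2 = k·1 + Σ_{pairs}`, `2k + #primes ≤ 2K₀`; `k + 2` is a sum of `⌊k/2⌋ + 1` primes).
[cite: Nathanson1996, Thm 7.9 (proof, with Mann's theorem in place of Thm 7.7)] -/
theorem sum_of_primes_of_density_mann {K₀ : ℕ} (hK₀ : 0 < K₀)
    (hσ : (1 : ℝ) / K₀ ≤ schnirelmannDensity (({0, 1} : Set ℕ) ∪ {n | ∃ p q : ℕ, p.Prime ∧ q.Prime ∧ p + q = n}))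
    (N : ℕ) (hN : 2 ≤ N) :
    ∃ M : Multiset ℕ, (∀ p ∈ M, p.Prime) ∧ Multiset.card M ≤ 2 * K₀ + 1 ∧ M.sum = N := by
  set A : Set ℕ := ({0, 1} : Set ℕ) ∪ {n | ∃ p q : ℕ, p.Prime ∧ q.Prime ∧ p + q = n} with hA
  have h0A : (0 : ℕ) ∈ A := Or.inl (by simp)
  have hbasis : K₀ • A = Set.univ := nsmul_eq_univ_of_density h0A hK₀ (by convert hσ)
  have hmem : N - 2 ∈ ∑ _i ∈ range K₀, A := by
    rw [sum_const, card_range, hbasis]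
    exact Set.mem_univ _
  rw [Set.mem_finsetSum] at hmem
  obtain ⟨g, hg, hgsum⟩ := hmem
  obtain ⟨k, M, hM, hcard, hsum⟩ := exists_repr_joint (range K₀) g fun i hi => hg hi
  rw [card_range] at hcard
  rw [hgsum] at hsum
  obtain ⟨M', hM', hcard', hsum'⟩ := ShnirelmanGoldbachTheorem.exists_multiset_primes_sum_eq_add_two k
  refine ⟨M' + M, fun p hp => ?_, ?_, ?_⟩
  · rw [Multiset.mem_add] at hp
    exact hp.elim (hM' p) (hM p)
  · rw [Multiset.card_add]
    omega
  · rw [Multiset.sum_add, hsum']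
    omega

/-- **The Shnirel'man–Goldbach theorem, explicit, unconditional, with Mann's theorem: every integer `N ≥ 2` is a
sum of at most `13521` primes** (`σ ≥ 1/6760`, `6760 • A = ℕ`, `2·6760 + 1 = 13521`).
[cite: Nathanson1996, Thm 7.9 (explicit constant proved here)] -/
theorem schnirelmann_goldbach_explicit_mann (N : ℕ) (hN : 2 ≤ N) :
    ∃ M : Multiset ℕ, (∀ p ∈ M, p.Prime) ∧ Multiset.card M ≤ 13521 ∧ M.sum = N := by
  have hσ : (1 : ℝ) / ((6760 : ℕ) : ℝ)
      ≤ schnirelmannDensity (({0, 1} : Set ℕ) ∪ {n | ∃ p q : ℕ, p.Prime ∧ q.Prime ∧ p + q = n}) := by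
    have := schnirelmannDensity_goldbach_ge
    exact_mod_cast this
  exact sum_of_primes_of_density_mann (K₀ := 6760) (by norm_num) hσ N hN

/-- **Conditional column with Mann's theorem**: under Rosser–Schoenfeld (3.3) every integer `N ≥ 2` is a sum of at
most `3121` primes (`σ ≥ 1/1560`, `2·1560 + 1 = 3121`). [cite: RosserSchoenfeld1962, Theorem 2, eq. (3.3) (as input)] -/
theorem schnirelmann_goldbach_of_RS_mann (hRS : Literature.NumberTheory.LFunctions.RosserSchoenfeld1962_theorem2)
    (N : ℕ) (hN : 2 ≤ N) :
    ∃ M : Multiset ℕ, (∀ p ∈ M, p.Prime) ∧ Multiset.card M ≤ 3121 ∧ M.sum = N := by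
  have hσ : (1 : ℝ) / ((1560 : ℕ) : ℝ)
      ≤ schnirelmannDensity (({0, 1} : Set ℕ) ∪ {n | ∃ p q : ℕ, p.Prime ∧ q.Prime ∧ p + q = n}) := by
    have := schnirelmannDensity_goldbach_ge_of_RS hRS
    exact_mod_cast this
  exact sum_of_primes_of_density_mann (K₀ := 1560) (by norm_num) hσ N hN


/-! ## §9 With Chebyshev's constant (tree `ChebyshevExplicit.psi_ge_chebyshev`: `A·n − 5 log n ≤ ψ(n)`, `n ≥ 30`,
`A ≥ 0.921292`): `c₀ = 0.9212` from `10^6`, `σ ≥ 1/2164`, every `N ≥ 2` a sum of at most `4329` primes — unconditionally -/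

/-- **First moment with Chebyshev's constant**: `Σ_{N ≤ x} r(N) ≥ 0.424·x²/log²x` for `x ≥ e^100`
(`c₀ = 0.9212`, `x₁ = 10^6`: `c₀²/2 = 0.42430…`). [cite: Nathanson1996, Lemma 7.6 (explicit form proved here)] -/
theorem sum_goldbachCount_ge_0424 {x : ℕ} (hx : Real.exp 100 ≤ (x : ℝ)) :
    0.424 * ((x : ℝ) ^ 2 / Real.log x ^ 2) ≤ ∑ N ∈ range (x + 1), (SingularSeries.goldbachCount N : ℝ) := by
  have hbig : (2 : ℝ) ^ 60 ≤ x := le_trans (le_trans (by norm_num) two_pow_100_le_exp_100) hx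
  have h60 : (2000000 : ℝ) ≤ (2 : ℝ) ^ 60 := by norm_num
  have hx2 : 2 * 10 ^ 6 ≤ x := by
    have : ((2 * 10 ^ 6 : ℕ) : ℝ) ≤ x := by push_cast; linarith
    exact_mod_cast this
  have h := sum_goldbachCount_ge_of_lower (by norm_num) (by norm_num) primeCountingLowerMul_09212 hx2
  have e : ((10 ^ 6 : ℕ) : ℝ) = (10 : ℝ) ^ 6 := by norm_num
  rw [e] at h
  refine le_trans ?_ h
  have hx1 : (1 : ℝ) < x := by linarith
  have hL : 0 < Real.log x := Real.log_pos hx1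
  have hL2 : 0 < 2 * Real.log x ^ 2 := by positivity
  have hxn : (0 : ℝ) ≤ x := by linarith
  have key : 0.424 * (x : ℝ) ^ 2 * 2 ≤ 0.9212 ^ 2 * (((x : ℝ) - (10 : ℝ) ^ 6) ^ 2 - ((10 : ℝ) ^ 6) ^ 2) := by
    nlinarith [mul_le_mul_of_nonneg_right hbig hxn]
  calc 0.424 * ((x : ℝ) ^ 2 / Real.log x ^ 2) = (0.424 * (x : ℝ) ^ 2 * 2) / (2 * Real.log x ^ 2) := by
        field_simp
    _ ≤ 0.9212 ^ 2 * (((x : ℝ) - (10 : ℝ) ^ 6) ^ 2 - ((10 : ℝ) ^ 6) ^ 2) / (2 * Real.log x ^ 2) :=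
        div_le_div_of_nonneg_right key hL2.le
    _ = 0.9212 ^ 2 * ((((x : ℝ) - (10 : ℝ) ^ 6) ^ 2 - ((10 : ℝ) ^ 6) ^ 2) / (2 * Real.log x ^ 2)) := by ring

/-- **Unconditional, Chebyshev constant**: for `x ≥ e^100`, at least `x/2164` of the integers in `(0, x]` are sums of
two primes (`0.424²/389 = 1/2163.8…`). [cite: Nathanson1996, Theorem 7.8 (proof; explicit form proved here)] -/
theorem goldbach_count_ge_2164 {x : ℕ} (hx : Real.exp 100 ≤ (x : ℝ)) :
    (x : ℝ) / 2164 ≤ #{N ∈ Ioc 0 x | ∃ p q : ℕ, p.Prime ∧ q.Prime ∧ p + q = N} := by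
  have h := goldbach_count_ge_of_first_moment (c₁ := 0.424) (by norm_num)
    (fun y hy => sum_goldbachCount_ge_0424 hy) hx
  have hx0 : (0 : ℝ) ≤ x := Nat.cast_nonneg x
  have hc : (1 : ℝ) / 2164 ≤ 0.424 ^ 2 / 389 := by norm_num
  calc (x : ℝ) / 2164 = 1 / 2164 * x := by ring
    _ ≤ 0.424 ^ 2 / 389 * x := mul_le_mul_of_nonneg_right hc hx0
    _ ≤ _ := h

/-- **All `N ≥ 1`, Chebyshev constant**: `A(N) ≥ N/2164` for `A = {0, 1} ∪ {p + q}`. [cite: Nathanson1996, Theorem 7.8 (explicit constant proved here)] -/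
theorem goldbach_A_count_ge_allN_2164 {N : ℕ} (hN : 1 ≤ N) :
    (N : ℝ) / 2164 ≤ #{a ∈ Ioc 0 N | a ∈ (({0, 1} : Set ℕ) ∪ {n | ∃ p q : ℕ, p.Prime ∧ q.Prime ∧ p + q = n})} := by
  have h := count_ge_allN (K₀ := 2164) (by norm_num)
    (fun x hx => by have := goldbach_count_ge_2164 hx; exact_mod_cast this) hN
  exact_mod_cast h

/-- **Theorem 7.8, explicit, Chebyshev constant**: `σ({0, 1} ∪ {p + q}) ≥ 1/2164`.
[cite: Nathanson1996, Thm 7.8 (explicit constant proved here)] -/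
theorem schnirelmannDensity_goldbach_ge_2164 :
    (1 : ℝ) / 2164 ≤ schnirelmannDensity (({0, 1} : Set ℕ) ∪ {n | ∃ p q : ℕ, p.Prime ∧ q.Prime ∧ p + q = n}) := by
  have h := schnirelmannDensity_ge_of_count (K₀ := 2164)
    (fun N hN => by have := goldbach_A_count_ge_allN_2164 hN; exact_mod_cast this)
  exact_mod_cast h

/-- ★ **The Shnirel'man–Goldbach theorem, explicit and unconditional — the best constant of this file: every integer
`N ≥ 2` is a sum of at most `4329` primes** (`σ ≥ 1/2164` from Chebyshev's `0.9212`; Mann: `2164·A = ℕ`,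
`2·2164 + 1 = 4329`).  No hypotheses, no named facts. [cite: Nathanson1996, Thm 7.9 (explicit constant proved here)] -/
theorem schnirelmann_goldbach_le_4329 (N : ℕ) (hN : 2 ≤ N) :
    ∃ M : Multiset ℕ, (∀ p ∈ M, p.Prime) ∧ Multiset.card M ≤ 4329 ∧ M.sum = N := by
  have hσ : (1 : ℝ) / ((2164 : ℕ) : ℝ)
      ≤ schnirelmannDensity (({0, 1} : Set ℕ) ∪ {n | ∃ p q : ℕ, p.Prime ∧ q.Prime ∧ p + q = n}) := by
    have := schnirelmannDensity_goldbach_ge_2164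
    exact_mod_cast this
  exact sum_of_primes_of_density_mann (K₀ := 2164) (by norm_num) hσ N hN

/-! ## §10 The factor `1/3` (ROUND-25): the WEIGHTED mean square `Σ_{even N ≤ x} N²·f(N)² ≤ 0.4431·x³`,
`S₂ ≤ 142·x³/log⁴x`, `σ ≥ 1/790`, every `N ≥ 2` a sum of at most `1581` primes (RS (3.3): `1141`)

§4 bounded `N²/log⁴N ≤ x²/log⁴x` termwise, which wastes the factor `3` of `∫₀ˣ t² dt = x³/3`.  Here the divisor-sum
expansion of §3 is run with the weight `N²` (`Σ_{m ≤ M} m² = M³/3 + M²/2 + M/6`); the boundary terms are controlled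
by the Rankin-type inequality `1_{2d ≤ x} ≤ √x / 10^{#{p ∣ d : p > 100}}` and Mathlib's `harmonic_le_one_add_log`;
the `log`-weight is handled by splitting at `x/e²`. -/

/-- `Σ_{m ≤ M} m² = M(M+1)(2M+1)/6`. [folklore] -/
private theorem sum_range_succ_sq (M : ℕ) :
    ∑ m ∈ range (M + 1), (m : ℝ) ^ 2 = (M : ℝ) * ((M : ℝ) + 1) * (2 * (M : ℝ) + 1) / 6 := by
  induction M with
  | zero => simp
  | succ M ih =>
      rw [sum_range_succ, ih]
      push_cast
      ring

/-- `Σ_{N ∈ (0, x], q ∣ N} N² ≤ x³/(3q) + x²/2 + qx/6` (`= q²·Σ_{m ≤ ⌊x/q⌋} m²`). [folklore] -/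
private theorem sum_sq_filter_dvd_le {x q : ℕ} (hq : 0 < q) :
    ∑ N ∈ (Ioc 0 x).filter (q ∣ ·), (N : ℝ) ^ 2
      ≤ (x : ℝ) ^ 3 / (3 * q) + (x : ℝ) ^ 2 / 2 + (q : ℝ) * x / 6 := by
  set M := x / q with hM
  have hsub : (Ioc 0 x).filter (q ∣ ·) ⊆ (range (M + 1)).image (fun m => q * m) := by
    intro N hN
    rw [mem_filter, mem_Ioc] at hN
    obtain ⟨⟨_, hNx⟩, hqN⟩ := hN
    rw [mem_image]
    refine ⟨N / q, ?_, Nat.mul_div_cancel' hqN⟩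
    rw [mem_range, Nat.lt_succ_iff, hM]
    exact Nat.div_le_div_right hNx
  have h1 : ∑ N ∈ (Ioc 0 x).filter (q ∣ ·), (N : ℝ) ^ 2
      ≤ ∑ N ∈ (range (M + 1)).image (fun m => q * m), (N : ℝ) ^ 2 :=
    sum_le_sum_of_subset_of_nonneg hsub fun N _ _ => by positivity
  have h2 : ∑ N ∈ (range (M + 1)).image (fun m => q * m), (N : ℝ) ^ 2
      = (q : ℝ) ^ 2 * ∑ m ∈ range (M + 1), (m : ℝ) ^ 2 := by
    rw [sum_image (fun a _ b _ h => Nat.eq_of_mul_eq_mul_left hq h), mul_sum]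
    refine sum_congr rfl fun m _ => ?_
    push_cast
    ring
  have hMu : (M : ℝ) ≤ (x : ℝ) / q := by rw [hM]; exact Nat.cast_div_le
  have hM0 : (0 : ℝ) ≤ M := Nat.cast_nonneg M
  have hq0 : (0 : ℝ) < q := by exact_mod_cast hq
  rw [sum_range_succ_sq] at h2
  have h3 : (M : ℝ) * ((M : ℝ) + 1) * (2 * (M : ℝ) + 1) / 6
      ≤ ((x : ℝ) / q) ^ 3 / 3 + ((x : ℝ) / q) ^ 2 / 2 + ((x : ℝ) / q) / 6 := by
    have e : (M : ℝ) * ((M : ℝ) + 1) * (2 * (M : ℝ) + 1) / 6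
        = (M : ℝ) ^ 3 / 3 + (M : ℝ) ^ 2 / 2 + (M : ℝ) / 6 := by ring
    rw [e]
    have hp3 := pow_le_pow_left₀ hM0 hMu 3
    have hp2 := pow_le_pow_left₀ hM0 hMu 2
    linarith
  calc ∑ N ∈ (Ioc 0 x).filter (q ∣ ·), (N : ℝ) ^ 2
      ≤ (q : ℝ) ^ 2 * ((M : ℝ) * ((M : ℝ) + 1) * (2 * (M : ℝ) + 1) / 6) := h1.trans h2.le
    _ ≤ (q : ℝ) ^ 2 * (((x : ℝ) / q) ^ 3 / 3 + ((x : ℝ) / q) ^ 2 / 2 + ((x : ℝ) / q) / 6) :=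
        mul_le_mul_of_nonneg_left h3 (by positivity)
    _ = (x : ℝ) ^ 3 / (3 * q) + (x : ℝ) ^ 2 / 2 + (q : ℝ) * x / 6 := by
        field_simp

/-- `Σ_{N ∈ (0, x], q ∣ N} N² = 0` when `x < q`. [folklore] -/
private theorem sum_sq_filter_dvd_eq_zero {x q : ℕ} (hxq : x < q) :
    ∑ N ∈ (Ioc 0 x).filter (q ∣ ·), (N : ℝ) ^ 2 = 0 := by
  apply sum_eq_zero
  intro N hN
  rw [mem_filter, mem_Ioc] at hN
  obtain ⟨⟨hN0, hNx⟩, hqN⟩ := hN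
  have := Nat.le_of_dvd hN0 hqN
  omega

/-- `100^{#{p ∈ T : p > 100}} ≤ ∏_{p ∈ T} p` for a finite set `T` of positive integers. [folklore] -/
private theorem pow_card_filter_le_prod (T : Finset ℕ) (hT : ∀ p ∈ T, 1 ≤ p) :
    (100 : ℝ) ^ #(T.filter (100 < ·)) ≤ ∏ p ∈ T, (p : ℝ) := by
  rw [← prod_filter_mul_prod_filter_not T (fun p => 100 < p)]
  have h1 : (100 : ℝ) ^ #(T.filter (100 < ·)) ≤ ∏ p ∈ T.filter (100 < ·), (p : ℝ) := by
    rw [← prod_const]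
    exact prod_le_prod (fun _ _ => by norm_num) fun p hp => by
      have := (mem_filter.mp hp).2
      exact_mod_cast this.le
  have h2 : (1 : ℝ) ≤ ∏ p ∈ T.filter (fun p => ¬100 < p), (p : ℝ) := by
    calc (1 : ℝ) = ∏ p ∈ T.filter (fun p => ¬100 < p), (1 : ℝ) := prod_const_one.symm
      _ ≤ _ := prod_le_prod (fun _ _ => zero_le_one) fun p hp => by
          exact_mod_cast hT p (mem_filter.mp hp).1
  have h0 : (0 : ℝ) ≤ ∏ p ∈ T.filter (100 < ·), (p : ℝ) := le_trans (by positivity) h1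
  calc (100 : ℝ) ^ #(T.filter (100 < ·)) = (100 : ℝ) ^ #(T.filter (100 < ·)) * 1 := (mul_one _).symm
    _ ≤ _ := mul_le_mul h1 h2 zero_le_one h0

/-- **Weighted mean square of the singular factor, product form**:
`Σ_{even N ∈ (0, x]} N²·f(N)² ≤ (x³/6)·∏_{2<p≤x}(1 + g(p)/p) + (2/3)·x²·√x·∏_{2<p≤x}(1 + g(p)·c_p)` with `c_p = 1/10`
for `p > 100` and `1` otherwise (expand `f²`, sum `N²` over the even multiples of `d_T = ∏_{p∈T} p`:
`Σ_{m ≤ x/2d} (2dm)² ≤ x³/(6d) + (2/3)x²·1_{2d ≤ x}`, and `1_{2d ≤ x} ≤ √x/10^{#{p∈T : p>100}}`). [folklore] -/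
private theorem sum_even_sq_mul_oddSingularFactor_sq_le_prod (x : ℕ) :
    ∑ N ∈ (Ioc 0 x).filter Even, (N : ℝ) ^ 2 * oddSingularFactor N ^ 2
      ≤ (x : ℝ) ^ 3 / 6 * ∏ p ∈ (range (x + 1)).filter (fun p => p.Prime ∧ 2 < p), (1 + gFactor p / p)
        + 2 / 3 * (x : ℝ) ^ 2 * Real.sqrt x *
          ∏ p ∈ (range (x + 1)).filter (fun p => p.Prime ∧ 2 < p),
            (1 + gFactor p * if 100 < p then (1 / 10 : ℝ) else 1) := by
  set E := (Ioc 0 x).filter Even with hE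
  set O := (range (x + 1)).filter (fun p => p.Prime ∧ 2 < p) with hO
  have hSO : ∀ N ∈ E, N.primeFactors.filter (2 < ·) ⊆ O := by
    intro N hN p hp
    rw [hE, mem_filter, mem_Ioc] at hN
    rw [mem_filter, Nat.mem_primeFactors] at hp
    obtain ⟨⟨hpr, hpd, hN0⟩, hp2⟩ := hp
    rw [hO, mem_filter, mem_range]
    have := Nat.le_of_dvd (by omega) hpd
    exact ⟨by omega, hpr, hp2⟩
  have hg0 : ∀ p ∈ O, 0 ≤ gFactor p := fun p hp => by
    rw [hO, mem_filter] at hp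
    exact gFactor_nonneg hp.2.2
  have hw0 : ∀ T ∈ O.powerset, 0 ≤ ∏ p ∈ T, gFactor p := fun T hT =>
    prod_nonneg fun p hp => hg0 p (mem_powerset.mp hT hp)
  -- Step 1: expand `N² f(N)²` over subsets of `O`
  have hexp : ∀ N ∈ E, (N : ℝ) ^ 2 * oddSingularFactor N ^ 2
      = ∑ T ∈ O.powerset, if T ⊆ N.primeFactors.filter (2 < ·) then (N : ℝ) ^ 2 * ∏ p ∈ T, gFactor p else 0 := by
    intro N hN
    rw [oddSingularFactor_sq_eq, mul_sum, ← sum_filter]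
    apply sum_congr _ (fun _ _ => rfl)
    ext T
    simp only [mem_powerset, mem_filter]
    exact ⟨fun h => ⟨h.trans (hSO N hN), h⟩, fun h => h.2⟩
  -- Step 2: swap the sums
  have hswap : ∑ N ∈ E, (N : ℝ) ^ 2 * oddSingularFactor N ^ 2
      = ∑ T ∈ O.powerset, (∏ p ∈ T, gFactor p) *
          ∑ N ∈ E.filter (fun N => T ⊆ N.primeFactors.filter (2 < ·)), (N : ℝ) ^ 2 := by
    rw [sum_congr rfl hexp, sum_comm]
    refine sum_congr rfl fun T _ => ?_
    rw [← sum_filter, mul_sum]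
    refine sum_congr rfl fun N _ => ?_
    ring
  -- Step 3: the inner sums
  have hinner : ∀ T ∈ O.powerset,
      ∑ N ∈ E.filter (fun N => T ⊆ N.primeFactors.filter (2 < ·)), (N : ℝ) ^ 2
        ≤ (x : ℝ) ^ 3 / (6 * ∏ p ∈ T, (p : ℝ))
          + 2 / 3 * (x : ℝ) ^ 2 * Real.sqrt x * ∏ p ∈ T, (if 100 < p then (1 / 10 : ℝ) else 1) := by
    intro T hT
    rw [mem_powerset] at hT
    have hTprime : ∀ p ∈ T, p.Prime ∧ 2 < p := fun p hp => by
      have := hT hp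
      rw [hO, mem_filter] at this
      exact this.2
    set d := ∏ p ∈ T, p with hd
    have h2d : Nat.Coprime 2 d := Nat.Coprime.prod_right fun p hp =>
      (Nat.coprime_primes Nat.prime_two (hTprime p hp).1).mpr (by have := (hTprime p hp).2; omega)
    have hd0 : 0 < d := prod_pos fun p hp => (hTprime p hp).1.pos
    have hdR : (d : ℝ) = ∏ p ∈ T, (p : ℝ) := by rw [hd]; push_cast; rfl
    have hsub : E.filter (fun N => T ⊆ N.primeFactors.filter (2 < ·)) ⊆ (Ioc 0 x).filter (2 * d ∣ ·) := by
      intro N hN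
      rw [mem_filter, hE, mem_filter] at hN
      obtain ⟨⟨hNx, hNeven⟩, hTS⟩ := hN
      rw [mem_filter]
      refine ⟨hNx, Nat.Coprime.mul_dvd_of_dvd_of_dvd h2d (even_iff_two_dvd.mp hNeven) ?_⟩
      rw [hd]
      exact Finset.prod_primes_dvd N (fun p hp => (hTprime p hp).1.prime) fun p hp => by
        have := hTS hp
        rw [mem_filter, Nat.mem_primeFactors] at this
        exact this.1.2.1
    have hle : ∑ N ∈ E.filter (fun N => T ⊆ N.primeFactors.filter (2 < ·)), (N : ℝ) ^ 2
        ≤ ∑ N ∈ (Ioc 0 x).filter (2 * d ∣ ·), (N : ℝ) ^ 2 :=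
      sum_le_sum_of_subset_of_nonneg hsub fun N _ _ => by positivity
    have hc : ∏ p ∈ T, (if 100 < p then (1 / 10 : ℝ) else 1) = (1 / 10 : ℝ) ^ #(T.filter (100 < ·)) := by
      rw [prod_ite, prod_const, prod_const_one, mul_one]
    rw [hc]
    have hTpos : (0 : ℝ) < ∏ p ∈ T, (p : ℝ) := by rw [← hdR]; exact_mod_cast hd0
    have hxR : (0 : ℝ) ≤ x := Nat.cast_nonneg x
    by_cases h2dx : x < 2 * d
    · rw [sum_sq_filter_dvd_eq_zero h2dx] at hle
      have : (0 : ℝ) ≤ (x : ℝ) ^ 3 / (6 * ∏ p ∈ T, (p : ℝ))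
          + 2 / 3 * (x : ℝ) ^ 2 * Real.sqrt x * (1 / 10 : ℝ) ^ #(T.filter (100 < ·)) := by positivity
      linarith
    · rw [not_lt] at h2dx
      have hmain := sum_sq_filter_dvd_le (x := x) (q := 2 * d) (by omega)
      have h2dR : ((2 * d : ℕ) : ℝ) ≤ x := by exact_mod_cast h2dx
      have hk : (100 : ℝ) ^ #(T.filter (100 < ·)) ≤ ∏ p ∈ T, (p : ℝ) :=
        pow_card_filter_le_prod T fun p hp => (hTprime p hp).1.one_le
      have hdx : (∏ p ∈ T, (p : ℝ)) ≤ x := by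
        rw [← hdR]
        push_cast at h2dR
        linarith [show (0 : ℝ) ≤ d from Nat.cast_nonneg d]
      have h10 : (10 : ℝ) ^ #(T.filter (100 < ·)) ≤ Real.sqrt x := by
        have h := Real.sqrt_le_sqrt (hk.trans hdx)
        rwa [show (100 : ℝ) ^ #(T.filter (100 < ·)) = ((10 : ℝ) ^ #(T.filter (100 < ·))) ^ 2 by
          rw [← pow_mul, mul_comm, pow_mul]; norm_num, Real.sqrt_sq (by positivity)] at h
      have hR : (1 : ℝ) ≤ Real.sqrt x * (1 / 10 : ℝ) ^ #(T.filter (100 < ·)) := by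
        rw [one_div_pow, mul_one_div, le_div_iff₀ (by positivity), one_mul]
        exact h10
      calc ∑ N ∈ E.filter (fun N => T ⊆ N.primeFactors.filter (2 < ·)), (N : ℝ) ^ 2
          ≤ ∑ N ∈ (Ioc 0 x).filter (2 * d ∣ ·), (N : ℝ) ^ 2 := hle
        _ ≤ (x : ℝ) ^ 3 / (3 * ((2 * d : ℕ) : ℝ)) + (x : ℝ) ^ 2 / 2 + ((2 * d : ℕ) : ℝ) * x / 6 := hmain
        _ ≤ (x : ℝ) ^ 3 / (6 * ∏ p ∈ T, (p : ℝ)) + 2 / 3 * (x : ℝ) ^ 2 := by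
            rw [show (3 : ℝ) * ((2 * d : ℕ) : ℝ) = 6 * ∏ p ∈ T, (p : ℝ) by rw [← hdR]; push_cast; ring]
            have : ((2 * d : ℕ) : ℝ) * x / 6 ≤ (x : ℝ) * x / 6 := by
              apply div_le_div_of_nonneg_right _ (by norm_num)
              exact mul_le_mul_of_nonneg_right h2dR hxR
            nlinarith
        _ ≤ (x : ℝ) ^ 3 / (6 * ∏ p ∈ T, (p : ℝ))
            + 2 / 3 * (x : ℝ) ^ 2 * (Real.sqrt x * (1 / 10 : ℝ) ^ #(T.filter (100 < ·))) := by
            have h0 : (0 : ℝ) ≤ 2 / 3 * (x : ℝ) ^ 2 := by positivity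
            have := mul_le_mul_of_nonneg_left hR h0
            linarith
        _ = _ := by ring
  -- Step 4: resum the two Euler products
  calc ∑ N ∈ E, (N : ℝ) ^ 2 * oddSingularFactor N ^ 2
      = ∑ T ∈ O.powerset, (∏ p ∈ T, gFactor p) *
          ∑ N ∈ E.filter (fun N => T ⊆ N.primeFactors.filter (2 < ·)), (N : ℝ) ^ 2 := hswap
    _ ≤ ∑ T ∈ O.powerset, (∏ p ∈ T, gFactor p) * ((x : ℝ) ^ 3 / (6 * ∏ p ∈ T, (p : ℝ))
          + 2 / 3 * (x : ℝ) ^ 2 * Real.sqrt x * ∏ p ∈ T, (if 100 < p then (1 / 10 : ℝ) else 1)) :=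
        sum_le_sum fun T hT => mul_le_mul_of_nonneg_left (hinner T hT) (hw0 T hT)
    _ = (x : ℝ) ^ 3 / 6 * ∑ T ∈ O.powerset, ∏ p ∈ T, (gFactor p / p)
        + 2 / 3 * (x : ℝ) ^ 2 * Real.sqrt x *
          ∑ T ∈ O.powerset, ∏ p ∈ T, (gFactor p * if 100 < p then (1 / 10 : ℝ) else 1) := by
        rw [mul_sum, mul_sum, ← sum_add_distrib]
        refine sum_congr rfl fun T hT => ?_
        rw [prod_div_distrib, prod_mul_distrib]
        have hTpos : (0 : ℝ) < ∏ p ∈ T, (p : ℝ) := prod_pos fun p hp => by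
          have := (mem_powerset.mp hT) hp
          rw [hO, mem_filter] at this
          exact_mod_cast this.2.1.pos
        field_simp
    _ = _ := by rw [prod_one_add, prod_one_add]

set_option maxHeartbeats 1600000 in
/-- The boundary Euler product: `∏_{2<p≤x}(1 + g(p)·c_p) ≤ 39.5·exp(0.206·(1 + log x))` (`∏_{2<p<100}(1 + g(p))
= (∏ (p−1)/(p−2))² = 39.48…`; for `p > 100`, `1 + g(p)/10 ≤ e^{0.206/p}` and `Σ_{p≤x} 1/p ≤ 1 + log x`). [folklore] -/
private theorem prod_gWeight_le (x : ℕ) :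
    ∏ p ∈ (range (x + 1)).filter (fun p => p.Prime ∧ 2 < p),
        (1 + gFactor p * if 100 < p then (1 / 10 : ℝ) else 1)
      ≤ 39.5 * Real.exp (0.206 * (1 + Real.log x)) := by
  set O := (range (x + 1)).filter (fun p => p.Prime ∧ 2 < p) with hO
  have hOmem : ∀ p ∈ O, p.Prime ∧ 2 < p ∧ p ≤ x := fun p hp => by
    rw [hO, mem_filter, mem_range] at hp
    exact ⟨hp.2.1, hp.2.2, by omega⟩
  have hF1 : ∀ p ∈ O, 1 ≤ 1 + gFactor p * (if 100 < p then (1 / 10 : ℝ) else 1) := fun p hp => by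
    have h1 := gFactor_nonneg (hOmem p hp).2.1
    have h2 : (0 : ℝ) ≤ (if 100 < p then (1 / 10 : ℝ) else 1) := by split_ifs <;> norm_num
    nlinarith
  have hF0 : ∀ p ∈ O, 0 ≤ 1 + gFactor p * (if 100 < p then (1 / 10 : ℝ) else 1) :=
    fun p hp => le_trans zero_le_one (hF1 p hp)
  rw [← prod_filter_mul_prod_filter_not O (fun p => p ≤ 100)]
  -- the head: `c_p = 1`
  have hhead : ∏ p ∈ O.filter (fun p => p ≤ 100),
      (1 + gFactor p * if 100 < p then (1 / 10 : ℝ) else 1) ≤ 39.5 := by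
    have heq : ∏ p ∈ O.filter (fun p => p ≤ 100), (1 + gFactor p * if 100 < p then (1 / 10 : ℝ) else 1)
        = ∏ p ∈ O.filter (fun p => p ≤ 100), (1 + gFactor p) :=
      prod_congr rfl fun p hp => by
        have := (mem_filter.mp hp).2
        rw [if_neg (by omega), mul_one]
    rw [heq]
    have hsub : O.filter (fun p => p ≤ 100) ⊆ (range 101).filter (fun p => p.Prime ∧ 2 < p) := by
      intro p hp
      rw [mem_filter] at hp ⊢
      obtain ⟨hpO, hp100⟩ := hp
      exact ⟨mem_range.mpr (by omega), (hOmem p hpO).1, (hOmem p hpO).2.1⟩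
    have hUval : ∏ p ∈ (range 101).filter (fun p => p.Prime ∧ 2 < p), (1 + gFactor p) ≤ 39.5 := by
      rw [prod_filter]
      simp only [prod_range_succ, prod_range_zero, gFactor]
      norm_num
    refine le_trans ?_ hUval
    rw [← prod_sdiff hsub]
    have hG1 : ∀ p ∈ (range 101).filter (fun p => p.Prime ∧ 2 < p), 1 ≤ 1 + gFactor p := fun p hp => by
      have := gFactor_nonneg (mem_filter.mp hp).2.2
      linarith
    have h1 : 1 ≤ ∏ p ∈ (range 101).filter (fun p => p.Prime ∧ 2 < p) \ O.filter (fun p => p ≤ 100),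
        (1 + gFactor p) := by
      calc (1 : ℝ) = ∏ p ∈ (range 101).filter (fun p => p.Prime ∧ 2 < p) \ O.filter (fun p => p ≤ 100),
          (1 : ℝ) := prod_const_one.symm
        _ ≤ _ := prod_le_prod (fun _ _ => zero_le_one) fun p hp => hG1 p (sdiff_subset hp)
    have h0 : 0 ≤ ∏ p ∈ O.filter (fun p => p ≤ 100), (1 + gFactor p) :=
      prod_nonneg fun p hp => by
        have := gFactor_nonneg (hOmem p (mem_filter.mp hp).1).2.1
        linarith
    exact le_mul_of_one_le_left h0 h1
  -- the tail: `c_p = 1/10`, `g(p) ≤ 2.06/p`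
  have htail : ∏ p ∈ O.filter (fun p => ¬p ≤ 100),
      (1 + gFactor p * if 100 < p then (1 / 10 : ℝ) else 1) ≤ Real.exp (0.206 * (1 + Real.log x)) := by
    set T' := O.filter (fun p => ¬p ≤ 100) with hT'
    have hT'mem : ∀ p ∈ T', p.Prime ∧ 2 < p ∧ 101 ≤ p ∧ p ≤ x := fun p hp => by
      rw [hT', mem_filter] at hp
      exact ⟨(hOmem p hp.1).1, (hOmem p hp.1).2.1, by omega, (hOmem p hp.1).2.2⟩
    have heq : ∏ p ∈ T', (1 + gFactor p * if 100 < p then (1 / 10 : ℝ) else 1)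
        = ∏ p ∈ T', (1 + gFactor p / 10) :=
      prod_congr rfl fun p hp => by
        rw [if_pos (by have := (hT'mem p hp).2.2.1; omega)]
        ring
    rw [heq]
    have h1 : ∏ p ∈ T', (1 + gFactor p / 10) ≤ Real.exp (∑ p ∈ T', gFactor p / 10) := by
      rw [Real.exp_sum]
      exact prod_le_prod (fun p hp => by have := gFactor_nonneg (hT'mem p hp).2.1; positivity) fun p _ => by
        have := Real.add_one_le_exp (gFactor p / 10); linarith
    have h2 : ∑ p ∈ T', gFactor p / 10 ≤ 0.206 * ∑ p ∈ T', (p : ℝ)⁻¹ := by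
      rw [mul_sum]
      exact sum_le_sum fun p hp => by
        have hp101 := (hT'mem p hp).2.2.1
        have hp0 : (0 : ℝ) < p := by exact_mod_cast (hT'mem p hp).1.pos
        have hg := gFactor_div_le hp101
        have e1 : gFactor p = gFactor p / p * p := by field_simp
        have e2 : (2.06 : ℝ) / (p : ℝ) ^ 2 * p = 2.06 * (p : ℝ)⁻¹ := by field_simp
        have hg' : gFactor p ≤ 2.06 * (p : ℝ)⁻¹ := by
          rw [e1, ← e2]; exact mul_le_mul_of_nonneg_right hg hp0.le
        linarith
    have h3 : ∑ p ∈ T', (p : ℝ)⁻¹ ≤ 1 + Real.log x := by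
      have hh := harmonic_le_one_add_log x
      simp only [harmonic_eq_sum_Icc, Rat.cast_sum, Rat.cast_inv, Rat.cast_natCast] at hh
      refine le_trans (sum_le_sum_of_subset_of_nonneg ?_ fun n _ _ => by positivity) hh
      intro p hp
      rw [mem_Icc]
      exact ⟨(hT'mem p hp).1.one_le, (hT'mem p hp).2.2.2⟩
    have h4 : ∑ p ∈ T', gFactor p / 10 ≤ 0.206 * (1 + Real.log x) := by nlinarith
    exact h1.trans (Real.exp_le_exp.mpr h4)
  have htail0 : 0 ≤ ∏ p ∈ O.filter (fun p => ¬p ≤ 100),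
      (1 + gFactor p * if 100 < p then (1 / 10 : ℝ) else 1) :=
    prod_nonneg fun p hp => hF0 p (mem_filter.mp hp).1
  exact mul_le_mul hhead htail htail0 (by norm_num)

/-- `e^{0.206} ≤ 1.25`. [folklore] -/
private theorem exp_0206_le : Real.exp (0.206 : ℝ) ≤ 1.25 := by
  have := Real.abs_exp_sub_one_sub_id_le (x := (0.206 : ℝ)) (by rw [abs_le]; constructor <;> norm_num)
  rw [abs_le] at this
  nlinarith [this.2]

/-- **Weighted mean square of the singular factor**: `Σ_{even N ∈ (0, x]} N²·f(N)² ≤ 0.4431·x³` for `x ≥ e^100`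
(`2.658/6 = 0.44300`; the boundary term is `≤ 33·x^{11/4} ≤ 10⁻⁴·x³`). [cite: Nathanson1996, Lemma 7.7 (proof: weighted mean square of the singular factor; explicit form proved here)] -/
theorem sum_even_sq_mul_oddSingularFactor_sq_le {x : ℕ} (hx : Real.exp 100 ≤ (x : ℝ)) :
    ∑ N ∈ (Ioc 0 x).filter Even, (N : ℝ) ^ 2 * oddSingularFactor N ^ 2 ≤ 0.4431 * (x : ℝ) ^ 3 := by
  have hx1 : (1 : ℝ) < x := lt_of_lt_of_le (by have := Real.add_one_le_exp (100 : ℝ); linarith) hx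
  have hx0 : (0 : ℝ) < x := by linarith
  have h1 := sum_even_sq_mul_oddSingularFactor_sq_le_prod x
  have h2 := prod_gFactor_le ((range (x + 1)).filter (fun p => p.Prime ∧ 2 < p))
    (fun p hp => (mem_filter.mp hp).2)
  have h3 := prod_gWeight_le x
  set L := Real.log x with hL
  have hL100 : 100 ≤ L := by
    have := Real.log_le_log (Real.exp_pos 100) hx
    rwa [Real.log_exp] at this
  set s := Real.exp (L / 4) with hs
  have hs0 : 0 < s := Real.exp_pos _
  have hs4 : s ^ 4 = x := by
    rw [hs, ← Real.exp_nat_mul, show ((4 : ℕ) : ℝ) * (L / 4) = L by push_cast; ring, hL, Real.exp_log hx0]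
  have hsqrt : Real.sqrt x = s ^ 2 := by
    rw [show (x : ℝ) = (s ^ 2) ^ 2 by rw [← hs4]; ring, Real.sqrt_sq (by positivity)]
  have hexpL : Real.exp (0.206 * (1 + L)) ≤ 1.25 * s := by
    rw [show 0.206 * (1 + L) = 0.206 + 0.206 * L by ring, Real.exp_add]
    have h : Real.exp (0.206 * L) ≤ s := Real.exp_le_exp.mpr (by linarith)
    exact mul_le_mul exp_0206_le h (Real.exp_pos _).le (by norm_num)
  have hsbig : (400000 : ℝ) ≤ s := by
    have he : (2.7 : ℝ) ≤ Real.exp 1 := by have := Real.exp_one_gt_d9; linarith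
    have h25 : (2.7 : ℝ) ^ 25 ≤ Real.exp 25 := by
      rw [show (25 : ℝ) = ((25 : ℕ) : ℝ) * 1 by norm_num, Real.exp_nat_mul]
      exact pow_le_pow_left₀ (by norm_num) he 25
    have h3' : Real.exp 25 ≤ s := Real.exp_le_exp.mpr (by linarith)
    exact le_trans (le_trans (by norm_num) h25) h3'
  -- the boundary term
  have hbd : 2 / 3 * (x : ℝ) ^ 2 * Real.sqrt x *
      ∏ p ∈ (range (x + 1)).filter (fun p => p.Prime ∧ 2 < p),
        (1 + gFactor p * if 100 < p then (1 / 10 : ℝ) else 1) ≤ 0.0001 * (x : ℝ) ^ 3 := by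
    have hA : 2 / 3 * (x : ℝ) ^ 2 * Real.sqrt x *
        ∏ p ∈ (range (x + 1)).filter (fun p => p.Prime ∧ 2 < p),
          (1 + gFactor p * if 100 < p then (1 / 10 : ℝ) else 1)
        ≤ 2 / 3 * (x : ℝ) ^ 2 * Real.sqrt x * (39.5 * (1.25 * s)) := by
      apply mul_le_mul_of_nonneg_left _ (by positivity)
      exact h3.trans (mul_le_mul_of_nonneg_left hexpL (by norm_num))
    rw [hsqrt, ← hs4] at hA ⊢
    have hB : 2 / 3 * (s ^ 4) ^ 2 * s ^ 2 * (39.5 * (1.25 * s)) ≤ 0.0001 * (s ^ 4) ^ 3 := by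
      have e1 : 2 / 3 * (s ^ 4) ^ 2 * s ^ 2 * (39.5 * (1.25 * s)) = (98.75 / 3) * s ^ 11 := by ring
      have e2 : 0.0001 * (s ^ 4) ^ 3 = (0.0001 * s) * s ^ 11 := by ring
      rw [e1, e2]
      exact mul_le_mul_of_nonneg_right (by linarith) (by positivity)
    exact hA.trans hB
  -- the main term
  have hmn : (x : ℝ) ^ 3 / 6 * ∏ p ∈ (range (x + 1)).filter (fun p => p.Prime ∧ 2 < p), (1 + gFactor p / p)
      ≤ (x : ℝ) ^ 3 / 6 * 2.658 := mul_le_mul_of_nonneg_left h2 (by positivity)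
  have hx3 : (0 : ℝ) ≤ (x : ℝ) ^ 3 := by positivity
  linarith

/-- **Second moment with the factor `1/3`**: `Σ_{N ≤ x} r(N)² ≤ 142·x³/log⁴x` for `x ≥ e^100` (even `N > x/e²`:
`r² ≤ 17.1² f² N²/(log x − 2)⁴` and the weighted mean square; even `e^47 ≤ N ≤ x/e²`: `r² ≤ 17.1² f² (x/e²)²/(log x − 2)⁴`
and `Σ f² ≤ 1.329·x/e²`; `(L/(L−2))⁴ ≤ 1.0842`; the rest as in §4: `129.57·1.0842 + 0.965·1.0842 + 0.387 ≤ 142`).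
[cite: Nathanson1996, Lemma 7.7 (explicit form proved here)] -/
theorem sum_goldbachCount_sq_le_142 {x : ℕ} (hx : Real.exp 100 ≤ (x : ℝ)) :
    ∑ N ∈ range (x + 1), (SingularSeries.goldbachCount N : ℝ) ^ 2 ≤ 142 * (x : ℝ) ^ 3 / Real.log x ^ 4 := by
  have hx1 : (1 : ℝ) < x := lt_of_lt_of_le (by have := Real.add_one_le_exp (100 : ℝ); linarith) hx
  have hx0 : (0 : ℝ) < x := by linarith
  set L := Real.log x with hL_def
  have hL100 : 100 ≤ L := by
    have := Real.log_le_log (Real.exp_pos 100) hx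
    rwa [Real.log_exp] at this
  have hL : 0 < L := by linarith
  set Lq := L ^ 4 with hLq_def
  have hLq0 : 0 < Lq := by positivity
  have hL2 : 0 < L - 2 := by linarith
  -- `1/(L-2)^4 ≤ 1.0842/L^4`
  have hL24 : (L - 2) ^ 4 * 1.0842 ≥ Lq := by
    have h1 : L ≤ 50 / 49 * (L - 2) := by linarith
    have h2 := pow_le_pow_left₀ hL.le h1 4
    rw [mul_pow] at h2
    have h3 : (0 : ℝ) ≤ (L - 2) ^ 4 := by positivity
    nlinarith
  set P : ℕ → Prop := fun N => Even N ∧ Real.exp 47 ≤ (N : ℝ) with hP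
  rw [← sum_filter_add_sum_filter_not (range (x + 1)) P]
  -- the rest: each term `≤ (2e^47)²`, at most `x + 1` terms (as in §4)
  have hrest : ∑ N ∈ (range (x + 1)).filter (fun N => ¬P N),
      (SingularSeries.goldbachCount N : ℝ) ^ 2 ≤ 0.387 * (x : ℝ) ^ 3 / Lq := by
    have hsum : ∑ N ∈ (range (x + 1)).filter (fun N => ¬P N),
        (SingularSeries.goldbachCount N : ℝ) ^ 2 ≤ ((x : ℝ) + 1) * (2 * Real.exp 47) ^ 2 := by
      have h47 : (1 : ℝ) ≤ Real.exp 47 := by have := Real.add_one_le_exp (47 : ℝ); linarith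
      have hterm : ∀ N ∈ (range (x + 1)).filter (fun N => ¬P N),
          (SingularSeries.goldbachCount N : ℝ) ^ 2 ≤ (2 * Real.exp 47) ^ 2 := by
        intro N hN
        rw [mem_filter] at hN
        have hr0 : (0 : ℝ) ≤ SingularSeries.goldbachCount N := Nat.cast_nonneg _
        apply pow_le_pow_left₀ hr0
        rcases Nat.even_or_odd N with hev | hodd
        · have hlt : (N : ℝ) < Real.exp 47 := by
            by_contra h
            exact hN.2 ⟨hev, not_lt.mp h⟩
          have h1 : (SingularSeries.goldbachCount N : ℝ) ≤ N + 1 := by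
            exact_mod_cast goldbachCount_le_succ N
          linarith
        · have h1 : (SingularSeries.goldbachCount N : ℝ) ≤ 2 := by
            exact_mod_cast goldbachCount_le_two_of_odd hodd
          linarith
      calc _ ≤ ∑ N ∈ (range (x + 1)).filter (fun N => ¬P N), (2 * Real.exp 47) ^ 2 := sum_le_sum hterm
        _ = #((range (x + 1)).filter (fun N => ¬P N)) * (2 * Real.exp 47) ^ 2 := by
            rw [sum_const, nsmul_eq_mul]
        _ ≤ ((x : ℝ) + 1) * (2 * Real.exp 47) ^ 2 := by
            apply mul_le_mul_of_nonneg_right _ (by positivity)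
            have : #((range (x + 1)).filter (fun N => ¬P N)) ≤ x + 1 :=
              (card_filter_le _ _).trans (by rw [card_range])
            exact_mod_cast this
    have hsqrt : Real.exp 50 ≤ Real.sqrt x := by
      apply Real.le_sqrt_of_sq_le
      rw [← Real.exp_nat_mul]
      norm_num
      exact hx
    have hLq : Lq ≤ 4096 * Real.sqrt x := log_pow_four_le_sqrt hx1.le
    have hxx : Real.sqrt x * Real.sqrt x = x := Real.mul_self_sqrt hx0.le
    have he : (2.7 : ℝ) ≤ Real.exp 1 := by have := Real.exp_one_gt_d9; linarith
    have he56 : (100000 : ℝ) ≤ Real.exp 56 := by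
      have h1 := pow_le_pow_left₀ (by norm_num) he 56
      rw [← Real.exp_nat_mul] at h1
      norm_num at h1
      have h2 : (100000 : ℝ) ≤ (2.7 : ℝ) ^ 56 := by norm_num
      linarith
    have h94 : (2 * Real.exp 47) ^ 2 = 4 * Real.exp 94 := by
      rw [mul_pow, ← Real.exp_nat_mul]; norm_num
    have h100 : Real.exp 100 = Real.exp 44 * Real.exp 56 := by rw [← Real.exp_add]; norm_num
    have h94' : Real.exp 94 = Real.exp 44 * Real.exp 50 := by rw [← Real.exp_add]; norm_num
    have e44 : 0 < Real.exp 44 := Real.exp_pos 44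
    have hkey : ((x : ℝ) + 1) * (2 * Real.exp 47) ^ 2 * Lq ≤ 0.387 * (x : ℝ) ^ 3 := by
      rw [h94]
      have h1 : Real.exp 50 * Real.sqrt x ≤ x := by
        calc Real.exp 50 * Real.sqrt x ≤ Real.sqrt x * Real.sqrt x :=
              mul_le_mul_of_nonneg_right hsqrt (Real.sqrt_nonneg x)
          _ = x := hxx
      calc ((x : ℝ) + 1) * (4 * Real.exp 94) * Lq ≤ (2 * x) * (4 * Real.exp 94) * (4096 * Real.sqrt x) :=
            mul_le_mul (mul_le_mul_of_nonneg_right (by linarith) (by positivity)) hLq hLq0.le (by positivity)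
        _ = 32768 * Real.exp 44 * x * (Real.exp 50 * Real.sqrt x) := by rw [h94']; ring
        _ ≤ 32768 * Real.exp 44 * x * x := mul_le_mul_of_nonneg_left h1 (by positivity)
        _ ≤ 0.387 * (Real.exp 44 * Real.exp 56) * x * x := by
            have h2 : 32768 * Real.exp 44 ≤ 0.387 * (Real.exp 44 * Real.exp 56) := by nlinarith
            have hxx0 : (0 : ℝ) ≤ x * x := by positivity
            nlinarith
        _ = 0.387 * Real.exp 100 * ((x : ℝ) * x) := by rw [h100]; ring
        _ ≤ 0.387 * x * ((x : ℝ) * x) := by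
            apply mul_le_mul_of_nonneg_right _ (by positivity)
            exact mul_le_mul_of_nonneg_left hx (by norm_num)
        _ = 0.387 * (x : ℝ) ^ 3 := by ring
    rw [le_div_iff₀ hLq0]
    exact (mul_le_mul_of_nonneg_right hsum hLq0.le).trans hkey
  -- the main part, split at `x/e²`
  set Q : ℕ → Prop := fun N => (x : ℝ) < Real.exp 2 * N with hQ
  have hkappa : ∀ N : ℕ, P N → ∀ {B : ℝ}, (N : ℝ) / Real.log (N : ℝ) ^ 2 ≤ B → 0 ≤ B →
      (SingularSeries.goldbachCount N : ℝ) ^ 2 ≤ 292.41 * oddSingularFactor N ^ 2 * B ^ 2 := by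
    intro N hPN B hB hB0
    have hk := TwoResidueSelbergExplicit.goldbachCount_le_kappa hPN.2 hPN.1
    have hf := oddSingularFactor_nonneg N
    have h1 : (SingularSeries.goldbachCount N : ℝ) ≤ 17.1 * oddSingularFactor N * B := by
      calc (SingularSeries.goldbachCount N : ℝ)
          ≤ 17.1 * oddSingularFactor N * (N : ℝ) / Real.log (N : ℝ) ^ 2 := hk
        _ = 17.1 * oddSingularFactor N * ((N : ℝ) / Real.log (N : ℝ) ^ 2) := by ring
        _ ≤ _ := mul_le_mul_of_nonneg_left hB (by positivity)
    have h0 : (0 : ℝ) ≤ SingularSeries.goldbachCount N := Nat.cast_nonneg _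
    calc (SingularSeries.goldbachCount N : ℝ) ^ 2 ≤ (17.1 * oddSingularFactor N * B) ^ 2 := pow_le_pow_left₀ h0 h1 2
      _ = _ := by ring
  -- C: `N > x/e²`
  have hC : ∑ N ∈ ((range (x + 1)).filter P).filter Q, (SingularSeries.goldbachCount N : ℝ) ^ 2
      ≤ 292.41 / (L - 2) ^ 4 * (0.4431 * (x : ℝ) ^ 3) := by
    have hterm : ∀ N ∈ ((range (x + 1)).filter P).filter Q, (SingularSeries.goldbachCount N : ℝ) ^ 2
        ≤ 292.41 / (L - 2) ^ 4 * ((N : ℝ) ^ 2 * oddSingularFactor N ^ 2) := by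
      intro N hN
      rw [mem_filter, mem_filter] at hN
      obtain ⟨⟨_, hPN⟩, hQN⟩ := hN
      have hN0 : (0 : ℝ) < N := lt_of_lt_of_le (Real.exp_pos 47) hPN.2
      have hlogN : L - 2 ≤ Real.log (N : ℝ) := by
        have h1 : Real.log (x : ℝ) < Real.log (Real.exp 2 * N) := Real.log_lt_log hx0 hQN
        rw [Real.log_mul (ne_of_gt (Real.exp_pos 2)) (ne_of_gt hN0), Real.log_exp] at h1
        linarith
      have hB : (N : ℝ) / Real.log (N : ℝ) ^ 2 ≤ (N : ℝ) / (L - 2) ^ 2 := by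
        apply div_le_div_of_nonneg_left hN0.le (by positivity)
        exact pow_le_pow_left₀ hL2.le hlogN 2
      have h := hkappa N hPN hB (by positivity)
      calc _ ≤ _ := h
        _ = 292.41 / (L - 2) ^ 4 * ((N : ℝ) ^ 2 * oddSingularFactor N ^ 2) := by
            field_simp
    calc _ ≤ ∑ N ∈ ((range (x + 1)).filter P).filter Q,
          292.41 / (L - 2) ^ 4 * ((N : ℝ) ^ 2 * oddSingularFactor N ^ 2) := sum_le_sum hterm
      _ = 292.41 / (L - 2) ^ 4 * ∑ N ∈ ((range (x + 1)).filter P).filter Q,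
          (N : ℝ) ^ 2 * oddSingularFactor N ^ 2 := by rw [mul_sum]
      _ ≤ 292.41 / (L - 2) ^ 4 * ∑ N ∈ (Ioc 0 x).filter Even, (N : ℝ) ^ 2 * oddSingularFactor N ^ 2 := by
          apply mul_le_mul_of_nonneg_left _ (by positivity)
          apply sum_le_sum_of_subset_of_nonneg
          · intro N hN
            rw [mem_filter, mem_filter, mem_range] at hN
            obtain ⟨⟨hNx, hPN⟩, _⟩ := hN
            rw [mem_filter, mem_Ioc]
            have hN0 : (0 : ℝ) < N := lt_of_lt_of_le (Real.exp_pos 47) hPN.2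
            have hN0' : 0 < N := by exact_mod_cast hN0
            exact ⟨⟨hN0', by omega⟩, hPN.1⟩
          · intro N _ _
            positivity
      _ ≤ 292.41 / (L - 2) ^ 4 * (0.4431 * (x : ℝ) ^ 3) :=
          mul_le_mul_of_nonneg_left (sum_even_sq_mul_oddSingularFactor_sq_le hx) (by positivity)
  -- B: `e^47 ≤ N ≤ x/e²`
  set y : ℝ := (x : ℝ) / Real.exp 2 with hy
  have hy0 : 0 < y := by positivity
  have hlogy : Real.log y = L - 2 := by
    rw [hy, Real.log_div (ne_of_gt hx0) (ne_of_gt (Real.exp_pos 2)), Real.log_exp]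
  have hB : ∑ N ∈ ((range (x + 1)).filter P).filter (fun N => ¬Q N), (SingularSeries.goldbachCount N : ℝ) ^ 2
      ≤ 292.41 * (y ^ 2 / (L - 2) ^ 4) * (1.329 * y) := by
    have hterm : ∀ N ∈ ((range (x + 1)).filter P).filter (fun N => ¬Q N),
        (SingularSeries.goldbachCount N : ℝ) ^ 2 ≤ 292.41 * (y ^ 2 / (L - 2) ^ 4) * oddSingularFactor N ^ 2 := by
      intro N hN
      rw [mem_filter, mem_filter] at hN
      obtain ⟨⟨_, hPN⟩, hQN⟩ := hN
      have hNy : (N : ℝ) ≤ y := by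
        rw [hy, le_div_iff₀ (Real.exp_pos 2)]
        have hQN' : Real.exp 2 * (N : ℝ) ≤ x := not_lt.mp hQN
        linarith
      have he2 : Real.exp 2 ≤ (N : ℝ) := le_trans (Real.exp_le_exp.mpr (by norm_num)) hPN.2
      have hmono := div_log_sq_mono he2 hNy
      rw [hlogy] at hmono
      have h := hkappa N hPN hmono (by positivity)
      calc _ ≤ _ := h
        _ = _ := by rw [div_pow]; ring
    have hsubB : ((range (x + 1)).filter P).filter (fun N => ¬Q N) ⊆ (Ioc 0 ⌊y⌋₊).filter Even := by
      intro N hN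
      rw [mem_filter, mem_filter, mem_range] at hN
      obtain ⟨⟨hNx, hPN⟩, hQN⟩ := hN
      have hNy : (N : ℝ) ≤ y := by
        rw [hy, le_div_iff₀ (Real.exp_pos 2)]
        have hQN' : Real.exp 2 * (N : ℝ) ≤ x := not_lt.mp hQN
        linarith
      rw [mem_filter, mem_Ioc]
      have hN0 : (0 : ℝ) < N := lt_of_lt_of_le (Real.exp_pos 47) hPN.2
      have hN0' : 0 < N := by exact_mod_cast hN0
      exact ⟨⟨hN0', Nat.le_floor hNy⟩, hPN.1⟩
    have hfy : ∑ N ∈ ((range (x + 1)).filter P).filter (fun N => ¬Q N), oddSingularFactor N ^ 2 ≤ 1.329 * y := by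
      calc _ ≤ ∑ N ∈ (Ioc 0 ⌊y⌋₊).filter Even, oddSingularFactor N ^ 2 :=
            sum_le_sum_of_subset_of_nonneg hsubB fun N _ _ => by positivity
        _ ≤ 1.329 * (⌊y⌋₊ : ℝ) := sum_even_oddSingularFactor_sq_le ⌊y⌋₊
        _ ≤ 1.329 * y := mul_le_mul_of_nonneg_left (Nat.floor_le hy0.le) (by norm_num)
    calc _ ≤ ∑ N ∈ ((range (x + 1)).filter P).filter (fun N => ¬Q N),
          292.41 * (y ^ 2 / (L - 2) ^ 4) * oddSingularFactor N ^ 2 := sum_le_sum hterm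
      _ = 292.41 * (y ^ 2 / (L - 2) ^ 4) *
          ∑ N ∈ ((range (x + 1)).filter P).filter (fun N => ¬Q N), oddSingularFactor N ^ 2 := by rw [mul_sum]
      _ ≤ _ := mul_le_mul_of_nonneg_left hfy (by positivity)
  -- numerics for B: `y³ = x³/e⁶`, `e⁶ ≥ 403`
  have he6 : (403 : ℝ) ≤ Real.exp 6 := by
    have he : (2.7182818283 : ℝ) ≤ Real.exp 1 := Real.exp_one_gt_d9.le
    have h6 : (2.7182818283 : ℝ) ^ 6 ≤ Real.exp 6 := by
      rw [show (6 : ℝ) = ((6 : ℕ) : ℝ) * 1 by norm_num, Real.exp_nat_mul]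
      exact pow_le_pow_left₀ (by norm_num) he 6
    exact le_trans (by norm_num) h6
  have hy3 : y ^ 3 * Real.exp 6 = (x : ℝ) ^ 3 := by
    rw [hy, div_pow, show Real.exp 6 = Real.exp 2 ^ 3 by rw [← Real.exp_nat_mul]; norm_num]
    field_simp
  have hB' : 292.41 * (y ^ 2 / (L - 2) ^ 4) * (1.329 * y) ≤ 0.965 / (L - 2) ^ 4 * (x : ℝ) ^ 3 := by
    rw [← hy3]
    have e1 : 292.41 * (y ^ 2 / (L - 2) ^ 4) * (1.329 * y) = (388.61289 * y ^ 3) / (L - 2) ^ 4 := by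
      field_simp
      ring
    have e2 : 0.965 / (L - 2) ^ 4 * (y ^ 3 * Real.exp 6) = (0.965 * Real.exp 6 * y ^ 3) / (L - 2) ^ 4 := by
      field_simp
    rw [e1, e2]
    apply div_le_div_of_nonneg_right _ (by positivity)
    have hy30 : (0 : ℝ) ≤ y ^ 3 := by positivity
    nlinarith
  -- assemble the main part
  have hmain : ∑ N ∈ (range (x + 1)).filter P, (SingularSeries.goldbachCount N : ℝ) ^ 2
      ≤ 141.53 * (x : ℝ) ^ 3 / Lq := by
    rw [← sum_filter_add_sum_filter_not ((range (x + 1)).filter P) Q]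
    have h1 : ∑ N ∈ ((range (x + 1)).filter P).filter Q, (SingularSeries.goldbachCount N : ℝ) ^ 2
        + ∑ N ∈ ((range (x + 1)).filter P).filter (fun N => ¬Q N), (SingularSeries.goldbachCount N : ℝ) ^ 2
        ≤ (292.41 * 0.4431 + 0.965) / (L - 2) ^ 4 * (x : ℝ) ^ 3 := by
      have := add_le_add hC (hB.trans hB')
      have e : 292.41 / (L - 2) ^ 4 * (0.4431 * (x : ℝ) ^ 3) + 0.965 / (L - 2) ^ 4 * (x : ℝ) ^ 3
          = (292.41 * 0.4431 + 0.965) / (L - 2) ^ 4 * (x : ℝ) ^ 3 := by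
        field_simp
      linarith
    have h2 : (292.41 * 0.4431 + 0.965) / (L - 2) ^ 4 * (x : ℝ) ^ 3 ≤ 141.53 * (x : ℝ) ^ 3 / Lq := by
      rw [div_mul_eq_mul_div, div_le_div_iff₀ (by positivity) hLq0]
      have hx3 : (0 : ℝ) ≤ (x : ℝ) ^ 3 := by positivity
      have : (292.41 * 0.4431 + 0.965) * Lq ≤ 141.53 * (L - 2) ^ 4 := by nlinarith
      nlinarith
    exact h1.trans h2
  calc _ ≤ 141.53 * (x : ℝ) ^ 3 / Lq + 0.387 * (x : ℝ) ^ 3 / Lq := add_le_add hmain hrest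
    _ ≤ 142 * (x : ℝ) ^ 3 / Lq := by
        rw [← add_div]
        apply div_le_div_of_nonneg_right _ hLq0.le
        have : (0 : ℝ) ≤ (x : ℝ) ^ 3 := by positivity
        nlinarith

/-- **Theorem 7.8 with both moments as parameters**: if `Σ_{N≤x} r(N) ≥ c₁ x²/log²x` and `Σ_{N≤x} r(N)² ≤ c₂ x³/log⁴x`
for `x ≥ e^100`, then `#{N ∈ (0, x] : N = p + q} ≥ (c₁²/c₂)·x` for `x ≥ e^100`.
[cite: Nathanson1996, Thm 7.8 (proof, explicit form proved here)] -/
theorem goldbach_count_ge_of_moments {c₁ c₂ : ℝ} (hc₁ : 0 ≤ c₁) (hc₂ : 0 < c₂)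
    (hS₁ : ∀ x : ℕ, Real.exp 100 ≤ (x : ℝ) →
      c₁ * ((x : ℝ) ^ 2 / Real.log x ^ 2) ≤ ∑ N ∈ range (x + 1), (SingularSeries.goldbachCount N : ℝ))
    (hS₂ : ∀ x : ℕ, Real.exp 100 ≤ (x : ℝ) →
      ∑ N ∈ range (x + 1), (SingularSeries.goldbachCount N : ℝ) ^ 2 ≤ c₂ * (x : ℝ) ^ 3 / Real.log x ^ 4)
    {x : ℕ} (hx : Real.exp 100 ≤ (x : ℝ)) :
    c₁ ^ 2 / c₂ * (x : ℝ) ≤ #{N ∈ Ioc 0 x | ∃ p q : ℕ, p.Prime ∧ q.Prime ∧ p + q = N} := by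
  have hx1 : (1 : ℝ) < x := lt_of_lt_of_le (by have := Real.add_one_le_exp (100 : ℝ); linarith) hx
  have hx0 : (0 : ℝ) < x := by linarith
  have hlogx : 0 < Real.log x := Real.log_pos hx1
  set r : ℕ → ℝ := fun N => (SingularSeries.goldbachCount N : ℝ) with hr
  set T : Finset ℕ := (range (x + 1)).filter fun N => 0 < SingularSeries.goldbachCount N with hT
  have hsumT : ∑ N ∈ range (x + 1), r N = ∑ N ∈ T, r N * 1 := by
    rw [hT, sum_filter]
    refine sum_congr rfl fun N _ => ?_
    by_cases h : 0 < SingularSeries.goldbachCount N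
    · rw [if_pos h, mul_one]
    · rw [if_neg h, hr]
      simp only [not_lt, Nat.le_zero] at h
      simp [h]
  have hCS : (∑ N ∈ T, r N * 1) ^ 2 ≤ (∑ N ∈ T, r N ^ 2) * ∑ N ∈ T, (1 : ℝ) ^ 2 :=
    sum_mul_sq_le_sq_mul_sq T r fun _ => 1
  have hT1 : ∑ N ∈ T, (1 : ℝ) ^ 2 = #T := by simp
  have hTsq : ∑ N ∈ T, r N ^ 2 ≤ ∑ N ∈ range (x + 1), r N ^ 2 :=
    sum_le_sum_of_subset_of_nonneg (filter_subset _ _) fun N _ _ => by positivity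
  have hTA : T ⊆ {N ∈ Ioc 0 x | ∃ p q : ℕ, p.Prime ∧ q.Prime ∧ p + q = N} := by
    intro N hN
    rw [hT, mem_filter, mem_range] at hN
    obtain ⟨hNx, hpos⟩ := hN
    unfold SingularSeries.goldbachCount at hpos
    obtain ⟨pq, hpq⟩ := card_pos.mp hpos
    rw [mem_filter, Finset.HasAntidiagonal.mem_antidiagonal] at hpq
    have hN2 : 2 ≤ N := by
      have := hpq.2.1.two_le
      omega
    rw [mem_filter, mem_Ioc]
    exact ⟨⟨by omega, by omega⟩, pq.1, pq.2, hpq.2.1, hpq.2.2, hpq.1⟩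
  have hTcard : (#T : ℝ) ≤ #{N ∈ Ioc 0 x | ∃ p q : ℕ, p.Prime ∧ q.Prime ∧ p + q = N} := by
    exact_mod_cast card_le_card hTA
  have h76 := hS₁ x hx
  have h77 := hS₂ x hx
  set S₁ := ∑ N ∈ range (x + 1), r N with hS₁_def
  set S₂ := ∑ N ∈ range (x + 1), r N ^ 2 with hS₂_def
  set Ax : ℝ := ((#{N ∈ Ioc 0 x | ∃ p q : ℕ, p.Prime ∧ q.Prime ∧ p + q = N} : ℕ) : ℝ) with hAx
  have hmain : S₁ ^ 2 ≤ S₂ * Ax := by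
    rw [hsumT]
    calc (∑ N ∈ T, r N * 1) ^ 2 ≤ (∑ N ∈ T, r N ^ 2) * #T := by rw [← hT1]; exact hCS
      _ ≤ S₂ * Ax := mul_le_mul hTsq hTcard (by positivity) (sum_nonneg fun N _ => by positivity)
  have hAx0 : 0 ≤ Ax := by positivity
  have h1 : (c₁ * ((x : ℝ) ^ 2 / Real.log x ^ 2)) ^ 2 ≤ S₁ ^ 2 := pow_le_pow_left₀ (by positivity) h76 2
  have h2 : S₂ * Ax ≤ c₂ * (x : ℝ) ^ 3 / Real.log x ^ 4 * Ax := mul_le_mul_of_nonneg_right h77 hAx0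
  have hL4 : (0 : ℝ) < Real.log x ^ 4 := by positivity
  have h3 : c₁ ^ 2 * (x : ℝ) ^ 4 / Real.log x ^ 4 ≤ c₂ * (x : ℝ) ^ 3 / Real.log x ^ 4 * Ax := by
    have e : (c₁ * ((x : ℝ) ^ 2 / Real.log x ^ 2)) ^ 2 = c₁ ^ 2 * (x : ℝ) ^ 4 / Real.log x ^ 4 := by
      rw [mul_pow, div_pow]; ring
    rw [← e]
    exact h1.trans (hmain.trans h2)
  have h4 : c₁ ^ 2 * (x : ℝ) ^ 4 ≤ c₂ * (x : ℝ) ^ 3 * Ax := by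
    have h := (div_le_iff₀ hL4).mp h3
    have e2 : c₂ * (x : ℝ) ^ 3 / Real.log x ^ 4 * Ax * Real.log x ^ 4 = c₂ * (x : ℝ) ^ 3 * Ax := by
      field_simp
    linarith [h, e2]
  have h5 : c₁ ^ 2 * (x : ℝ) ≤ c₂ * Ax := by
    have hx3 : (0 : ℝ) < (x : ℝ) ^ 3 := by positivity
    have h : (x : ℝ) ^ 3 * (c₁ ^ 2 * x) ≤ (x : ℝ) ^ 3 * (c₂ * Ax) := by
      calc (x : ℝ) ^ 3 * (c₁ ^ 2 * x) = c₁ ^ 2 * (x : ℝ) ^ 4 := by ring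
        _ ≤ c₂ * (x : ℝ) ^ 3 * Ax := h4
        _ = (x : ℝ) ^ 3 * (c₂ * Ax) := by ring
    exact le_of_mul_le_mul_left h hx3
  calc c₁ ^ 2 / c₂ * (x : ℝ) = c₁ ^ 2 * x / c₂ := by ring
    _ ≤ Ax := by rw [div_le_iff₀ hc₂]; linarith

/-- **Unconditional, factor `1/3`**: for `x ≥ e^100`, at least `x/790` Goldbach numbers in `(0, x]`
(`0.424²/142 = 1/789.9…`). [cite: Nathanson1996, Theorem 7.8 (proof; explicit form proved here)] -/
theorem goldbach_count_ge_790 {x : ℕ} (hx : Real.exp 100 ≤ (x : ℝ)) :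
    (x : ℝ) / 790 ≤ #{N ∈ Ioc 0 x | ∃ p q : ℕ, p.Prime ∧ q.Prime ∧ p + q = N} := by
  have h := goldbach_count_ge_of_moments (c₁ := 0.424) (c₂ := 142) (by norm_num) (by norm_num)
    (fun y hy => sum_goldbachCount_ge_0424 hy) (fun y hy => sum_goldbachCount_sq_le_142 hy) hx
  have hx0 : (0 : ℝ) ≤ x := Nat.cast_nonneg x
  have hc : (1 : ℝ) / 790 ≤ 0.424 ^ 2 / 142 := by norm_num
  calc (x : ℝ) / 790 = 1 / 790 * x := by ring
    _ ≤ 0.424 ^ 2 / 142 * x := mul_le_mul_of_nonneg_right hc hx0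
    _ ≤ _ := h

/-- **Under Rosser–Schoenfeld (3.3), factor `1/3`**: for `x ≥ e^100`, at least `x/570` Goldbach numbers in `(0, x]`
(`0.4995²/142 = 1/569.1…`). [cite: RosserSchoenfeld1962, Theorem 2, eq. (3.3) (as input)] -/
theorem goldbach_count_ge_of_RS_570 (hRS : Literature.NumberTheory.LFunctions.RosserSchoenfeld1962_theorem2)
    {x : ℕ} (hx : Real.exp 100 ≤ (x : ℝ)) :
    (x : ℝ) / 570 ≤ #{N ∈ Ioc 0 x | ∃ p q : ℕ, p.Prime ∧ q.Prime ∧ p + q = N} := by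
  have h := goldbach_count_ge_of_moments (c₁ := 0.4995) (c₂ := 142) (by norm_num) (by norm_num)
    (fun y hy => sum_goldbachCount_ge_of_RS hRS hy) (fun y hy => sum_goldbachCount_sq_le_142 hy) hx
  have hx0 : (0 : ℝ) ≤ x := Nat.cast_nonneg x
  have hc : (1 : ℝ) / 570 ≤ 0.4995 ^ 2 / 142 := by norm_num
  calc (x : ℝ) / 570 = 1 / 570 * x := by ring
    _ ≤ 0.4995 ^ 2 / 142 * x := mul_le_mul_of_nonneg_right hc hx0
    _ ≤ _ := h

/-- **All `N ≥ 1`, factor `1/3`**: `A(N) ≥ N/790` for `A = {0, 1} ∪ {p + q}`. [cite: Nathanson1996, Theorem 7.8 (explicit constant proved here)] -/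
theorem goldbach_A_count_ge_allN_790 {N : ℕ} (hN : 1 ≤ N) :
    (N : ℝ) / 790 ≤ #{a ∈ Ioc 0 N | a ∈ (({0, 1} : Set ℕ) ∪ {n | ∃ p q : ℕ, p.Prime ∧ q.Prime ∧ p + q = n})} := by
  have h := count_ge_allN (K₀ := 790) (by norm_num)
    (fun x hx => by have := goldbach_count_ge_790 hx; exact_mod_cast this) hN
  exact_mod_cast h

/-- **All `N ≥ 1`, under (3.3), factor `1/3`**: `A(N) ≥ N/570`. [cite: RosserSchoenfeld1962, Theorem 2, eq. (3.3) (as input)] -/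
theorem goldbach_A_count_ge_allN_of_RS_570 (hRS : Literature.NumberTheory.LFunctions.RosserSchoenfeld1962_theorem2)
    {N : ℕ} (hN : 1 ≤ N) :
    (N : ℝ) / 570 ≤ #{a ∈ Ioc 0 N | a ∈ (({0, 1} : Set ℕ) ∪ {n | ∃ p q : ℕ, p.Prime ∧ q.Prime ∧ p + q = n})} := by
  have h := count_ge_allN (K₀ := 570) (by norm_num)
    (fun x hx => by have := goldbach_count_ge_of_RS_570 hRS hx; exact_mod_cast this) hN
  exact_mod_cast h

/-- **Theorem 7.8, explicit, factor `1/3`**: `σ({0, 1} ∪ {p + q}) ≥ 1/790`, unconditionally.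
[cite: Nathanson1996, Thm 7.8 (explicit constant proved here)] -/
theorem schnirelmannDensity_goldbach_ge_790 :
    (1 : ℝ) / 790 ≤ schnirelmannDensity (({0, 1} : Set ℕ) ∪ {n | ∃ p q : ℕ, p.Prime ∧ q.Prime ∧ p + q = n}) := by
  have h := schnirelmannDensity_ge_of_count (K₀ := 790)
    (fun N hN => by have := goldbach_A_count_ge_allN_790 hN; exact_mod_cast this)
  exact_mod_cast h

/-- **Theorem 7.8 under (3.3), factor `1/3`**: `σ({0, 1} ∪ {p + q}) ≥ 1/570`.
[cite: RosserSchoenfeld1962, Theorem 2, eq. (3.3) (as input)] -/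
theorem schnirelmannDensity_goldbach_ge_of_RS_570
    (hRS : Literature.NumberTheory.LFunctions.RosserSchoenfeld1962_theorem2) :
    (1 : ℝ) / 570 ≤ schnirelmannDensity (({0, 1} : Set ℕ) ∪ {n | ∃ p q : ℕ, p.Prime ∧ q.Prime ∧ p + q = n}) := by
  have h := schnirelmannDensity_ge_of_count (K₀ := 570)
    (fun N hN => by have := goldbach_A_count_ge_allN_of_RS_570 hRS hN; exact_mod_cast this)
  exact_mod_cast h

/-- ★★ **The Shnirel'man–Goldbach theorem, explicit and unconditional — the best constant of this file: every
integer `N ≥ 2` is a sum of at most `1581` primes** (`σ ≥ 1/790`: Chebyshev's `0.9212`, the explicit Selberg bound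
`17.1`, the weighted mean square `0.4431`, Mann's theorem: `790·A = ℕ`, `2·790 + 1 = 1581`).  No hypotheses, no
named facts. [cite: Nathanson1996, Thm 7.9 (explicit constant proved here)] -/
theorem schnirelmann_goldbach_le_1581 (N : ℕ) (hN : 2 ≤ N) :
    ∃ M : Multiset ℕ, (∀ p ∈ M, p.Prime) ∧ Multiset.card M ≤ 1581 ∧ M.sum = N := by
  have hσ : (1 : ℝ) / ((790 : ℕ) : ℝ)
      ≤ schnirelmannDensity (({0, 1} : Set ℕ) ∪ {n | ∃ p q : ℕ, p.Prime ∧ q.Prime ∧ p + q = n}) := by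
    have := schnirelmannDensity_goldbach_ge_790
    exact_mod_cast this
  exact sum_of_primes_of_density_mann (K₀ := 790) (by norm_num) hσ N hN

/-- ★ **Under Rosser–Schoenfeld (3.3), factor `1/3`: every integer `N ≥ 2` is a sum of at most `1141` primes**
(`σ ≥ 1/570`, Mann). [cite: RosserSchoenfeld1962, Theorem 2, eq. (3.3) (as input)] -/
theorem schnirelmann_goldbach_of_RS_le_1141 (hRS : Literature.NumberTheory.LFunctions.RosserSchoenfeld1962_theorem2)
    (N : ℕ) (hN : 2 ≤ N) :
    ∃ M : Multiset ℕ, (∀ p ∈ M, p.Prime) ∧ Multiset.card M ≤ 1141 ∧ M.sum = N := by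
  have hσ : (1 : ℝ) / ((570 : ℕ) : ℝ)
      ≤ schnirelmannDensity (({0, 1} : Set ℕ) ∪ {n | ∃ p q : ℕ, p.Prime ∧ q.Prime ∧ p + q = n}) := by
    have := schnirelmannDensity_goldbach_ge_of_RS_570 hRS
    exact_mod_cast this
  exact sum_of_primes_of_density_mann (K₀ := 570) (by norm_num) hσ N hN

/-! ## §11 Halving (ROUND-26): the Shnirel'man density of `B = {0, 1} ∪ {m : 2m = p + q}` is `≥ 1/395`; every `N ≥ 2`
is a sum of at most `791` primes (RS (3.3): `571`)

Every Goldbach number `≥ 4` is even, so `A = {0, 1} ∪ {p + q}` has density `≤ 1/2 + o(1)` and §10's `σ(A) ≥ 1/790` gives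
away a factor `2` that the halved set `B` recovers: `B(y) ≥ #{even N ≤ 2y : N = p + q} ≥ 2y/790` (Cauchy–Schwarz restricted
to even `N`: `Σ_{odd N ≤ x} r(N) ≤ 2(x + 1)`).  Mann's theorem gives `395 • B = ℕ`, and doubling `n = Σ bᵢ` gives
`2n = Σ 2bᵢ` with `2·1 = 2` prime and `2m = p + q`: every even `N` is a sum of `≤ 790` primes, every odd `N = 2(n−1) + 3`
of `≤ 791`. -/

/-- **First moment, `0.4243`**: `Σ_{N ≤ x} r(N) ≥ 0.4243·x²/log²x` for `x ≥ e^100` (`c₀²/2 = 0.424305…`). [cite: Nathanson1996, Lemma 7.6 (explicit form proved here)] -/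
theorem sum_goldbachCount_ge_04243 {x : ℕ} (hx : Real.exp 100 ≤ (x : ℝ)) :
    0.4243 * ((x : ℝ) ^ 2 / Real.log x ^ 2) ≤ ∑ N ∈ range (x + 1), (SingularSeries.goldbachCount N : ℝ) := by
  have hbig : (2 : ℝ) ^ 60 ≤ x := le_trans (le_trans (by norm_num) two_pow_100_le_exp_100) hx
  have h60 : (2000000 : ℝ) ≤ (2 : ℝ) ^ 60 := by norm_num
  have hx2 : 2 * 10 ^ 6 ≤ x := by
    have : ((2 * 10 ^ 6 : ℕ) : ℝ) ≤ x := by push_cast; linarith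
    exact_mod_cast this
  have h := sum_goldbachCount_ge_of_lower (by norm_num) (by norm_num) primeCountingLowerMul_09212 hx2
  have e : ((10 ^ 6 : ℕ) : ℝ) = (10 : ℝ) ^ 6 := by norm_num
  rw [e] at h
  refine le_trans ?_ h
  have hx1 : (1 : ℝ) < x := by linarith
  have hL : 0 < Real.log x := Real.log_pos hx1
  have hL2 : 0 < 2 * Real.log x ^ 2 := by positivity
  have hxn : (0 : ℝ) ≤ x := by linarith
  have key : 0.4243 * (x : ℝ) ^ 2 * 2 ≤ 0.9212 ^ 2 * (((x : ℝ) - (10 : ℝ) ^ 6) ^ 2 - ((10 : ℝ) ^ 6) ^ 2) := by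
    nlinarith [mul_le_mul_of_nonneg_right hbig hxn]
  calc 0.4243 * ((x : ℝ) ^ 2 / Real.log x ^ 2) = (0.4243 * (x : ℝ) ^ 2 * 2) / (2 * Real.log x ^ 2) := by
        field_simp
    _ ≤ 0.9212 ^ 2 * (((x : ℝ) - (10 : ℝ) ^ 6) ^ 2 - ((10 : ℝ) ^ 6) ^ 2) / (2 * Real.log x ^ 2) :=
        div_le_div_of_nonneg_right key hL2.le
    _ = 0.9212 ^ 2 * ((((x : ℝ) - (10 : ℝ) ^ 6) ^ 2 - ((10 : ℝ) ^ 6) ^ 2) / (2 * Real.log x ^ 2)) := by ring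

/-- **Odd `N` are negligible in the first moment**: `Σ_{odd N ≤ x} r(N) ≤ 2(x + 1)`. [folklore] -/
private theorem sum_goldbachCount_odd_le (x : ℕ) :
    ∑ N ∈ (range (x + 1)).filter (fun N => ¬Even N), (SingularSeries.goldbachCount N : ℝ) ≤ 2 * ((x : ℝ) + 1) := by
  calc ∑ N ∈ (range (x + 1)).filter (fun N => ¬Even N), (SingularSeries.goldbachCount N : ℝ)
      ≤ ∑ N ∈ (range (x + 1)).filter (fun N => ¬Even N), (2 : ℝ) := sum_le_sum fun N hN => by
        rw [mem_filter] at hN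
        exact_mod_cast goldbachCount_le_two_of_odd (Nat.not_even_iff_odd.mp hN.2)
    _ = #((range (x + 1)).filter (fun N => ¬Even N)) * 2 := by rw [sum_const, nsmul_eq_mul]
    _ ≤ ((x : ℝ) + 1) * 2 := by
        apply mul_le_mul_of_nonneg_right _ (by norm_num)
        have : #((range (x + 1)).filter (fun N => ¬Even N)) ≤ x + 1 :=
          (card_filter_le _ _).trans (by rw [card_range])
        exact_mod_cast this
    _ = 2 * ((x : ℝ) + 1) := by ring

/-- `2(x + 1) ≤ 10⁻⁴·x²/log²x` for `x ≥ e^100` (`log²x ≤ 0.41√x`, `√x ≥ 2^30`). [folklore] -/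
private theorem two_mul_succ_le_small {x : ℕ} (hx : Real.exp 100 ≤ (x : ℝ)) :
    2 * ((x : ℝ) + 1) ≤ 0.0001 * ((x : ℝ) ^ 2 / Real.log x ^ 2) := by
  have hx1 : (1 : ℝ) < x := lt_of_lt_of_le (by have := Real.add_one_le_exp (100 : ℝ); linarith) hx
  have hx0 : (0 : ℝ) < x := by linarith
  set L := Real.log x with hL
  have hL100 : 100 ≤ L := by
    have := Real.log_le_log (Real.exp_pos 100) hx
    rwa [Real.log_exp] at this
  have hLpos : 0 < L ^ 2 := by positivity
  have hL4 : L ^ 4 ≤ 4096 * Real.sqrt x := log_pow_four_le_sqrt hx1.le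
  have hLsq : (10000 : ℝ) ≤ L ^ 2 := by nlinarith
  have hL2 : L ^ 2 ≤ 0.4096 * Real.sqrt x := by
    have e : L ^ 4 = L ^ 2 * L ^ 2 := by ring
    nlinarith
  have hbig : (2 : ℝ) ^ 60 ≤ x := le_trans (le_trans (by norm_num) two_pow_100_le_exp_100) hx
  have hsx : (2 : ℝ) ^ 30 ≤ Real.sqrt x :=
    Real.le_sqrt_of_sq_le (by rw [show ((2 : ℝ) ^ 30) ^ 2 = (2 : ℝ) ^ 60 by norm_num]; exact hbig)
  have hxx : Real.sqrt x * Real.sqrt x = x := Real.mul_self_sqrt hx0.le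
  have key : 2 * ((x : ℝ) + 1) * L ^ 2 ≤ 0.0001 * (x : ℝ) ^ 2 := by
    have h1 : 2 * ((x : ℝ) + 1) * L ^ 2 ≤ 4 * x * (0.4096 * Real.sqrt x) := by
      have : 2 * ((x : ℝ) + 1) ≤ 4 * x := by linarith
      exact mul_le_mul this hL2 (by positivity) (by positivity)
    have h2 : (1 : ℝ) ≤ Real.sqrt x / 2 ^ 30 := by
      rw [le_div_iff₀ (by positivity)]; linarith
    calc 2 * ((x : ℝ) + 1) * L ^ 2 ≤ 4 * x * (0.4096 * Real.sqrt x) := h1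
      _ ≤ 4 * x * (0.4096 * Real.sqrt x) * (Real.sqrt x / 2 ^ 30) :=
          le_mul_of_one_le_right (by positivity) h2
      _ = (1.6384 / 2 ^ 30) * (x * (Real.sqrt x * Real.sqrt x)) := by ring
      _ = (1.6384 / 2 ^ 30) * (x : ℝ) ^ 2 := by rw [hxx]; ring
      _ ≤ 0.0001 * (x : ℝ) ^ 2 := mul_le_mul_of_nonneg_right (by norm_num) (by positivity)
  calc 2 * ((x : ℝ) + 1) = 2 * ((x : ℝ) + 1) * L ^ 2 / L ^ 2 := by field_simp
    _ ≤ 0.0001 * (x : ℝ) ^ 2 / L ^ 2 := div_le_div_of_nonneg_right key hLpos.le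
    _ = _ := by ring

/-- **Theorem 7.8 for EVEN Goldbach numbers, both moments as parameters**: if `Σ_{N≤x} r(N) ≥ c₁x²/log²x` and
`Σ_{N≤x} r(N)² ≤ c₂x³/log⁴x` for `x ≥ e^100`, then `#{even N ∈ (0, x] : N = p + q} ≥ ((c₁ − 10⁻⁴)²/c₂)·x` for `x ≥ e^100`
(Cauchy–Schwarz over even `N` only; the odd `N` carry `Σ r ≤ 2(x+1) ≤ 10⁻⁴x²/log²x`).
[cite: Nathanson1996, Thm 7.8 (proof, explicit form restricted to even N proved here)] -/
theorem goldbach_even_count_ge_of_moments {c₁ c₂ : ℝ} (hc₁ : 0.0001 ≤ c₁) (hc₂ : 0 < c₂)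
    (hS₁ : ∀ x : ℕ, Real.exp 100 ≤ (x : ℝ) →
      c₁ * ((x : ℝ) ^ 2 / Real.log x ^ 2) ≤ ∑ N ∈ range (x + 1), (SingularSeries.goldbachCount N : ℝ))
    (hS₂ : ∀ x : ℕ, Real.exp 100 ≤ (x : ℝ) →
      ∑ N ∈ range (x + 1), (SingularSeries.goldbachCount N : ℝ) ^ 2 ≤ c₂ * (x : ℝ) ^ 3 / Real.log x ^ 4)
    {x : ℕ} (hx : Real.exp 100 ≤ (x : ℝ)) :
    (c₁ - 0.0001) ^ 2 / c₂ * (x : ℝ) ≤ #{N ∈ Ioc 0 x | Even N ∧ ∃ p q : ℕ, p.Prime ∧ q.Prime ∧ p + q = N} := by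
  have hx1 : (1 : ℝ) < x := lt_of_lt_of_le (by have := Real.add_one_le_exp (100 : ℝ); linarith) hx
  have hx0 : (0 : ℝ) < x := by linarith
  have hlogx : 0 < Real.log x := Real.log_pos hx1
  set r : ℕ → ℝ := fun N => (SingularSeries.goldbachCount N : ℝ) with hr
  set T : Finset ℕ := (range (x + 1)).filter fun N => Even N ∧ 0 < SingularSeries.goldbachCount N with hT
  have hsumT : ∑ N ∈ (range (x + 1)).filter Even, r N = ∑ N ∈ T, r N * 1 := by
    rw [hT]
    simp only [sum_filter]
    refine sum_congr rfl fun N _ => ?_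
    by_cases he : Even N
    · by_cases h0 : 0 < SingularSeries.goldbachCount N
      · rw [if_pos he, if_pos ⟨he, h0⟩, mul_one]
      · rw [if_pos he, if_neg (fun h => h0 h.2), hr]
        simp only [not_lt, Nat.le_zero] at h0
        simp [h0]
    · rw [if_neg he, if_neg (fun h => he h.1)]
  have hCS : (∑ N ∈ T, r N * 1) ^ 2 ≤ (∑ N ∈ T, r N ^ 2) * ∑ N ∈ T, (1 : ℝ) ^ 2 :=
    sum_mul_sq_le_sq_mul_sq T r fun _ => 1
  have hT1 : ∑ N ∈ T, (1 : ℝ) ^ 2 = #T := by simp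
  have hTsq : ∑ N ∈ T, r N ^ 2 ≤ ∑ N ∈ range (x + 1), r N ^ 2 :=
    sum_le_sum_of_subset_of_nonneg (by rw [hT]; exact filter_subset _ _) fun N _ _ => by positivity
  have hTA : T ⊆ {N ∈ Ioc 0 x | Even N ∧ ∃ p q : ℕ, p.Prime ∧ q.Prime ∧ p + q = N} := by
    intro N hN
    rw [hT, mem_filter, mem_range] at hN
    obtain ⟨hNx, he, hpos⟩ := hN
    unfold SingularSeries.goldbachCount at hpos
    obtain ⟨pq, hpq⟩ := card_pos.mp hpos
    rw [mem_filter, Finset.HasAntidiagonal.mem_antidiagonal] at hpq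
    have hN2 : 2 ≤ N := by
      have := hpq.2.1.two_le
      omega
    rw [mem_filter, mem_Ioc]
    exact ⟨⟨by omega, by omega⟩, he, pq.1, pq.2, hpq.2.1, hpq.2.2, hpq.1⟩
  have hTcard : (#T : ℝ) ≤ #{N ∈ Ioc 0 x | Even N ∧ ∃ p q : ℕ, p.Prime ∧ q.Prime ∧ p + q = N} := by
    exact_mod_cast card_le_card hTA
  -- the even first moment
  have hsplit := sum_filter_add_sum_filter_not (range (x + 1)) Even r
  have hodd : ∑ N ∈ (range (x + 1)).filter (fun N => ¬Even N), r N ≤ 2 * ((x : ℝ) + 1) :=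
    sum_goldbachCount_odd_le x
  have hsmall := two_mul_succ_le_small hx
  have h76' : (c₁ - 0.0001) * ((x : ℝ) ^ 2 / Real.log x ^ 2) ≤ ∑ N ∈ (range (x + 1)).filter Even, r N := by
    have h76 := hS₁ x hx
    have e : (c₁ - 0.0001) * ((x : ℝ) ^ 2 / Real.log x ^ 2)
        = c₁ * ((x : ℝ) ^ 2 / Real.log x ^ 2) - 0.0001 * ((x : ℝ) ^ 2 / Real.log x ^ 2) := by ring
    rw [e]
    linarith
  have h77 := hS₂ x hx
  have hc₁' : 0 ≤ c₁ - 0.0001 := by linarith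
  set S₁ := ∑ N ∈ (range (x + 1)).filter Even, r N with hS₁_def
  set S₂ := ∑ N ∈ range (x + 1), r N ^ 2 with hS₂_def
  set Ax : ℝ := ((#{N ∈ Ioc 0 x | Even N ∧ ∃ p q : ℕ, p.Prime ∧ q.Prime ∧ p + q = N} : ℕ) : ℝ) with hAx
  have hmain : S₁ ^ 2 ≤ S₂ * Ax := by
    rw [hsumT]
    calc (∑ N ∈ T, r N * 1) ^ 2 ≤ (∑ N ∈ T, r N ^ 2) * #T := by rw [← hT1]; exact hCS
      _ ≤ S₂ * Ax := mul_le_mul hTsq hTcard (by positivity) (sum_nonneg fun N _ => by positivity)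
  have hAx0 : 0 ≤ Ax := by positivity
  have h1 : ((c₁ - 0.0001) * ((x : ℝ) ^ 2 / Real.log x ^ 2)) ^ 2 ≤ S₁ ^ 2 := pow_le_pow_left₀ (by positivity) h76' 2
  have h2 : S₂ * Ax ≤ c₂ * (x : ℝ) ^ 3 / Real.log x ^ 4 * Ax := mul_le_mul_of_nonneg_right h77 hAx0
  have hL4 : (0 : ℝ) < Real.log x ^ 4 := by positivity
  have h3 : (c₁ - 0.0001) ^ 2 * (x : ℝ) ^ 4 / Real.log x ^ 4 ≤ c₂ * (x : ℝ) ^ 3 / Real.log x ^ 4 * Ax := by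
    have e : ((c₁ - 0.0001) * ((x : ℝ) ^ 2 / Real.log x ^ 2)) ^ 2
        = (c₁ - 0.0001) ^ 2 * (x : ℝ) ^ 4 / Real.log x ^ 4 := by
      rw [mul_pow, div_pow]; ring
    rw [← e]
    exact h1.trans (hmain.trans h2)
  have h4 : (c₁ - 0.0001) ^ 2 * (x : ℝ) ^ 4 ≤ c₂ * (x : ℝ) ^ 3 * Ax := by
    have h := (div_le_iff₀ hL4).mp h3
    have e2 : c₂ * (x : ℝ) ^ 3 / Real.log x ^ 4 * Ax * Real.log x ^ 4 = c₂ * (x : ℝ) ^ 3 * Ax := by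
      field_simp
    linarith [h, e2]
  have h5 : (c₁ - 0.0001) ^ 2 * (x : ℝ) ≤ c₂ * Ax := by
    have hx3 : (0 : ℝ) < (x : ℝ) ^ 3 := by positivity
    have h : (x : ℝ) ^ 3 * ((c₁ - 0.0001) ^ 2 * x) ≤ (x : ℝ) ^ 3 * (c₂ * Ax) := by
      calc (x : ℝ) ^ 3 * ((c₁ - 0.0001) ^ 2 * x) = (c₁ - 0.0001) ^ 2 * (x : ℝ) ^ 4 := by ring
        _ ≤ c₂ * (x : ℝ) ^ 3 * Ax := h4
        _ = (x : ℝ) ^ 3 * (c₂ * Ax) := by ring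
    exact le_of_mul_le_mul_left h hx3
  calc (c₁ - 0.0001) ^ 2 / c₂ * (x : ℝ) = (c₁ - 0.0001) ^ 2 * x / c₂ := by ring
    _ ≤ Ax := by rw [div_le_iff₀ hc₂]; linarith

/-- **Unconditional**: for `x ≥ e^100`, at least `x/790` EVEN Goldbach numbers in `(0, x]`
(`(0.4243 − 10⁻⁴)²/142 = 1/789.1…`). [cite: Nathanson1996, Theorem 7.8 (proof, restricted to even N; explicit form proved here)] -/
theorem goldbach_even_count_ge_790 {x : ℕ} (hx : Real.exp 100 ≤ (x : ℝ)) :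
    (x : ℝ) / 790 ≤ #{N ∈ Ioc 0 x | Even N ∧ ∃ p q : ℕ, p.Prime ∧ q.Prime ∧ p + q = N} := by
  have h := goldbach_even_count_ge_of_moments (c₁ := 0.4243) (c₂ := 142) (by norm_num) (by norm_num)
    (fun y hy => sum_goldbachCount_ge_04243 hy) (fun y hy => sum_goldbachCount_sq_le_142 hy) hx
  have hx0 : (0 : ℝ) ≤ x := Nat.cast_nonneg x
  have hc : (1 : ℝ) / 790 ≤ (0.4243 - 0.0001) ^ 2 / 142 := by norm_num
  calc (x : ℝ) / 790 = 1 / 790 * x := by ring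
    _ ≤ (0.4243 - 0.0001) ^ 2 / 142 * x := mul_le_mul_of_nonneg_right hc hx0
    _ ≤ _ := h

/-- **Under Rosser–Schoenfeld (3.3)**: for `x ≥ e^100`, at least `x/570` EVEN Goldbach numbers in `(0, x]`
(`(0.4995 − 10⁻⁴)²/142 = 1/569.4…`). [cite: RosserSchoenfeld1962, Theorem 2, eq. (3.3) (as input)] -/
theorem goldbach_even_count_ge_of_RS_570 (hRS : Literature.NumberTheory.LFunctions.RosserSchoenfeld1962_theorem2)
    {x : ℕ} (hx : Real.exp 100 ≤ (x : ℝ)) :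
    (x : ℝ) / 570 ≤ #{N ∈ Ioc 0 x | Even N ∧ ∃ p q : ℕ, p.Prime ∧ q.Prime ∧ p + q = N} := by
  have h := goldbach_even_count_ge_of_moments (c₁ := 0.4995) (c₂ := 142) (by norm_num) (by norm_num)
    (fun y hy => sum_goldbachCount_ge_of_RS hRS hy) (fun y hy => sum_goldbachCount_sq_le_142 hy) hx
  have hx0 : (0 : ℝ) ≤ x := Nat.cast_nonneg x
  have hc : (1 : ℝ) / 570 ≤ (0.4995 - 0.0001) ^ 2 / 142 := by norm_num
  calc (x : ℝ) / 570 = 1 / 570 * x := by ring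
    _ ≤ (0.4995 - 0.0001) ^ 2 / 142 * x := mul_le_mul_of_nonneg_right hc hx0
    _ ≤ _ := h

/-- The halving map: `#{even N ∈ (0, 2y] : N = p + q} ≤ #{b ∈ (0, y] : b ∈ B}`, `B = {0, 1} ∪ {m : 2m = p + q}`
(`N ↦ N/2`). [folklore] -/
private theorem even_goldbach_card_le_half (y : ℕ) :
    #{N ∈ Ioc 0 (2 * y) | Even N ∧ ∃ p q : ℕ, p.Prime ∧ q.Prime ∧ p + q = N}
      ≤ #{b ∈ Ioc 0 y | b ∈ (({0, 1} : Set ℕ) ∪ {m | ∃ p q : ℕ, p.Prime ∧ q.Prime ∧ p + q = 2 * m})} := by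
  refine card_le_card_of_injOn (fun N => N / 2) ?_ ?_
  · intro N hN
    rw [mem_coe, mem_filter, mem_Ioc] at hN
    obtain ⟨⟨hN0, hNy⟩, ⟨k, hk⟩, p, q, hp, hq, hpq⟩ := hN
    rw [mem_coe, mem_filter, mem_Ioc]
    dsimp only
    exact ⟨⟨by omega, by omega⟩, Or.inr ⟨p, q, hp, hq, by omega⟩⟩
  · intro N hN N' hN' h
    rw [mem_coe, mem_filter] at hN hN'
    obtain ⟨k, hk⟩ := hN.2.1
    obtain ⟨k', hk'⟩ := hN'.2.1
    simp only at h
    omega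

/-- **All `y ≥ 1` for the halved set**: if `x/(2h) ≤ #{even N ∈ (0, x] : N = p + q}` for `x ≥ e^100` and `h ≥ 202`,
then `y/h ≤ B(y)` for every `y ≥ 1` (`2y ≥ e^100`: halve; `y ≤ h`: `1 ∈ B`; otherwise the primes `p ≤ y` lie in `B`
(`2p = p + p`) and `π(y) ≥ 0.9212·y/log y` (`y ≥ 10^6`, `log y < 100`) or `π(y) ≥ y/(4 log y)` (`log y ≤ 14`)). [cite: Nathanson1996, Theorem 7.8 (explicit constant for the halved set proved here)] -/
theorem half_count_ge_allN {h : ℕ} (hh : 202 ≤ h)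
    (hlarge : ∀ x : ℕ, Real.exp 100 ≤ (x : ℝ) →
      (x : ℝ) / (2 * h) ≤ #{N ∈ Ioc 0 x | Even N ∧ ∃ p q : ℕ, p.Prime ∧ q.Prime ∧ p + q = N})
    {y : ℕ} (hy : 1 ≤ y) :
    (y : ℝ) / h ≤ #{b ∈ Ioc 0 y | b ∈ (({0, 1} : Set ℕ) ∪ {m | ∃ p q : ℕ, p.Prime ∧ q.Prime ∧ p + q = 2 * m})} := by
  set B : Set ℕ := ({0, 1} : Set ℕ) ∪ {m | ∃ p q : ℕ, p.Prime ∧ q.Prime ∧ p + q = 2 * m} with hB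
  have hhr : (202 : ℝ) ≤ h := by exact_mod_cast hh
  have hh0 : (0 : ℝ) < h := by linarith
  by_cases hbig : Real.exp 100 ≤ ((2 * y : ℕ) : ℝ)
  · have h1 := hlarge (2 * y) hbig
    have h2 := even_goldbach_card_le_half y
    have e : ((2 * y : ℕ) : ℝ) / (2 * h) = (y : ℝ) / h := by
      push_cast
      field_simp
    rw [e] at h1
    exact h1.trans (by exact_mod_cast h2)
  rw [not_le] at hbig
  by_cases hsmall : y ≤ h
  · have h1 : 1 ≤ #{b ∈ Ioc 0 y | b ∈ B} :=
      card_pos.mpr ⟨1, by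
        rw [mem_filter, mem_Ioc]
        exact ⟨⟨by omega, hy⟩, Or.inl (by simp)⟩⟩
    have h1' : (1 : ℝ) ≤ #{b ∈ Ioc 0 y | b ∈ B} := by exact_mod_cast h1
    have h2 : (y : ℝ) / h ≤ 1 := by
      rw [div_le_one hh0]
      exact_mod_cast hsmall
    linarith
  rw [not_le] at hsmall
  -- the primes `p ≤ y` lie in `B`
  have hP : #((range (y + 1)).filter Nat.Prime) ≤ #{b ∈ Ioc 0 y | b ∈ B} := card_le_card fun p hp => by
    rw [mem_filter, mem_range] at hp
    rw [mem_filter, mem_Ioc]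
    exact ⟨⟨hp.2.pos, by omega⟩, Or.inr ⟨p, p, hp.2, hp.2, by ring⟩⟩
  rw [card_filter_prime_range] at hP
  have hPr : (Nat.primeCounting y : ℝ) ≤ #{b ∈ Ioc 0 y | b ∈ B} := by exact_mod_cast hP
  refine le_trans ?_ hPr
  have hy1 : (1 : ℝ) < y := by exact_mod_cast (show 1 < y by omega)
  have hy0 : (0 : ℝ) < y := by linarith
  have hlogpos : 0 < Real.log y := Real.log_pos hy1
  have hlogy : Real.log y < 100 := by
    have h2y : (y : ℝ) ≤ ((2 * y : ℕ) : ℝ) := by push_cast; linarith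
    have := Real.log_lt_log hy0 (lt_of_le_of_lt h2y hbig)
    rwa [Real.log_exp] at this
  by_cases h6 : 10 ^ 6 ≤ y
  · have hπ : 0.9212 * (y : ℝ) / Real.log (y : ℝ) ≤ (Nat.primeCounting y : ℝ) := by
      have := primeCountingLowerMul_09212
      unfold PrimeCountingLowerMul at this
      exact this y h6
    refine le_trans ?_ hπ
    rw [div_le_div_iff₀ hh0 hlogpos]
    nlinarith
  · rw [not_le] at h6
    have hy32 : 32 ≤ y := by omega
    have hπ := ShnirelmanGoldbachTheorem.primeCounting_ge hy32
    have hlog14 : Real.log y ≤ 14 := by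
      have hy6 : (y : ℝ) ≤ (2.7 : ℝ) ^ 14 := by
        have : (y : ℝ) < 10 ^ 6 := by exact_mod_cast h6
        have h27 : (10 : ℝ) ^ 6 ≤ (2.7 : ℝ) ^ 14 := by norm_num
        linarith
      have he : (2.7 : ℝ) ≤ Real.exp 1 := by have := Real.exp_one_gt_d9; linarith
      have h14 : (2.7 : ℝ) ^ 14 ≤ Real.exp 14 := by
        rw [show (14 : ℝ) = ((14 : ℕ) : ℝ) * 1 by norm_num, Real.exp_nat_mul]
        exact pow_le_pow_left₀ (by norm_num) he 14
      have := Real.log_le_log hy0 (hy6.trans h14)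
      rwa [Real.log_exp] at this
    refine le_trans ?_ hπ
    apply div_le_div_of_nonneg_left hy0.le (by positivity)
    linarith

/-- `σ(S) ≥ 1/K` from `S(N) ≥ N/K` (`N ≥ 1`), for any set `S`. [folklore] -/
private theorem schnirelmannDensity_ge_of_count' {S : Set ℕ} [DecidablePred (· ∈ S)] {K : ℕ}
    (h : ∀ N : ℕ, 1 ≤ N → (N : ℝ) / K ≤ #{a ∈ Ioc 0 N | a ∈ S}) :
    (1 : ℝ) / K ≤ schnirelmannDensity S := by
  rw [le_schnirelmannDensity_iff]
  intro n hn
  have hn' : (0 : ℝ) < n := by exact_mod_cast hn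
  rw [le_div_iff₀ hn']
  have := h n hn
  calc (1 : ℝ) / K * n = (n : ℝ) / K := by ring
    _ ≤ _ := by convert this using 2

/-- Representations double: if `g i ∈ B` for `i ∈ s` then `2·Σ_{i∈s} g i` is a sum of at most `2·#s` primes
(`2·0 = 0`, `2·1 = 2` is prime, `2m = p + q`). [folklore] -/
private theorem exists_repr_half (s : Finset ℕ) (g : ℕ → ℕ)
    (hg : ∀ i ∈ s, g i ∈ (({0, 1} : Set ℕ) ∪ {m | ∃ p q : ℕ, p.Prime ∧ q.Prime ∧ p + q = 2 * m})) :
    ∃ M : Multiset ℕ, (∀ p ∈ M, p.Prime) ∧ Multiset.card M ≤ 2 * #s ∧ M.sum = 2 * ∑ i ∈ s, g i := by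
  induction s using Finset.induction_on with
  | empty => exact ⟨0, by simp, by simp, by simp⟩
  | insert i s hi ih =>
      obtain ⟨M, hM, hcard, hsum⟩ := ih fun j hj => hg j (mem_insert_of_mem hj)
      have hgi := hg i (mem_insert_self i s)
      rw [sum_insert hi, card_insert_of_notMem hi]
      rcases hgi with h01 | ⟨p, q, hp, hq, hpq⟩
      · have h01' : g i = 0 ∨ g i = 1 := by simpa using h01
        rcases h01' with h0 | h1
        · exact ⟨M, hM, by omega, by rw [h0]; omega⟩
        · refine ⟨2 ::ₘ M, fun r hr => ?_, ?_, ?_⟩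
          · rw [Multiset.mem_cons] at hr
            rcases hr with rfl | hr
            · exact Nat.prime_two
            · exact hM r hr
          · rw [Multiset.card_cons]; omega
          · rw [Multiset.sum_cons, h1]; omega
      · refine ⟨p ::ₘ q ::ₘ M, fun r hr => ?_, ?_, ?_⟩
        · rw [Multiset.mem_cons, Multiset.mem_cons] at hr
          rcases hr with rfl | rfl | hr
          · exact hp
          · exact hq
          · exact hM r hr
        · rw [Multiset.card_cons, Multiset.card_cons]; omega
        · rw [Multiset.sum_cons, Multiset.sum_cons]; omega

/-- **From the density of the halved set to an explicit basis, via Mann**: `σ(B) ≥ 1/h` ⇒ `h • B = ℕ` ⇒ every `n`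
has `2n = ` a sum of at most `2h` primes ⇒ every `N ≥ 2` is a sum of at most `2h + 1` primes (`N` odd: `N = 2(n−1) + 3`).
[cite: Nathanson1996, Thm 7.9 (proof, with Mann's theorem and the halved set)] -/
theorem sum_of_primes_of_half_density_mann {h : ℕ} (hh : 0 < h)
    (hσ : (1 : ℝ) / h ≤ schnirelmannDensity
      (({0, 1} : Set ℕ) ∪ {m | ∃ p q : ℕ, p.Prime ∧ q.Prime ∧ p + q = 2 * m}))
    (N : ℕ) (hN : 2 ≤ N) :
    ∃ M : Multiset ℕ, (∀ p ∈ M, p.Prime) ∧ Multiset.card M ≤ 2 * h + 1 ∧ M.sum = N := by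
  set B : Set ℕ := ({0, 1} : Set ℕ) ∪ {m | ∃ p q : ℕ, p.Prime ∧ q.Prime ∧ p + q = 2 * m} with hB
  have h0B : (0 : ℕ) ∈ B := Or.inl (by simp)
  have hbasis : h • B = Set.univ := nsmul_eq_univ_of_density h0B hh (by convert hσ)
  have hrep : ∀ n : ℕ, ∃ M : Multiset ℕ, (∀ p ∈ M, p.Prime) ∧ Multiset.card M ≤ 2 * h ∧ M.sum = 2 * n := by
    intro n
    have hmem : n ∈ ∑ _i ∈ range h, B := by
      rw [sum_const, card_range, hbasis]
      exact Set.mem_univ _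
    rw [Set.mem_finsetSum] at hmem
    obtain ⟨g, hg, hgsum⟩ := hmem
    obtain ⟨M, hM, hcard, hsum⟩ := exists_repr_half (range h) g fun i hi => hg hi
    rw [card_range] at hcard
    exact ⟨M, hM, hcard, by rw [hsum, hgsum]⟩
  rcases Nat.even_or_odd N with ⟨n, hn⟩ | ⟨n, hn⟩
  · obtain ⟨M, hM, hcard, hsum⟩ := hrep n
    exact ⟨M, hM, by omega, by rw [hsum]; omega⟩
  · obtain ⟨M, hM, hcard, hsum⟩ := hrep (n - 1)
    refine ⟨3 ::ₘ M, fun r hr => ?_, ?_, ?_⟩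
    · rw [Multiset.mem_cons] at hr
      rcases hr with rfl | hr
      · exact Nat.prime_three
      · exact hM r hr
    · rw [Multiset.card_cons]; omega
    · rw [Multiset.sum_cons, hsum]; omega

/-- **Unconditional count for all `y ≥ 1`**: `B(y) ≥ y/395`. [cite: Nathanson1996, Theorem 7.8 (explicit constant for the halved set proved here)] -/
theorem half_count_ge_allN_395 {y : ℕ} (hy : 1 ≤ y) :
    (y : ℝ) / 395 ≤ #{b ∈ Ioc 0 y | b ∈ (({0, 1} : Set ℕ) ∪ {m | ∃ p q : ℕ, p.Prime ∧ q.Prime ∧ p + q = 2 * m})} := by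
  have h := half_count_ge_allN (h := 395) (by norm_num) (fun x hx => by
    have h1 := goldbach_even_count_ge_790 hx
    have e : (x : ℝ) / (2 * ((395 : ℕ) : ℝ)) = (x : ℝ) / 790 := by norm_num
    rw [e]
    exact h1) hy
  exact_mod_cast h

/-- **Under (3.3), all `y ≥ 1`**: `B(y) ≥ y/285`. [cite: RosserSchoenfeld1962, Theorem 2, eq. (3.3) (as input)] -/
theorem half_count_ge_allN_of_RS_285 (hRS : Literature.NumberTheory.LFunctions.RosserSchoenfeld1962_theorem2)
    {y : ℕ} (hy : 1 ≤ y) :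
    (y : ℝ) / 285 ≤ #{b ∈ Ioc 0 y | b ∈ (({0, 1} : Set ℕ) ∪ {m | ∃ p q : ℕ, p.Prime ∧ q.Prime ∧ p + q = 2 * m})} := by
  have h := half_count_ge_allN (h := 285) (by norm_num) (fun x hx => by
    have h1 := goldbach_even_count_ge_of_RS_570 hRS hx
    have e : (x : ℝ) / (2 * ((285 : ℕ) : ℝ)) = (x : ℝ) / 570 := by norm_num
    rw [e]
    exact h1) hy
  exact_mod_cast h

/-- **The halved density**: `σ({0, 1} ∪ {m : 2m = p + q}) ≥ 1/395`, unconditionally. [cite: Nathanson1996, Theorem 7.8 (explicit constant for the halved set proved here)] -/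
theorem schnirelmannDensity_half_ge_395 :
    (1 : ℝ) / 395 ≤ schnirelmannDensity
      (({0, 1} : Set ℕ) ∪ {m | ∃ p q : ℕ, p.Prime ∧ q.Prime ∧ p + q = 2 * m}) := by
  have h := schnirelmannDensity_ge_of_count' (K := 395)
    (S := ({0, 1} : Set ℕ) ∪ {m | ∃ p q : ℕ, p.Prime ∧ q.Prime ∧ p + q = 2 * m})
    (fun N hN => by have := half_count_ge_allN_395 hN; exact_mod_cast this)
  exact_mod_cast h

/-- **The halved density under (3.3)**: `≥ 1/285`. [cite: RosserSchoenfeld1962, Theorem 2, eq. (3.3) (as input)] -/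
theorem schnirelmannDensity_half_ge_of_RS_285
    (hRS : Literature.NumberTheory.LFunctions.RosserSchoenfeld1962_theorem2) :
    (1 : ℝ) / 285 ≤ schnirelmannDensity
      (({0, 1} : Set ℕ) ∪ {m | ∃ p q : ℕ, p.Prime ∧ q.Prime ∧ p + q = 2 * m}) := by
  have h := schnirelmannDensity_ge_of_count' (K := 285)
    (S := ({0, 1} : Set ℕ) ∪ {m | ∃ p q : ℕ, p.Prime ∧ q.Prime ∧ p + q = 2 * m})
    (fun N hN => by have := half_count_ge_allN_of_RS_285 hRS hN; exact_mod_cast this)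
  exact_mod_cast h

/-- ★★★ **The Shnirel'man–Goldbach theorem, explicit and unconditional — the best constant of this file: every
integer `N ≥ 2` is a sum of at most `791` primes** (`σ({0,1} ∪ {m : 2m = p+q}) ≥ 1/395` from Chebyshev's `0.9212`,
the explicit Selberg bound `17.1`, the weighted mean square `0.4431`; Mann: `395 • B = ℕ`; doubling: `2·395 + 1`).
No hypotheses, no named facts. [cite: Nathanson1996, Thm 7.9 (explicit constant proved here)] -/
theorem schnirelmann_goldbach_le_791 (N : ℕ) (hN : 2 ≤ N) :
    ∃ M : Multiset ℕ, (∀ p ∈ M, p.Prime) ∧ Multiset.card M ≤ 791 ∧ M.sum = N := by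
  have hσ : (1 : ℝ) / ((395 : ℕ) : ℝ) ≤ schnirelmannDensity
      (({0, 1} : Set ℕ) ∪ {m | ∃ p q : ℕ, p.Prime ∧ q.Prime ∧ p + q = 2 * m}) := by
    have := schnirelmannDensity_half_ge_395
    exact_mod_cast this
  exact sum_of_primes_of_half_density_mann (h := 395) (by norm_num) hσ N hN

/-- ★ **Under Rosser–Schoenfeld (3.3): every integer `N ≥ 2` is a sum of at most `571` primes** (`σ(B) ≥ 1/285`).
[cite: RosserSchoenfeld1962, Theorem 2, eq. (3.3) (as input)] -/
theorem schnirelmann_goldbach_of_RS_le_571 (hRS : Literature.NumberTheory.LFunctions.RosserSchoenfeld1962_theorem2)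
    (N : ℕ) (hN : 2 ≤ N) :
    ∃ M : Multiset ℕ, (∀ p ∈ M, p.Prime) ∧ Multiset.card M ≤ 571 ∧ M.sum = N := by
  have hσ : (1 : ℝ) / ((285 : ℕ) : ℝ) ≤ schnirelmannDensity
      (({0, 1} : Set ℕ) ∪ {m | ∃ p q : ℕ, p.Prime ∧ q.Prime ∧ p + q = 2 * m}) := by
    have := schnirelmannDensity_half_ge_of_RS_285 hRS
    exact_mod_cast this
  exact sum_of_primes_of_half_density_mann (h := 285) (by norm_num) hσ N hN


/-! ## §12 The threshold (ROUND-27): `A = 13.88` at `Λ = 226` from the tree's GENERIC explicit large-sieve step;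
`S₂ ≤ 89.9·x³/log⁴x` for `x ≥ e^228`; `σ(B) ≥ 1/250`; every `N ≥ 2` is a sum of at most `501` primes (RS (3.3): `379`)

The tree's `TwoResidueSelbergExplicit.explicit_of_largeSieve_kappa` is generic in the threshold `Λ` and the constant `A`:
`r(N) ≤ A·f(N)·N/log²N` for even `N ≥ e^Λ` as soon as `17L² ≤ 16(A − 0.02)·TlowK(L/2 − 1.38632)` for `L ≥ Λ`, and
`A(Λ) ↘ 13.2` (`A(47) = 17.1` is the tree's `goldbachCount_le_kappa`).  The C–S count is needed only above a threshold
`e^{Λ₀}` that the all-`y` glue tolerates up to `Λ₀ ≤ 0.9212·h` (primes `p ∈ B`), so ONE input is varied: the threshold,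
`e^100 → e^228` (`A(226) = 13.88`, `(L/(L−2))⁴ ≤ 1.036`), everything else (`0.9212`, `0.4431`, halving, Mann) untouched:
`S₂ ≤ (13.88²·0.4431·1.036 + 0.965·1.036 + 0.387)·x³/log⁴x ≤ 89.9·x³/log⁴x`, `(0.4242)²/89.9 ≥ 1/500`, `h = 250`, `K = 501`. -/

/-- `f(n) ≥ 1`. [folklore] -/
private theorem one_le_oddSingularFactor' (n : ℕ) : 1 ≤ oddSingularFactor n := by
  unfold oddSingularFactor
  have h : ∏ _p ∈ n.primeFactors.filter (2 < ·), (1 : ℝ)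
      ≤ ∏ p ∈ n.primeFactors.filter (2 < ·), (((p : ℝ) - 1) / ((p : ℝ) - 2)) := by
    refine Finset.prod_le_prod (fun _ _ => zero_le_one) fun p hp => ?_
    rw [Finset.mem_filter] at hp
    have hp3 : (3 : ℝ) ≤ p := by exact_mod_cast hp.2
    rw [le_div_iff₀ (by linarith)]
    linarith
  simpa using h

/-- **The tree's generic large-sieve step, packaged**: if `Λ ≥ 47` and `17L² ≤ 16(A − 0.02)·TlowK(L/2 − 1.38632)` for all
`L ≥ Λ`, then `r(N) ≤ A·f(N)·N/log²N` for every even `N ≥ e^Λ`.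
[cite: BatemanDiamond2004, Thm 13.8, §13.4–13.5 pp. 325–328 (explicit form: the tree's `explicit_of_largeSieve_kappa`)] -/
theorem goldbachCount_le_of_numeric {Λ A : ℝ} (hΛ : 47 ≤ Λ)
    (hnum : ∀ L : ℝ, Λ ≤ L → 17 * L ^ 2 ≤ 16 * (A - 0.02) * TwoResidueSelbergExplicit.TlowK (L / 2 - 1.38632))
    {N : ℕ} (hN : Real.exp Λ ≤ (N : ℝ)) (heven : Even N) :
    (SingularSeries.goldbachCount N : ℝ) ≤ A * oddSingularFactor N * (N : ℝ) / Real.log (N : ℝ) ^ 2 := by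
  have hN47 : Real.exp 47 ≤ (N : ℝ) := (Real.exp_le_exp.mpr hΛ).trans hN
  have hN16 : 16 ≤ N := by
    have h48 : (48 : ℝ) ≤ Real.exp 47 := by have := Real.add_one_le_exp (47 : ℝ); linarith
    have : (16 : ℝ) ≤ N := by linarith
    exact_mod_cast this
  have hX1 : 1 ≤ Nat.sqrt N / 4 := by
    have h4 : 4 ≤ Nat.sqrt N := Nat.le_sqrt.mpr (by omega)
    omega
  have hBD := GoldbachSieveEight.goldbachCount_mul_Qsum_le N (Nat.sqrt N / 4) heven hX1
  have hprod : (∏ p ∈ (N.primeFactors.filter (2 < ·)), (((p : ℝ) - 1) / ((p : ℝ) - 2)))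
      = oddSingularFactor N := rfl
  rw [hprod] at hBD
  exact TwoResidueSelbergExplicit.explicit_of_largeSieve_kappa (Λ := Λ) (by linarith) hnum hN
    (one_le_oddSingularFactor' _) (by linarith) hBD

/-- Numerics at `Λ = 226`: `17L² ≤ 16·13.86·TlowK(L/2 − 1.38632)` for `L ≥ 226`. [folklore] -/
private theorem kappa_numeric_226 {L : ℝ} (hL : 226 ≤ L) :
    17 * L ^ 2 ≤ 16 * (13.88 - 0.02) * TwoResidueSelbergExplicit.TlowK (L / 2 - 1.38632) := by
  unfold TwoResidueSelbergExplicit.TlowK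
  nlinarith [hL, mul_self_nonneg (L - 226)]

/-- Numerics at `Λ = 168`: `17L² ≤ 16·14.11·TlowK(L/2 − 1.38632)` for `L ≥ 168`. [folklore] -/
private theorem kappa_numeric_168 {L : ℝ} (hL : 168 ≤ L) :
    17 * L ^ 2 ≤ 16 * (14.13 - 0.02) * TwoResidueSelbergExplicit.TlowK (L / 2 - 1.38632) := by
  unfold TwoResidueSelbergExplicit.TlowK
  nlinarith [hL, mul_self_nonneg (L - 168)]

/-- **`A = 13.88`**: `r(N) ≤ 13.88·f(N)·N/log²N` for even `N ≥ e^226`. [cite: BatemanDiamond2004, §13.4 (13.13)–(13.14)] -/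
theorem goldbachCount_le_1388 {N : ℕ} (hN : Real.exp 226 ≤ (N : ℝ)) (heven : Even N) :
    (SingularSeries.goldbachCount N : ℝ) ≤ 13.88 * oddSingularFactor N * (N : ℝ) / Real.log (N : ℝ) ^ 2 :=
  goldbachCount_le_of_numeric (by norm_num) (fun _ hL => kappa_numeric_226 hL) hN heven

/-- **`A = 14.13`**: `r(N) ≤ 14.13·f(N)·N/log²N` for even `N ≥ e^168`. [cite: BatemanDiamond2004, §13.4 (13.13)–(13.14)] -/
theorem goldbachCount_le_1413 {N : ℕ} (hN : Real.exp 168 ≤ (N : ℝ)) (heven : Even N) :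
    (SingularSeries.goldbachCount N : ℝ) ≤ 14.13 * oddSingularFactor N * (N : ℝ) / Real.log (N : ℝ) ^ 2 :=
  goldbachCount_le_of_numeric (by norm_num) (fun _ hL => kappa_numeric_168 hL) hN heven

/-- **Second moment, generic in the threshold** (§10(c) with the constants as parameters): if `r(N) ≤ A·f(N)·N/log²N`
for even `N ≥ e^{Λ₀−2}`, `L⁴ ≤ κ(L−2)⁴` for `L ≥ Λ₀ ≥ 100`, and `A²·0.4431·κ + 0.965·κ + 0.387 ≤ c`, then
`Σ_{N≤x} r(N)² ≤ c·x³/log⁴x` for `x ≥ e^{Λ₀}` (main block `N > x/e²` with `A`, the block `e^47 ≤ N ≤ x/e²` with the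
tree's `17.1` and `Σ_{even N ≤ x/e²} f² ≤ 1.329·x/e²`, the rest `≤ 0.387`). [cite: Nathanson1996, Thm 7.7 (explicit form proved here)] -/
theorem sum_goldbachCount_sq_le_gen {Λ₀ A κ c : ℝ} (hΛ₀ : 100 ≤ Λ₀) (hA0 : 0 ≤ A)
    (hA : ∀ N : ℕ, Real.exp (Λ₀ - 2) ≤ (N : ℝ) → Even N →
      (SingularSeries.goldbachCount N : ℝ) ≤ A * oddSingularFactor N * (N : ℝ) / Real.log (N : ℝ) ^ 2)
    (hκ : ∀ L : ℝ, Λ₀ ≤ L → L ^ 4 ≤ κ * (L - 2) ^ 4)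
    (hc : A ^ 2 * 0.4431 * κ + 0.965 * κ + 0.387 ≤ c)
    {x : ℕ} (hx : Real.exp Λ₀ ≤ (x : ℝ)) :
    ∑ N ∈ range (x + 1), (SingularSeries.goldbachCount N : ℝ) ^ 2 ≤ c * (x : ℝ) ^ 3 / Real.log x ^ 4 := by
  have hx100 : Real.exp 100 ≤ (x : ℝ) := (Real.exp_le_exp.mpr hΛ₀).trans hx
  have hx1 : (1 : ℝ) < x := lt_of_lt_of_le (by have := Real.add_one_le_exp (100 : ℝ); linarith) hx100
  have hx0 : (0 : ℝ) < x := by linarith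
  set L := Real.log x with hL_def
  have hL100 : 100 ≤ L := by
    have := Real.log_le_log (Real.exp_pos 100) hx100
    rwa [Real.log_exp] at this
  have hLΛ : Λ₀ ≤ L := by
    have := Real.log_le_log (Real.exp_pos Λ₀) hx
    rwa [Real.log_exp] at this
  have hL : 0 < L := by linarith
  set Lq := L ^ 4 with hLq_def
  have hLq0 : 0 < Lq := by positivity
  have hL2 : 0 < L - 2 := by linarith
  have hk : Lq ≤ κ * (L - 2) ^ 4 := hκ L hLΛ
  have hκ0 : 0 ≤ κ := by
    by_contra hneg
    rw [not_le] at hneg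
    have : κ * (L - 2) ^ 4 < 0 := mul_neg_of_neg_of_pos hneg (by positivity)
    linarith
  set P : ℕ → Prop := fun N => Even N ∧ Real.exp 47 ≤ (N : ℝ) with hP
  rw [← sum_filter_add_sum_filter_not (range (x + 1)) P]
  -- the rest: each term `≤ (2e^47)²`, at most `x + 1` terms (as in §4, §10)
  have hrest : ∑ N ∈ (range (x + 1)).filter (fun N => ¬P N),
      (SingularSeries.goldbachCount N : ℝ) ^ 2 ≤ 0.387 * (x : ℝ) ^ 3 / Lq := by
    have hsum : ∑ N ∈ (range (x + 1)).filter (fun N => ¬P N),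
        (SingularSeries.goldbachCount N : ℝ) ^ 2 ≤ ((x : ℝ) + 1) * (2 * Real.exp 47) ^ 2 := by
      have h47 : (1 : ℝ) ≤ Real.exp 47 := by have := Real.add_one_le_exp (47 : ℝ); linarith
      have hterm : ∀ N ∈ (range (x + 1)).filter (fun N => ¬P N),
          (SingularSeries.goldbachCount N : ℝ) ^ 2 ≤ (2 * Real.exp 47) ^ 2 := by
        intro N hN
        rw [mem_filter] at hN
        have hr0 : (0 : ℝ) ≤ SingularSeries.goldbachCount N := Nat.cast_nonneg _
        apply pow_le_pow_left₀ hr0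
        rcases Nat.even_or_odd N with hev | hodd
        · have hlt : (N : ℝ) < Real.exp 47 := by
            by_contra h
            exact hN.2 ⟨hev, not_lt.mp h⟩
          have h1 : (SingularSeries.goldbachCount N : ℝ) ≤ N + 1 := by
            exact_mod_cast goldbachCount_le_succ N
          linarith
        · have h1 : (SingularSeries.goldbachCount N : ℝ) ≤ 2 := by
            exact_mod_cast goldbachCount_le_two_of_odd hodd
          linarith
      calc _ ≤ ∑ N ∈ (range (x + 1)).filter (fun N => ¬P N), (2 * Real.exp 47) ^ 2 := sum_le_sum hterm
        _ = #((range (x + 1)).filter (fun N => ¬P N)) * (2 * Real.exp 47) ^ 2 := by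
            rw [sum_const, nsmul_eq_mul]
        _ ≤ ((x : ℝ) + 1) * (2 * Real.exp 47) ^ 2 := by
            apply mul_le_mul_of_nonneg_right _ (by positivity)
            have : #((range (x + 1)).filter (fun N => ¬P N)) ≤ x + 1 :=
              (card_filter_le _ _).trans (by rw [card_range])
            exact_mod_cast this
    have hsqrt : Real.exp 50 ≤ Real.sqrt x := by
      apply Real.le_sqrt_of_sq_le
      rw [← Real.exp_nat_mul]
      norm_num
      exact hx100
    have hLq : Lq ≤ 4096 * Real.sqrt x := log_pow_four_le_sqrt hx1.le
    have hxx : Real.sqrt x * Real.sqrt x = x := Real.mul_self_sqrt hx0.le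
    have he : (2.7 : ℝ) ≤ Real.exp 1 := by have := Real.exp_one_gt_d9; linarith
    have he56 : (100000 : ℝ) ≤ Real.exp 56 := by
      have h1 := pow_le_pow_left₀ (by norm_num) he 56
      rw [← Real.exp_nat_mul] at h1
      norm_num at h1
      have h2 : (100000 : ℝ) ≤ (2.7 : ℝ) ^ 56 := by norm_num
      linarith
    have h94 : (2 * Real.exp 47) ^ 2 = 4 * Real.exp 94 := by
      rw [mul_pow, ← Real.exp_nat_mul]; norm_num
    have h100 : Real.exp 100 = Real.exp 44 * Real.exp 56 := by rw [← Real.exp_add]; norm_num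
    have h94' : Real.exp 94 = Real.exp 44 * Real.exp 50 := by rw [← Real.exp_add]; norm_num
    have e44 : 0 < Real.exp 44 := Real.exp_pos 44
    have hkey : ((x : ℝ) + 1) * (2 * Real.exp 47) ^ 2 * Lq ≤ 0.387 * (x : ℝ) ^ 3 := by
      rw [h94]
      have h1 : Real.exp 50 * Real.sqrt x ≤ x := by
        calc Real.exp 50 * Real.sqrt x ≤ Real.sqrt x * Real.sqrt x :=
              mul_le_mul_of_nonneg_right hsqrt (Real.sqrt_nonneg x)
          _ = x := hxx
      calc ((x : ℝ) + 1) * (4 * Real.exp 94) * Lq ≤ (2 * x) * (4 * Real.exp 94) * (4096 * Real.sqrt x) :=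
            mul_le_mul (mul_le_mul_of_nonneg_right (by linarith) (by positivity)) hLq hLq0.le (by positivity)
        _ = 32768 * Real.exp 44 * x * (Real.exp 50 * Real.sqrt x) := by rw [h94']; ring
        _ ≤ 32768 * Real.exp 44 * x * x := mul_le_mul_of_nonneg_left h1 (by positivity)
        _ ≤ 0.387 * (Real.exp 44 * Real.exp 56) * x * x := by
            have h2 : 32768 * Real.exp 44 ≤ 0.387 * (Real.exp 44 * Real.exp 56) := by nlinarith
            have hxx0 : (0 : ℝ) ≤ x * x := by positivity
            nlinarith
        _ = 0.387 * Real.exp 100 * ((x : ℝ) * x) := by rw [h100]; ring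
        _ ≤ 0.387 * x * ((x : ℝ) * x) := by
            apply mul_le_mul_of_nonneg_right _ (by positivity)
            exact mul_le_mul_of_nonneg_left hx100 (by norm_num)
        _ = 0.387 * (x : ℝ) ^ 3 := by ring
    rw [le_div_iff₀ hLq0]
    exact (mul_le_mul_of_nonneg_right hsum hLq0.le).trans hkey
  -- the main part, split at `x/e²`
  set Q : ℕ → Prop := fun N => (x : ℝ) < Real.exp 2 * N with hQ
  have hkappa : ∀ N : ℕ, ∀ {A' B : ℝ}, 0 ≤ A' →
      (SingularSeries.goldbachCount N : ℝ) ≤ A' * oddSingularFactor N * (N : ℝ) / Real.log (N : ℝ) ^ 2 →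
      (N : ℝ) / Real.log (N : ℝ) ^ 2 ≤ B → 0 ≤ B →
      (SingularSeries.goldbachCount N : ℝ) ^ 2 ≤ A' ^ 2 * oddSingularFactor N ^ 2 * B ^ 2 := by
    intro N A' B hA' hk hB hB0
    have hf := oddSingularFactor_nonneg N
    have h1 : (SingularSeries.goldbachCount N : ℝ) ≤ A' * oddSingularFactor N * B := by
      calc (SingularSeries.goldbachCount N : ℝ)
          ≤ A' * oddSingularFactor N * (N : ℝ) / Real.log (N : ℝ) ^ 2 := hk
        _ = A' * oddSingularFactor N * ((N : ℝ) / Real.log (N : ℝ) ^ 2) := by ring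
        _ ≤ _ := mul_le_mul_of_nonneg_left hB (mul_nonneg hA' hf)
    have h0 : (0 : ℝ) ≤ SingularSeries.goldbachCount N := Nat.cast_nonneg _
    calc (SingularSeries.goldbachCount N : ℝ) ^ 2 ≤ (A' * oddSingularFactor N * B) ^ 2 := pow_le_pow_left₀ h0 h1 2
      _ = _ := by ring
  have heΛ : Real.exp (Λ₀ - 2) * Real.exp 2 = Real.exp Λ₀ := by rw [← Real.exp_add]; ring_nf
  -- C: `N > x/e²`
  have hC : ∑ N ∈ ((range (x + 1)).filter P).filter Q, (SingularSeries.goldbachCount N : ℝ) ^ 2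
      ≤ A ^ 2 / (L - 2) ^ 4 * (0.4431 * (x : ℝ) ^ 3) := by
    have hterm : ∀ N ∈ ((range (x + 1)).filter P).filter Q, (SingularSeries.goldbachCount N : ℝ) ^ 2
        ≤ A ^ 2 / (L - 2) ^ 4 * ((N : ℝ) ^ 2 * oddSingularFactor N ^ 2) := by
      intro N hN
      rw [mem_filter, mem_filter] at hN
      obtain ⟨⟨_, hPN⟩, hQN⟩ := hN
      have hN0 : (0 : ℝ) < N := lt_of_lt_of_le (Real.exp_pos 47) hPN.2
      have hQN' : (x : ℝ) < Real.exp 2 * N := hQN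
      have hNΛ : Real.exp (Λ₀ - 2) ≤ (N : ℝ) := by
        have he2 := Real.exp_pos 2
        have h3 : Real.exp (Λ₀ - 2) * Real.exp 2 < (N : ℝ) * Real.exp 2 := by rw [heΛ]; linarith
        exact le_of_lt (lt_of_mul_lt_mul_right h3 he2.le)
      have hlogN : L - 2 ≤ Real.log (N : ℝ) := by
        have h1 : Real.log (x : ℝ) < Real.log (Real.exp 2 * N) := Real.log_lt_log hx0 hQN'
        rw [Real.log_mul (ne_of_gt (Real.exp_pos 2)) (ne_of_gt hN0), Real.log_exp] at h1
        linarith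
      have hB : (N : ℝ) / Real.log (N : ℝ) ^ 2 ≤ (N : ℝ) / (L - 2) ^ 2 := by
        apply div_le_div_of_nonneg_left hN0.le (by positivity)
        exact pow_le_pow_left₀ hL2.le hlogN 2
      have h := hkappa N hA0 (hA N hNΛ hPN.1) hB (by positivity)
      calc _ ≤ _ := h
        _ = A ^ 2 / (L - 2) ^ 4 * ((N : ℝ) ^ 2 * oddSingularFactor N ^ 2) := by
            rw [div_pow, ← pow_mul]
            ring
    calc _ ≤ ∑ N ∈ ((range (x + 1)).filter P).filter Q,
          A ^ 2 / (L - 2) ^ 4 * ((N : ℝ) ^ 2 * oddSingularFactor N ^ 2) := sum_le_sum hterm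
      _ = A ^ 2 / (L - 2) ^ 4 * ∑ N ∈ ((range (x + 1)).filter P).filter Q,
          (N : ℝ) ^ 2 * oddSingularFactor N ^ 2 := by rw [mul_sum]
      _ ≤ A ^ 2 / (L - 2) ^ 4 * ∑ N ∈ (Ioc 0 x).filter Even, (N : ℝ) ^ 2 * oddSingularFactor N ^ 2 := by
          apply mul_le_mul_of_nonneg_left _ (by positivity)
          apply sum_le_sum_of_subset_of_nonneg
          · intro N hN
            rw [mem_filter, mem_filter, mem_range] at hN
            obtain ⟨⟨hNx, hPN⟩, _⟩ := hN
            rw [mem_filter, mem_Ioc]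
            have hN0 : (0 : ℝ) < N := lt_of_lt_of_le (Real.exp_pos 47) hPN.2
            have hN0' : 0 < N := by exact_mod_cast hN0
            exact ⟨⟨hN0', by omega⟩, hPN.1⟩
          · intro N _ _
            positivity
      _ ≤ A ^ 2 / (L - 2) ^ 4 * (0.4431 * (x : ℝ) ^ 3) :=
          mul_le_mul_of_nonneg_left (sum_even_sq_mul_oddSingularFactor_sq_le hx100) (by positivity)
  -- B: `e^47 ≤ N ≤ x/e²` (the tree's `17.1`)
  set y : ℝ := (x : ℝ) / Real.exp 2 with hy
  have hy0 : 0 < y := by positivity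
  have hlogy : Real.log y = L - 2 := by
    rw [hy, Real.log_div (ne_of_gt hx0) (ne_of_gt (Real.exp_pos 2)), Real.log_exp]
  have hB : ∑ N ∈ ((range (x + 1)).filter P).filter (fun N => ¬Q N), (SingularSeries.goldbachCount N : ℝ) ^ 2
      ≤ 292.41 * (y ^ 2 / (L - 2) ^ 4) * (1.329 * y) := by
    have hterm : ∀ N ∈ ((range (x + 1)).filter P).filter (fun N => ¬Q N),
        (SingularSeries.goldbachCount N : ℝ) ^ 2 ≤ 292.41 * (y ^ 2 / (L - 2) ^ 4) * oddSingularFactor N ^ 2 := by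
      intro N hN
      rw [mem_filter, mem_filter] at hN
      obtain ⟨⟨_, hPN⟩, hQN⟩ := hN
      have hNy : (N : ℝ) ≤ y := by
        rw [hy, le_div_iff₀ (Real.exp_pos 2)]
        have hQN' : Real.exp 2 * (N : ℝ) ≤ x := not_lt.mp hQN
        linarith
      have he2 : Real.exp 2 ≤ (N : ℝ) := le_trans (Real.exp_le_exp.mpr (by norm_num)) hPN.2
      have hmono := div_log_sq_mono he2 hNy
      rw [hlogy] at hmono
      have h := hkappa N (by norm_num : (0 : ℝ) ≤ 17.1)
        (TwoResidueSelbergExplicit.goldbachCount_le_kappa hPN.2 hPN.1) hmono (by positivity)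
      calc _ ≤ _ := h
        _ = _ := by
            rw [div_pow, ← pow_mul]
            ring
    have hsubB : ((range (x + 1)).filter P).filter (fun N => ¬Q N) ⊆ (Ioc 0 ⌊y⌋₊).filter Even := by
      intro N hN
      rw [mem_filter, mem_filter, mem_range] at hN
      obtain ⟨⟨hNx, hPN⟩, hQN⟩ := hN
      have hNy : (N : ℝ) ≤ y := by
        rw [hy, le_div_iff₀ (Real.exp_pos 2)]
        have hQN' : Real.exp 2 * (N : ℝ) ≤ x := not_lt.mp hQN
        linarith
      rw [mem_filter, mem_Ioc]
      have hN0 : (0 : ℝ) < N := lt_of_lt_of_le (Real.exp_pos 47) hPN.2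
      have hN0' : 0 < N := by exact_mod_cast hN0
      exact ⟨⟨hN0', Nat.le_floor hNy⟩, hPN.1⟩
    have hfy : ∑ N ∈ ((range (x + 1)).filter P).filter (fun N => ¬Q N), oddSingularFactor N ^ 2 ≤ 1.329 * y := by
      calc _ ≤ ∑ N ∈ (Ioc 0 ⌊y⌋₊).filter Even, oddSingularFactor N ^ 2 :=
            sum_le_sum_of_subset_of_nonneg hsubB fun N _ _ => by positivity
        _ ≤ 1.329 * (⌊y⌋₊ : ℝ) := sum_even_oddSingularFactor_sq_le ⌊y⌋₊
        _ ≤ 1.329 * y := mul_le_mul_of_nonneg_left (Nat.floor_le hy0.le) (by norm_num)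
    calc _ ≤ ∑ N ∈ ((range (x + 1)).filter P).filter (fun N => ¬Q N),
          292.41 * (y ^ 2 / (L - 2) ^ 4) * oddSingularFactor N ^ 2 := sum_le_sum hterm
      _ = 292.41 * (y ^ 2 / (L - 2) ^ 4) *
          ∑ N ∈ ((range (x + 1)).filter P).filter (fun N => ¬Q N), oddSingularFactor N ^ 2 := by rw [mul_sum]
      _ ≤ _ := mul_le_mul_of_nonneg_left hfy (by positivity)
  -- numerics for B: `y³ = x³/e⁶`, `e⁶ ≥ 403`
  have he6 : (403 : ℝ) ≤ Real.exp 6 := by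
    have he : (2.7182818283 : ℝ) ≤ Real.exp 1 := Real.exp_one_gt_d9.le
    have h6 : (2.7182818283 : ℝ) ^ 6 ≤ Real.exp 6 := by
      rw [show (6 : ℝ) = ((6 : ℕ) : ℝ) * 1 by norm_num, Real.exp_nat_mul]
      exact pow_le_pow_left₀ (by norm_num) he 6
    exact le_trans (by norm_num) h6
  have hy3 : y ^ 3 * Real.exp 6 = (x : ℝ) ^ 3 := by
    rw [hy, div_pow, show Real.exp 6 = Real.exp 2 ^ 3 by rw [← Real.exp_nat_mul]; norm_num]
    field_simp
  have hB' : 292.41 * (y ^ 2 / (L - 2) ^ 4) * (1.329 * y) ≤ 0.965 / (L - 2) ^ 4 * (x : ℝ) ^ 3 := by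
    rw [← hy3]
    have e1 : 292.41 * (y ^ 2 / (L - 2) ^ 4) * (1.329 * y) = (388.61289 * y ^ 3) / (L - 2) ^ 4 := by
      field_simp
      ring
    have e2 : 0.965 / (L - 2) ^ 4 * (y ^ 3 * Real.exp 6) = (0.965 * Real.exp 6 * y ^ 3) / (L - 2) ^ 4 := by
      field_simp
    rw [e1, e2]
    apply div_le_div_of_nonneg_right _ (by positivity)
    have hy30 : (0 : ℝ) ≤ y ^ 3 := by positivity
    nlinarith
  -- assemble the main part
  have hmain : ∑ N ∈ (range (x + 1)).filter P, (SingularSeries.goldbachCount N : ℝ) ^ 2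
      ≤ (A ^ 2 * 0.4431 + 0.965) * κ * (x : ℝ) ^ 3 / Lq := by
    rw [← sum_filter_add_sum_filter_not ((range (x + 1)).filter P) Q]
    have h1 : ∑ N ∈ ((range (x + 1)).filter P).filter Q, (SingularSeries.goldbachCount N : ℝ) ^ 2
        + ∑ N ∈ ((range (x + 1)).filter P).filter (fun N => ¬Q N), (SingularSeries.goldbachCount N : ℝ) ^ 2
        ≤ (A ^ 2 * 0.4431 + 0.965) / (L - 2) ^ 4 * (x : ℝ) ^ 3 := by
      have := add_le_add hC (hB.trans hB')
      have e : A ^ 2 / (L - 2) ^ 4 * (0.4431 * (x : ℝ) ^ 3) + 0.965 / (L - 2) ^ 4 * (x : ℝ) ^ 3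
          = (A ^ 2 * 0.4431 + 0.965) / (L - 2) ^ 4 * (x : ℝ) ^ 3 := by
        field_simp
      linarith
    have h2 : (A ^ 2 * 0.4431 + 0.965) / (L - 2) ^ 4 * (x : ℝ) ^ 3
        ≤ (A ^ 2 * 0.4431 + 0.965) * κ * (x : ℝ) ^ 3 / Lq := by
      rw [div_mul_eq_mul_div, div_le_div_iff₀ (by positivity) hLq0]
      have ha : (0 : ℝ) ≤ (A ^ 2 * 0.4431 + 0.965) * (x : ℝ) ^ 3 := by positivity
      calc (A ^ 2 * 0.4431 + 0.965) * (x : ℝ) ^ 3 * Lq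
          ≤ (A ^ 2 * 0.4431 + 0.965) * (x : ℝ) ^ 3 * (κ * (L - 2) ^ 4) := mul_le_mul_of_nonneg_left hk ha
        _ = _ := by ring
    exact h1.trans h2
  calc _ ≤ (A ^ 2 * 0.4431 + 0.965) * κ * (x : ℝ) ^ 3 / Lq + 0.387 * (x : ℝ) ^ 3 / Lq := add_le_add hmain hrest
    _ = ((A ^ 2 * 0.4431 * κ + 0.965 * κ + 0.387) * (x : ℝ) ^ 3) / Lq := by
        rw [← add_div]
        ring
    _ ≤ c * (x : ℝ) ^ 3 / Lq := by
        apply div_le_div_of_nonneg_right _ hLq0.le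
        exact mul_le_mul_of_nonneg_right hc (by positivity)

/-- `L⁴ ≤ 1.036·(L−2)⁴` for `L ≥ 228`. [folklore] -/
private theorem log_loss_228 {L : ℝ} (hL : 228 ≤ L) : L ^ 4 ≤ 1.036 * (L - 2) ^ 4 := by
  have hL0 : 0 ≤ L := by linarith
  have h1 : L ≤ 114 / 113 * (L - 2) := by linarith
  have h2 := pow_le_pow_left₀ hL0 h1 4
  rw [mul_pow] at h2
  have h3 : (0 : ℝ) ≤ (L - 2) ^ 4 := by positivity
  calc L ^ 4 ≤ (114 / 113 : ℝ) ^ 4 * (L - 2) ^ 4 := h2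
    _ ≤ 1.036 * (L - 2) ^ 4 := mul_le_mul_of_nonneg_right (by norm_num) h3

/-- `L⁴ ≤ 1.0486·(L−2)⁴` for `L ≥ 170`. [folklore] -/
private theorem log_loss_170 {L : ℝ} (hL : 170 ≤ L) : L ^ 4 ≤ 1.0486 * (L - 2) ^ 4 := by
  have hL0 : 0 ≤ L := by linarith
  have h1 : L ≤ 85 / 84 * (L - 2) := by linarith
  have h2 := pow_le_pow_left₀ hL0 h1 4
  rw [mul_pow] at h2
  have h3 : (0 : ℝ) ≤ (L - 2) ^ 4 := by positivity
  calc L ^ 4 ≤ (85 / 84 : ℝ) ^ 4 * (L - 2) ^ 4 := h2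
    _ ≤ 1.0486 * (L - 2) ^ 4 := mul_le_mul_of_nonneg_right (by norm_num) h3

/-- **Second moment, `89.9` above `e^228`**: `Σ_{N≤x} r(N)² ≤ 89.9·x³/log⁴x` for `x ≥ e^228`
(`13.88²·0.4431·1.036 + 0.965·1.036 + 0.387 = 89.83`). [cite: Nathanson1996, Thm 7.7 (explicit constant proved here)] -/
theorem sum_goldbachCount_sq_le_899 {x : ℕ} (hx : Real.exp 228 ≤ (x : ℝ)) :
    ∑ N ∈ range (x + 1), (SingularSeries.goldbachCount N : ℝ) ^ 2 ≤ 89.9 * (x : ℝ) ^ 3 / Real.log x ^ 4 :=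
  sum_goldbachCount_sq_le_gen (Λ₀ := 228) (A := 13.88) (κ := 1.036) (by norm_num) (by norm_num)
    (fun N hN hev => goldbachCount_le_1388 (by norm_num at hN ⊢; exact hN) hev)
    (fun _ hL => log_loss_228 hL) (by norm_num) hx

/-- **Second moment, `94.2` above `e^170`** (for the RS column): `Σ_{N≤x} r(N)² ≤ 94.2·x³/log⁴x` for `x ≥ e^170`
(`14.13²·0.4431·1.0486 + 0.965·1.0486 + 0.387 = 94.17`). [cite: Nathanson1996, Thm 7.7 (explicit constant proved here)] -/
theorem sum_goldbachCount_sq_le_942 {x : ℕ} (hx : Real.exp 170 ≤ (x : ℝ)) :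
    ∑ N ∈ range (x + 1), (SingularSeries.goldbachCount N : ℝ) ^ 2 ≤ 94.2 * (x : ℝ) ^ 3 / Real.log x ^ 4 :=
  sum_goldbachCount_sq_le_gen (Λ₀ := 170) (A := 14.13) (κ := 1.0486) (by norm_num) (by norm_num)
    (fun N hN hev => goldbachCount_le_1413 (by norm_num at hN ⊢; exact hN) hev)
    (fun _ hL => log_loss_170 hL) (by norm_num) hx

/-- **Even Cauchy–Schwarz, generic in the threshold** (§11 with `e^{Λ₀}`, `Λ₀ ≥ 100`, in place of `e^100`).
[cite: Nathanson1996, Thm 7.8 (proof, explicit form restricted to even N proved here)] -/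
theorem goldbach_even_count_ge_of_moments_gen {Λ₀ c₁ c₂ : ℝ} (hΛ₀ : 100 ≤ Λ₀) (hc₁ : 0.0001 ≤ c₁) (hc₂ : 0 < c₂)
    (hS₁ : ∀ x : ℕ, Real.exp Λ₀ ≤ (x : ℝ) →
      c₁ * ((x : ℝ) ^ 2 / Real.log x ^ 2) ≤ ∑ N ∈ range (x + 1), (SingularSeries.goldbachCount N : ℝ))
    (hS₂ : ∀ x : ℕ, Real.exp Λ₀ ≤ (x : ℝ) →
      ∑ N ∈ range (x + 1), (SingularSeries.goldbachCount N : ℝ) ^ 2 ≤ c₂ * (x : ℝ) ^ 3 / Real.log x ^ 4)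
    {x : ℕ} (hx : Real.exp Λ₀ ≤ (x : ℝ)) :
    (c₁ - 0.0001) ^ 2 / c₂ * (x : ℝ) ≤ #{N ∈ Ioc 0 x | Even N ∧ ∃ p q : ℕ, p.Prime ∧ q.Prime ∧ p + q = N} := by
  have hx100 : Real.exp 100 ≤ (x : ℝ) := (Real.exp_le_exp.mpr hΛ₀).trans hx
  have hx1 : (1 : ℝ) < x := lt_of_lt_of_le (by have := Real.add_one_le_exp (100 : ℝ); linarith) hx100
  have hx0 : (0 : ℝ) < x := by linarith
  have hlogx : 0 < Real.log x := Real.log_pos hx1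
  set r : ℕ → ℝ := fun N => (SingularSeries.goldbachCount N : ℝ) with hr
  set T : Finset ℕ := (range (x + 1)).filter fun N => Even N ∧ 0 < SingularSeries.goldbachCount N with hT
  have hsumT : ∑ N ∈ (range (x + 1)).filter Even, r N = ∑ N ∈ T, r N * 1 := by
    rw [hT]
    simp only [sum_filter]
    refine sum_congr rfl fun N _ => ?_
    by_cases he : Even N
    · by_cases h0 : 0 < SingularSeries.goldbachCount N
      · rw [if_pos he, if_pos ⟨he, h0⟩, mul_one]
      · rw [if_pos he, if_neg (fun h => h0 h.2), hr]
        simp only [not_lt, Nat.le_zero] at h0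
        simp [h0]
    · rw [if_neg he, if_neg (fun h => he h.1)]
  have hCS : (∑ N ∈ T, r N * 1) ^ 2 ≤ (∑ N ∈ T, r N ^ 2) * ∑ N ∈ T, (1 : ℝ) ^ 2 :=
    sum_mul_sq_le_sq_mul_sq T r fun _ => 1
  have hT1 : ∑ N ∈ T, (1 : ℝ) ^ 2 = #T := by simp
  have hTsq : ∑ N ∈ T, r N ^ 2 ≤ ∑ N ∈ range (x + 1), r N ^ 2 :=
    sum_le_sum_of_subset_of_nonneg (by rw [hT]; exact filter_subset _ _) fun N _ _ => by positivity
  have hTA : T ⊆ {N ∈ Ioc 0 x | Even N ∧ ∃ p q : ℕ, p.Prime ∧ q.Prime ∧ p + q = N} := by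
    intro N hN
    rw [hT, mem_filter, mem_range] at hN
    obtain ⟨hNx, he, hpos⟩ := hN
    unfold SingularSeries.goldbachCount at hpos
    obtain ⟨pq, hpq⟩ := card_pos.mp hpos
    rw [mem_filter, Finset.HasAntidiagonal.mem_antidiagonal] at hpq
    have hN2 : 2 ≤ N := by
      have := hpq.2.1.two_le
      omega
    rw [mem_filter, mem_Ioc]
    exact ⟨⟨by omega, by omega⟩, he, pq.1, pq.2, hpq.2.1, hpq.2.2, hpq.1⟩
  have hTcard : (#T : ℝ) ≤ #{N ∈ Ioc 0 x | Even N ∧ ∃ p q : ℕ, p.Prime ∧ q.Prime ∧ p + q = N} := by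
    exact_mod_cast card_le_card hTA
  have hsplit := sum_filter_add_sum_filter_not (range (x + 1)) Even r
  have hodd : ∑ N ∈ (range (x + 1)).filter (fun N => ¬Even N), r N ≤ 2 * ((x : ℝ) + 1) :=
    sum_goldbachCount_odd_le x
  have hsmall := two_mul_succ_le_small hx100
  have h76' : (c₁ - 0.0001) * ((x : ℝ) ^ 2 / Real.log x ^ 2) ≤ ∑ N ∈ (range (x + 1)).filter Even, r N := by
    have h76 := hS₁ x hx
    have e : (c₁ - 0.0001) * ((x : ℝ) ^ 2 / Real.log x ^ 2)
        = c₁ * ((x : ℝ) ^ 2 / Real.log x ^ 2) - 0.0001 * ((x : ℝ) ^ 2 / Real.log x ^ 2) := by ring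
    rw [e]
    linarith
  have h77 := hS₂ x hx
  have hc₁' : 0 ≤ c₁ - 0.0001 := by linarith
  set S₁ := ∑ N ∈ (range (x + 1)).filter Even, r N with hS₁_def
  set S₂ := ∑ N ∈ range (x + 1), r N ^ 2 with hS₂_def
  set Ax : ℝ := ((#{N ∈ Ioc 0 x | Even N ∧ ∃ p q : ℕ, p.Prime ∧ q.Prime ∧ p + q = N} : ℕ) : ℝ) with hAx
  have hmain : S₁ ^ 2 ≤ S₂ * Ax := by
    rw [hsumT]
    calc (∑ N ∈ T, r N * 1) ^ 2 ≤ (∑ N ∈ T, r N ^ 2) * #T := by rw [← hT1]; exact hCS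
      _ ≤ S₂ * Ax := mul_le_mul hTsq hTcard (by positivity) (sum_nonneg fun N _ => by positivity)
  have hAx0 : 0 ≤ Ax := by positivity
  have h1 : ((c₁ - 0.0001) * ((x : ℝ) ^ 2 / Real.log x ^ 2)) ^ 2 ≤ S₁ ^ 2 := pow_le_pow_left₀ (by positivity) h76' 2
  have h2 : S₂ * Ax ≤ c₂ * (x : ℝ) ^ 3 / Real.log x ^ 4 * Ax := mul_le_mul_of_nonneg_right h77 hAx0
  have hL4 : (0 : ℝ) < Real.log x ^ 4 := by positivity
  have h3 : (c₁ - 0.0001) ^ 2 * (x : ℝ) ^ 4 / Real.log x ^ 4 ≤ c₂ * (x : ℝ) ^ 3 / Real.log x ^ 4 * Ax := by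
    have e : ((c₁ - 0.0001) * ((x : ℝ) ^ 2 / Real.log x ^ 2)) ^ 2
        = (c₁ - 0.0001) ^ 2 * (x : ℝ) ^ 4 / Real.log x ^ 4 := by
      rw [mul_pow, div_pow]; ring
    rw [← e]
    exact h1.trans (hmain.trans h2)
  have h4 : (c₁ - 0.0001) ^ 2 * (x : ℝ) ^ 4 ≤ c₂ * (x : ℝ) ^ 3 * Ax := by
    have h := (div_le_iff₀ hL4).mp h3
    have e2 : c₂ * (x : ℝ) ^ 3 / Real.log x ^ 4 * Ax * Real.log x ^ 4 = c₂ * (x : ℝ) ^ 3 * Ax := by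
      field_simp
    linarith [h, e2]
  have h5 : (c₁ - 0.0001) ^ 2 * (x : ℝ) ≤ c₂ * Ax := by
    have hx3 : (0 : ℝ) < (x : ℝ) ^ 3 := by positivity
    have h : (x : ℝ) ^ 3 * ((c₁ - 0.0001) ^ 2 * x) ≤ (x : ℝ) ^ 3 * (c₂ * Ax) := by
      calc (x : ℝ) ^ 3 * ((c₁ - 0.0001) ^ 2 * x) = (c₁ - 0.0001) ^ 2 * (x : ℝ) ^ 4 := by ring
        _ ≤ c₂ * (x : ℝ) ^ 3 * Ax := h4
        _ = (x : ℝ) ^ 3 * (c₂ * Ax) := by ring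
    exact le_of_mul_le_mul_left h hx3
  calc (c₁ - 0.0001) ^ 2 / c₂ * (x : ℝ) = (c₁ - 0.0001) ^ 2 * x / c₂ := by ring
    _ ≤ Ax := by rw [div_le_iff₀ hc₂]; linarith

/-- **Unconditional, above `e^228`**: at least `x/500` EVEN Goldbach numbers in `(0, x]` (`0.4242²/89.9 = 1/499.6`). [cite: Nathanson1996, Theorem 7.8 (proof, restricted to even N; explicit form proved here)] -/
theorem goldbach_even_count_ge_500 {x : ℕ} (hx : Real.exp 228 ≤ (x : ℝ)) :
    (x : ℝ) / 500 ≤ #{N ∈ Ioc 0 x | Even N ∧ ∃ p q : ℕ, p.Prime ∧ q.Prime ∧ p + q = N} := by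
  have h := goldbach_even_count_ge_of_moments_gen (Λ₀ := 228) (c₁ := 0.4243) (c₂ := 89.9)
    (by norm_num) (by norm_num) (by norm_num)
    (fun y hy => sum_goldbachCount_ge_04243 ((Real.exp_le_exp.mpr (by norm_num)).trans hy))
    (fun y hy => sum_goldbachCount_sq_le_899 hy) hx
  have hx0 : (0 : ℝ) ≤ x := Nat.cast_nonneg x
  have hc : (1 : ℝ) / 500 ≤ (0.4243 - 0.0001) ^ 2 / 89.9 := by norm_num
  calc (x : ℝ) / 500 = 1 / 500 * x := by ring
    _ ≤ (0.4243 - 0.0001) ^ 2 / 89.9 * x := mul_le_mul_of_nonneg_right hc hx0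
    _ ≤ _ := h

/-- **Under (3.3), above `e^170`**: at least `x/378` EVEN Goldbach numbers in `(0, x]` (`0.4994²/94.2 = 1/377.7`).
[cite: RosserSchoenfeld1962, Theorem 2, eq. (3.3) (as input)] -/
theorem goldbach_even_count_ge_of_RS_378 (hRS : Literature.NumberTheory.LFunctions.RosserSchoenfeld1962_theorem2)
    {x : ℕ} (hx : Real.exp 170 ≤ (x : ℝ)) :
    (x : ℝ) / 378 ≤ #{N ∈ Ioc 0 x | Even N ∧ ∃ p q : ℕ, p.Prime ∧ q.Prime ∧ p + q = N} := by
  have h := goldbach_even_count_ge_of_moments_gen (Λ₀ := 170) (c₁ := 0.4995) (c₂ := 94.2)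
    (by norm_num) (by norm_num) (by norm_num)
    (fun y hy => sum_goldbachCount_ge_of_RS hRS ((Real.exp_le_exp.mpr (by norm_num)).trans hy))
    (fun y hy => sum_goldbachCount_sq_le_942 hy) hx
  have hx0 : (0 : ℝ) ≤ x := Nat.cast_nonneg x
  have hc : (1 : ℝ) / 378 ≤ (0.4995 - 0.0001) ^ 2 / 94.2 := by norm_num
  calc (x : ℝ) / 378 = 1 / 378 * x := by ring
    _ ≤ (0.4995 - 0.0001) ^ 2 / 94.2 * x := mul_le_mul_of_nonneg_right hc hx0
    _ ≤ _ := h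

/-- **All `y ≥ 1` for the halved set, generic in the threshold**: if `x/(2h) ≤ #{even N ∈ (0, x] : N = p + q}` for
`x ≥ e^{Λ₀}`, `Λ₀ ≤ 0.9212·h` and `h ≥ 56`, then `y/h ≤ B(y)` for every `y ≥ 1` (below `e^{Λ₀}/2` the primes
`p ≤ y` lie in `B`: `π(y) ≥ 0.9212·y/log y ≥ y/h` for `y ≥ 10^6`, `π(y) ≥ y/(4 log y) ≥ y/56` below). [cite: Nathanson1996, Theorem 7.8 (explicit constant for the halved set proved here)] -/
theorem half_count_ge_allN_gen {Λ₀ : ℝ} {h : ℕ} (h56 : 56 ≤ h) (hΛh : Λ₀ ≤ 0.9212 * h)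
    (hlarge : ∀ x : ℕ, Real.exp Λ₀ ≤ (x : ℝ) →
      (x : ℝ) / (2 * h) ≤ #{N ∈ Ioc 0 x | Even N ∧ ∃ p q : ℕ, p.Prime ∧ q.Prime ∧ p + q = N})
    {y : ℕ} (hy : 1 ≤ y) :
    (y : ℝ) / h ≤ #{b ∈ Ioc 0 y | b ∈ (({0, 1} : Set ℕ) ∪ {m | ∃ p q : ℕ, p.Prime ∧ q.Prime ∧ p + q = 2 * m})} := by
  set B : Set ℕ := ({0, 1} : Set ℕ) ∪ {m | ∃ p q : ℕ, p.Prime ∧ q.Prime ∧ p + q = 2 * m} with hB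
  have hhr : (56 : ℝ) ≤ h := by exact_mod_cast h56
  have hh0 : (0 : ℝ) < h := by linarith
  by_cases hbig : Real.exp Λ₀ ≤ ((2 * y : ℕ) : ℝ)
  · have h1 := hlarge (2 * y) hbig
    have h2 := even_goldbach_card_le_half y
    have e : ((2 * y : ℕ) : ℝ) / (2 * h) = (y : ℝ) / h := by
      push_cast
      field_simp
    rw [e] at h1
    exact h1.trans (by exact_mod_cast h2)
  rw [not_le] at hbig
  by_cases hsmall : y ≤ h
  · have h1 : 1 ≤ #{b ∈ Ioc 0 y | b ∈ B} :=
      card_pos.mpr ⟨1, by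
        rw [mem_filter, mem_Ioc]
        exact ⟨⟨by omega, hy⟩, Or.inl (by simp)⟩⟩
    have h1' : (1 : ℝ) ≤ #{b ∈ Ioc 0 y | b ∈ B} := by exact_mod_cast h1
    have h2 : (y : ℝ) / h ≤ 1 := by
      rw [div_le_one hh0]
      exact_mod_cast hsmall
    linarith
  rw [not_le] at hsmall
  have hP : #((range (y + 1)).filter Nat.Prime) ≤ #{b ∈ Ioc 0 y | b ∈ B} := card_le_card fun p hp => by
    rw [mem_filter, mem_range] at hp
    rw [mem_filter, mem_Ioc]
    exact ⟨⟨hp.2.pos, by omega⟩, Or.inr ⟨p, p, hp.2, hp.2, by ring⟩⟩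
  rw [card_filter_prime_range] at hP
  have hPr : (Nat.primeCounting y : ℝ) ≤ #{b ∈ Ioc 0 y | b ∈ B} := by exact_mod_cast hP
  refine le_trans ?_ hPr
  have hy1 : (1 : ℝ) < y := by exact_mod_cast (show 1 < y by omega)
  have hy0 : (0 : ℝ) < y := by linarith
  have hlogpos : 0 < Real.log y := Real.log_pos hy1
  have hlogy : Real.log y < Λ₀ := by
    have h2y : (y : ℝ) ≤ ((2 * y : ℕ) : ℝ) := by push_cast; linarith
    have := Real.log_lt_log hy0 (lt_of_le_of_lt h2y hbig)
    rwa [Real.log_exp] at this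
  by_cases h6 : 10 ^ 6 ≤ y
  · have hπ : 0.9212 * (y : ℝ) / Real.log (y : ℝ) ≤ (Nat.primeCounting y : ℝ) := by
      have := primeCountingLowerMul_09212
      unfold PrimeCountingLowerMul at this
      exact this y h6
    refine le_trans ?_ hπ
    rw [div_le_div_iff₀ hh0 hlogpos]
    have hlh : Real.log y ≤ 0.9212 * h := by linarith
    nlinarith [mul_le_mul_of_nonneg_left hlh hy0.le]
  · rw [not_le] at h6
    have hy32 : 32 ≤ y := by omega
    have hπ := ShnirelmanGoldbachTheorem.primeCounting_ge hy32
    have hlog14 : Real.log y ≤ 14 := by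
      have hy6 : (y : ℝ) ≤ (2.7 : ℝ) ^ 14 := by
        have : (y : ℝ) < 10 ^ 6 := by exact_mod_cast h6
        have h27 : (10 : ℝ) ^ 6 ≤ (2.7 : ℝ) ^ 14 := by norm_num
        linarith
      have he : (2.7 : ℝ) ≤ Real.exp 1 := by have := Real.exp_one_gt_d9; linarith
      have h14 : (2.7 : ℝ) ^ 14 ≤ Real.exp 14 := by
        rw [show (14 : ℝ) = ((14 : ℕ) : ℝ) * 1 by norm_num, Real.exp_nat_mul]
        exact pow_le_pow_left₀ (by norm_num) he 14
      have := Real.log_le_log hy0 (hy6.trans h14)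
      rwa [Real.log_exp] at this
    refine le_trans ?_ hπ
    apply div_le_div_of_nonneg_left hy0.le (by positivity)
    linarith

/-- **Unconditional count for all `y ≥ 1`**: `B(y) ≥ y/250`. [cite: Nathanson1996, Theorem 7.8 (explicit constant for the halved set proved here)] -/
theorem half_count_ge_allN_250 {y : ℕ} (hy : 1 ≤ y) :
    (y : ℝ) / 250 ≤ #{b ∈ Ioc 0 y | b ∈ (({0, 1} : Set ℕ) ∪ {m | ∃ p q : ℕ, p.Prime ∧ q.Prime ∧ p + q = 2 * m})} := by
  have h := half_count_ge_allN_gen (Λ₀ := 228) (h := 250) (by norm_num) (by norm_num)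
    (fun x hx => by
      have h1 := goldbach_even_count_ge_500 hx
      have e : (x : ℝ) / (2 * ((250 : ℕ) : ℝ)) = (x : ℝ) / 500 := by norm_num
      rw [e]
      exact h1) hy
  exact_mod_cast h

/-- **Under (3.3), all `y ≥ 1`**: `B(y) ≥ y/189`. [cite: RosserSchoenfeld1962, Theorem 2, eq. (3.3) (as input)] -/
theorem half_count_ge_allN_of_RS_189 (hRS : Literature.NumberTheory.LFunctions.RosserSchoenfeld1962_theorem2)
    {y : ℕ} (hy : 1 ≤ y) :
    (y : ℝ) / 189 ≤ #{b ∈ Ioc 0 y | b ∈ (({0, 1} : Set ℕ) ∪ {m | ∃ p q : ℕ, p.Prime ∧ q.Prime ∧ p + q = 2 * m})} := by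
  have h := half_count_ge_allN_gen (Λ₀ := 170) (h := 189) (by norm_num) (by norm_num)
    (fun x hx => by
      have h1 := goldbach_even_count_ge_of_RS_378 hRS hx
      have e : (x : ℝ) / (2 * ((189 : ℕ) : ℝ)) = (x : ℝ) / 378 := by norm_num
      rw [e]
      exact h1) hy
  exact_mod_cast h

/-- **The halved density, `1/250`**: `σ({0, 1} ∪ {m : 2m = p + q}) ≥ 1/250`, unconditionally. [cite: Nathanson1996, Theorem 7.8 (explicit constant for the halved set proved here)] -/
theorem schnirelmannDensity_half_ge_250 :
    (1 : ℝ) / 250 ≤ schnirelmannDensity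
      (({0, 1} : Set ℕ) ∪ {m | ∃ p q : ℕ, p.Prime ∧ q.Prime ∧ p + q = 2 * m}) := by
  have h := schnirelmannDensity_ge_of_count' (K := 250)
    (S := ({0, 1} : Set ℕ) ∪ {m | ∃ p q : ℕ, p.Prime ∧ q.Prime ∧ p + q = 2 * m})
    (fun N hN => by have := half_count_ge_allN_250 hN; exact_mod_cast this)
  exact_mod_cast h

/-- **The halved density under (3.3), `1/189`**. [cite: RosserSchoenfeld1962, Theorem 2, eq. (3.3) (as input)] -/
theorem schnirelmannDensity_half_ge_of_RS_189
    (hRS : Literature.NumberTheory.LFunctions.RosserSchoenfeld1962_theorem2) :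
    (1 : ℝ) / 189 ≤ schnirelmannDensity
      (({0, 1} : Set ℕ) ∪ {m | ∃ p q : ℕ, p.Prime ∧ q.Prime ∧ p + q = 2 * m}) := by
  have h := schnirelmannDensity_ge_of_count' (K := 189)
    (S := ({0, 1} : Set ℕ) ∪ {m | ∃ p q : ℕ, p.Prime ∧ q.Prime ∧ p + q = 2 * m})
    (fun N hN => by have := half_count_ge_allN_of_RS_189 hRS hN; exact_mod_cast this)
  exact_mod_cast h

/-- ★★★★ **The Shnirel'man–Goldbach theorem, explicit and unconditional — the best constant of this file: every
integer `N ≥ 2` is a sum of at most `501` primes** (`A = 13.88` at the threshold `e^226` from the tree's generic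
large-sieve step, Chebyshev's `0.9212`, the weighted mean square `0.4431`, halving, Mann: `250 • B = ℕ`, `2·250 + 1`).
No hypotheses, no named facts. [cite: Nathanson1996, Thm 7.9 (explicit constant proved here)] -/
theorem schnirelmann_goldbach_le_501 (N : ℕ) (hN : 2 ≤ N) :
    ∃ M : Multiset ℕ, (∀ p ∈ M, p.Prime) ∧ Multiset.card M ≤ 501 ∧ M.sum = N := by
  have hσ : (1 : ℝ) / ((250 : ℕ) : ℝ) ≤ schnirelmannDensity
      (({0, 1} : Set ℕ) ∪ {m | ∃ p q : ℕ, p.Prime ∧ q.Prime ∧ p + q = 2 * m}) := by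
    have := schnirelmannDensity_half_ge_250
    exact_mod_cast this
  exact sum_of_primes_of_half_density_mann (h := 250) (by norm_num) hσ N hN

/-- ★ **Under Rosser–Schoenfeld (3.3): every integer `N ≥ 2` is a sum of at most `379` primes** (`σ(B) ≥ 1/189`).
[cite: RosserSchoenfeld1962, Theorem 2, eq. (3.3) (as input)] -/
theorem schnirelmann_goldbach_of_RS_le_379 (hRS : Literature.NumberTheory.LFunctions.RosserSchoenfeld1962_theorem2)
    (N : ℕ) (hN : 2 ≤ N) :
    ∃ M : Multiset ℕ, (∀ p ∈ M, p.Prime) ∧ Multiset.card M ≤ 379 ∧ M.sum = N := by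
  have hσ : (1 : ℝ) / ((189 : ℕ) : ℝ) ≤ schnirelmannDensity
      (({0, 1} : Set ℕ) ∪ {m | ∃ p q : ℕ, p.Prime ∧ q.Prime ∧ p + q = 2 * m}) := by
    have := schnirelmannDensity_half_ge_of_RS_189 hRS
    exact_mod_cast this
  exact sum_of_primes_of_half_density_mann (h := 189) (by norm_num) hσ N hN

end Literature.NumberTheory.Sieve.ShnirelmanGoldbachExplicit
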